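import Literature.MathematicalPhysics.QuantumFieldTheory.Balaban1983to89.B9Thm314GFlatV1Transfer
import Literature.MathematicalPhysics.QuantumFieldTheory.Balaban1983to89.B6LapLegKLevelV1
import Literature.MathematicalPhysics.QuantumFieldTheory.Balaban1983to89.B6Ineq2140KLevelV1
import Literature.MathematicalPhysics.QuantumFieldTheory.Balaban1983to89.B6GEDVaTransposeV1

/-!
# `Balaban1983to89.B9Thm314GFlatV1DivTransfer` — T. Bałaban, *Propagators for lattice gauge theories in a background field*,
# Commun. Math. Phys. **99** (1985) 389–434 [Balaban1985BackgroundPropagators], **THEOREM 3.14 (pp. 426–427, (3.154)) AT `U = 1` FOR THE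
# GENUINE `k`-LEVEL `G = Δ_a⁻¹` ((2.19)/(2.22) of [4] = [Balaban1984PropagatorsII]) ON THE V1 TORUS, FILE 4: THE ENGINE OF FILE 2 FOR AN INNER
# FACTOR WITH THE (2.136)₃ PROFILE `Lʲ|c_f|⁻¹`, AND THE (2.136)₃ MEMBER `G∇*` MODULO ITS ONE-FAMILY MAJORANTS**
# — the letter estimates of `B9Thm314GFlatV1Transfer` §4–§6 re-derived when the inner output `g` carries the profile
# `A·(L^{j′(v)}·|c_f|⁻¹)·e^{−δd′}·B` (print's `Lʲη` of the third member of (2.136)) instead of `A·pref·e^{−δd′}·B` (every conclusion acquires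
# the factor `|c_f|/L^k`), the abstract theorem `resolvent_diff_bound_lin`, and `thm314_Gdiv_flat_V1_of_majorants`: the (2.136)₃ member
# `|((G[Ω] − G[Ω′])∇*_ν μ)(x)| ≤ C·(L^k|c_f|⁻¹)·|μ|·e^{−δ·min(d,d′)(y,y′)}·e^{−δ·d(y,y′,Ω)}` GIVEN the one-family (2.136)₃ majorants of `G∇*`, `G′∇*`
# as hypotheses of the printed shape ; AND (§5–§9) THE `L²` MEMBERS OF THEOREM 3.14 FOR `G`: (2.140)₁ `‖ζ(G[Ω] − G[Ω′])J‖₂ ≤ C·(Lᵏ/c_f)²·|ζ|·E·‖J‖₂` UNCONDITIONALLY, and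
# (2.140)₂,₃ `‖ζ∇_ν(G[Ω] − G[Ω′])J‖₂, ‖ζ(G[Ω] − G[Ω′])∇*_νJ‖₂ ≤ C·(Lᵏ|c_f|⁻¹)·|ζ|·E·‖J‖₂` MODULO THE SAME ONE-FAMILY (2.136)₃ MAJORANTS, by Schur's test on a
# block pair (`E = e^{−δ·min(d,d′)(y,y′)}·e^{−δ·d(y,y′,Ω)}`; no existing module is touched; no definition, no fact is minted — theorems only)

statement-level skeleton of published theorems with citation tags; proofs where landed; nothing here is a claim about the Yang–Mills mass gap

PDF held: `paper:balaban1985-cmp99-background-propagators` (journal page = PDF page + 388), pp. 426–427 [PDF 38–39] re-read this generation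
(text layer p0038 L37–L42, p0039 L4–L11: «Theorem 3.14. If we take a pair of operators constructed for the two sequences … exp(−δ₀d(y,y′,Ω)),
d(y,y′,Ω) = inf (|y − y₁| + |y₁ − y′|) (3.154) … for which at least one localization X_i intersects Ωᶜ … (after adjusting a definition of δ₀)»);
`paper:balaban1984-cmp96-propagators-rt-ii` (journal page = PDF page + 222), p. 247 [PDF 25] (text layer p0025 L13–L18: «Proposition 2.6. There
exists a positive constant δ₃ depending on d and L only, such that |(GJ)(x)|, |(∇GJ)(x)|, |(G∇*J)(x)|, |(ΔGJ)(x)| ≦ O(1)[(Lʲη)², Lʲη, Lʲη, 1]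
e^{−δ₃d(y,y′)}|J| (2.136) for x ∈ Δ(y), y ∈ Λ_j, supp J ⊂ Δ(y′), with the constant O(1) depending on d and L only»), p. 226 [PDF 4] ((2.19),
(2.22) «G = Δ_a⁻¹»), p. 234 [PDF 12] ((2.60)–(2.61)); p. 247 L31–L33: «‖ζGJ‖, ‖ζ∇GJ‖, ‖ζG∇*J‖, ‖ζ∇G∇*J‖, ‖ζ∇∇GJ‖, ‖ζG∇*∇*J‖ ≦
O(1)[(Lʲη)², Lʲη, Lʲη, 1, 1, 1]|ζ|e^{−δ₃d(y,y′)}‖J‖ (2.140) if supp ζ ⊂ Δ(y), y ∈ Λ_j, supp J ⊂ Δ(y′), with the constant O(1) depending on d and L».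

CITATION HEADER (lean-in-tree rule) — WHAT IS REPRODUCED.  Phase-2 file of the `lit-balaban` typed skeleton (HOME `run/shared/lean/pub/lit-balaban/`),
unit `lit-balaban-p21` (proof seat p21, gen 21; free-target protocol G.5-34(d), TAKING 2026-08-23T21:56Z; B9 fold owner r06, referee ref-4);
SKELETON row B9.Thm3.14 (cell: Thm 3.14 at `U = 1` for the genuine `k`-level `G = Δ_a⁻¹`, member (2.136)₃).  Sister files of the same target:
`B9Thm314GFlatV1Kernel` (FILE 1: the resolvent identity, the letters `V_P`, `V_Q`, the localisation of the perturbation in `Ωᶜ`),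
`B9Thm314GFlatV1Transfer` (FILE 2: the engine for the `pref` profile; members (2.136)₁, (2.136)₂), `B9Thm314GFlatV1MultiLevelTorus` (FILE 3: member (2.136)₄);
the same `L²` device for `G′` at `U = 1` is gen 18's `B9Thm314GpFlatL2`.  SKELETON cells served: (2.136)₃ modulo majorants, (2.140)₁, (2.140)₂,₃ modulo majorants.

## WHY A SECOND ENGINE

FILE 2 bounds `|(T(V_P + V_Q)g)(x)|` for an inner output with the profile of the FIRST member of (2.136), `|g(v)| ≤ A·(L^{j′(v)}/c_f)²·e^{−δd′}·B`.
For the third member `(G − G′)∇* = G·(V_P + V_Q)·(G′∇*)` the inner output `g = G′∇*μ` has the profile `A·(L^{j′(v)}·|c_f|⁻¹)·e^{−δd′}·B`, which is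
NOT dominated by a constant multiple of the first (the ratio is `|c_f|·L^{−j′(v)}`, unbounded over the levels relative to its top value `|c_f|L^{−k}`),
and replacing it by its top value `A·(L^k|c_f|⁻¹)·…` loses the level sum of the surviving index bonds of `{Ω′_j}` (`Σ_{j≤k} 1`).  Hence §1–§3
below re-derive FILE 2's `termCT_le … abs_V_apply_le` for the linear profile: the (CT) pairs, the `{Ω_j}`-kernel of the (¬CT) pairs and the
surviving index bonds of `{Ω_j}` use `|c_f|L^{j′} ≤ |c_f|L^k`; the `{Ω′_j}` terms use the transfer (2.60) in `{Ω′_j}` and, for the index bonds,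
the level sum `Σ_{j≤k} L^{j}/L^{2k} ≤ 2L^{−k}`.  Every conclusion is FILE 2's multiplied by `|c_f|/L^k`, so that after the outer factor
(`pref(y) = (L^k/c_f)²` on a top block) the prefactor is print's `L^k|c_f|⁻¹` of (2.136)₃.

## WHAT THIS FILE CERTIFIES (kernel-checked; V1 torus `B6GlobalChartV1.PV`, families `domT hN D hk` of p21's `TDomains`, block maps `blkV1`)

* §1 the `∂P∂*` letter for the linear profile: **`termCT_le_lin`**, **`termD_le_lin`**, **`termD'_le_lin`**, **`abs_VP_apply_le_lin`**
  (`|(V_Pg)(f)| ≤ (d+1)c(C_Δ + C_Pe^{2δ}(1+L²))·A·B·(|c_f|/L^k)·(L^{2k}/L^{2j(p)})·e^{½δd(y,p)}·e^{−½δd(y,y′,Ω)}`).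
* §2 the `Q*aQ` letter for the linear profile: **`gprof_tube_lin`**, **`abs_QsE_trunc_le_lin`** (`{Ω_j}`), **`abs_QsE_trunc'_le_lin`** (`{Ω′_j}`: transfer
  (2.60) in `{Ω′_j}`, `L^{3j′} ≤ L^{3j}` by coverage, `Σ_{j≤k}L^{j}/L^{2k} ≤ 2L^{−k}`).
* §3 **`abs_V_apply_le_lin`**, **`engine_lin`** (outer factor with a general prefactor `φ`:
  `|(T(V_P+V_Q)g)(x)| ≤ ΘL²c·A′A·B·(|c_f|/L^k)·φ(y)·e^{−½δd(y,y′,Ω)}`), **`pref_mul_kappa_of_top`** (`pref(y)·|c_f|/L^k = L^k|c_f|⁻¹` on a top block),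
  **`resolvent_diff_bound_lin`** (THE ABSTRACT THEOREM: for `T − T′ = G_D(V_P + V_Q)T′` with `G_D` carrying the (2.136)₁ majorant and `T, T′` the
  (2.136)₃-shaped majorants `A₃·(L^{j(y)}|c_f|⁻¹)·e^{−δd}`: `|(Tμ)(x) − (T′μ)(x)| ≤ √(2A₃)·√(ΘL²cAA₃)·(L^k|c_f|⁻¹)·B·e^{−½δ·min(d,d′)}·e^{−¼δ·d(y,y′,Ω)}`).
* §4 **`thm314_Gdiv_flat_V1_of_majorants`** — THEOREM 3.14 AT `U = 1`, THE (2.136)₃ MEMBER FOR `G = Δ_a⁻¹` MODULO ITS ONE-FAMILY MAJORANTS: for all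
  `A₃ ≥ 0`, `δ₃ > 0` there are `δ, C, M₀ > 0`, `N₀ > 0` such that for every V1 torus, every pair of p21 torus families `D, D′` (`1 ≤ k`, `M_h = L^a ≥ 8`,
  `R ≥ 2L²`, `P_μ ≥ 5L`, `L ≥ 5`, `L·M_h ≥ M₀`, `R·L·M_h ≥ N₀ + 1`), fine factor `c_f ≠ 0`, positive weights in the global band agreeing on the common
  index bonds, a direction `ν` such that `G[Ω]∇*_ν` and `G[Ω′]∇*_ν` (`onFun GE * B6LapLegKLevelV1.DVa ν c_f`) carry the majorants
  `A₃·(L^{j(y)}|c_f|⁻¹)·e^{−δ₃d}` in their families (the printed shape of (2.136)₃ — p38's/p22's one-family theorem), common top blocks `y, y′`,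
  `supp μ ⊂ B(y′)`, `|μ| ≤ B`, `x ∈ B(y)`:  `|(G[Ω]∇*_νμ)(x) − (G[Ω′]∇*_νμ)(x)| ≤ C·(L^k|c_f|⁻¹)·B·e^{−δ·min(d(y,y′),d′(y,y′))}·e^{−δ·d(y,y′,Ω)}`.
  Inputs BY NAME, restating nothing: FILE 1 (`VP`, `VQ`, `VP_single_apply`, `VQ_apply_eq`, `trunc`/`trunc'`, `qk`, `sum_qk`, `abs_bondAvgIter_le_sum_qk`,
  `witness_of_not_isCT`/`'`, `onFun_GE_sub`, `dPd_le`, `member4_eq_dPd`, `w_le_of_band`), FILE 2 (`tdistK_blk_le_of_top`, `tdistK_blk_blk_le(_of_dist)`,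
  `dOmega_le_chain`, `dist_tube_le`, `sum_le_of_fibre_bound`, `one_le_ratio`, `witness_of_not_pairCT`, `trivial_bound_gen`), p38's
  `B6Prop26GradKLevelV1.prop26_2136_grad_kLevel_unconditional_pad_V1` (first conjunct only: the (2.136)₁ majorant of the OUTER factor `G_D = G[Ω]`),
  gen 19's `B9Thm314PFlatMultiLevelTorus.thm314_P_flat_multiLevelTorus` member 4, gen 18's `consts_260_261`, `combined_bound`,
  r05's `B8Prop3MultiLevelTorus.abs_QsE_apply_le` and coverage/locality lemmas, `B6LapLegKLevelV1.DVa`.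

* §5 **`OmegaC_comm`**, **`dOmega_swap`** — `Ωᶜ` and `d(y,y′,Ω)` do not depend on the order of the two families; §6 **`rowSum_le_of_blockBound`** —
  the absolute row sum of a kernel over a block from a sup bound on block-supported test functions (the sign pattern of the row; the pointwise
  form of p22's `B6Ineq2140KLevelV1.rowSum_le_of_hasMajorant`).
* §7 **`thm314_G_l2_flat_V1`** — THEOREM 3.14 AT `U = 1`, THE `L²` MEMBER (2.140)₁ FOR `G = Δ_a⁻¹`, UNCONDITIONAL: there are `δ, C, M₀ > 0`, `N₀ > 0` such
  that for every V1 torus, every pair of p21 torus families `D, D′` (hypotheses of FILE 2's `thm314_G_flat_V1` verbatim), weights in the global band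
  agreeing on the common index bonds, common top blocks `y, y′`, and `ζ, J` with `supp ζ ⊂ B(y)` (block of `{Ω_j}`), `|ζ| ≤ s`, `supp J ⊂ B′(y′)` (block of
  `{Ω′_j}`): `Σ_x (ζ(x)·((G[Ω] − G[Ω′])J)(x))² ≤ (C·(Lᵏ/c_f)²·e^{−δ·min(d(y,y′),d′(y,y′))}·e^{−δ·d(y,y′,Ω)}·s)²·Σ_x J(x)²`.  Mechanism: FILE 2's sup member
  gives the row sums of the kernel of `G[Ω] − G[Ω′]` on `B(y) × B′(y′)`; applied to the pair `(Ω′, Ω)` with `y, y′` exchanged (same constants — they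
  precede the families), with the symmetry of the kernels (p22's `onFun_GE_single_symm`), `dOmega_swap`/`dOmega_comm`, `symmT` and
  `pref(y) = pref(y′) = (Lᵏ/c_f)²`, it gives the column sums; Schur's test (`B6SchurTorusBound.sum_sq_le_abs`).
* §8 **`sum_sq_le_of_blockBounds`** — SCHUR'S TEST ON ONE BLOCK PAIR FOR AN OPERATOR AND ITS TRANSPOSE with two block maps: if `Tᵗ(δ_x)(x′) = T(δ_{x′})(x)`,
  `|(Tμ)(x)| ≤ K·B` for `x ∈ Δ(y)` (block map `blk`) and `μ` supported in `Δ′(y′)` (block map `blk′`) with `|μ| ≤ B`, and `|(Tᵗμ)(x′)| ≤ K′·B` for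
  `x′ ∈ Δ′(y′)` and `μ` supported in `Δ(y)`, then `Σ_x (ζ(x)(TJ)(x))² ≤ s²KK′·Σ_x J(x)²` for `supp ζ ⊂ Δ(y)`, `|ζ| ≤ s`, `supp J ⊂ Δ′(y′)`.
* §9 **`thm314_gradG_l2_flat_V1_of_majorants`** ((2.140)₂) and **`thm314_Gdiv_l2_flat_V1_of_majorants`** ((2.140)₃) — for all `A₃ ≥ 0`, `δ₃ > 0` there are
  `δ, C, M₀ > 0`, `N₀ > 0` such that, under the hypotheses of §4 (the one-family (2.136)₃ majorants `hT3`, `hT3′` AS PRINTED included), for common top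
  blocks `y, y′`, `supp ζ ⊂ B(y)`, `|ζ| ≤ s`, `supp J ⊂ B′(y′)`: `Σ_x (ζ(x)·(∇_ν(G[Ω] − G[Ω′])J)(x))², Σ_x (ζ(x)·((G[Ω] − G[Ω′])∇*_νJ)(x))² ≤
  (C·(Lᵏ|c_f|⁻¹)·E·s)²·Σ_x J(x)²` (`∇_ν = B6GradLegKLevelV1.DV ν c_f`, `∇*_ν = B6LapLegKLevelV1.DVa ν c_f`): the rows of `∇(G − G′)` come from FILE 2's
  `thm314_gradG_flat_V1`, its columns are the rows of the transpose `(G − G′)∇*` (p22's `B6GEDVaTransposeV1.onFun_DV_GE_single_transpose` /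
  `onFun_GE_DVa_single_transpose`), bounded by §4 for the exchanged pair of families; and symmetrically for `(G − G′)∇*`.

## HONEST SCOPE

* ABSTRACT in (§3): as FILE 2's `resolvent_diff_bound_gen`, with the inner profile linear; §4 discharges everything for `G = Δ_a⁻¹` EXCEPT the
  one-family (2.136)₃ majorants of `G∇*`, `G′∇*`, which enter as the hypotheses `hT3`, `hT3'` AS PRINTED ((2.136)₃ with constants `A₃`, `δ₃`):
  their proof on the V1 torus is p38's `B6Prop26DivLegKLevelV1` / p22's `B6Ineq2140GradKLevelPadV1.prop26_2136_div_kLevel_unconditional_pad_V1`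
  (announced, not yet in the tree at the time of writing); the unconditional member follows by one instantiation in a successor file.
  Hypotheses otherwise = those of FILE 2 §8–§9 / FILE 3; `U = 1`; `1 ≤ k`; rates of the conclusion `δ/4` of the common input rate.
* `L²` (§5–§9): (2.140)₁ unconditional (hypotheses of FILE 2's `thm314_G_flat_V1`); (2.140)₂,₃ modulo the same (2.136)₃ majorants as §4; the members
  (2.140)₄₋₆ (prefactor `1`) are `L²`-only in print and are NOT sup-derived here.  The Schur route is ours (derivation) — declared.
* ROUTE (declared, as FILES 1–3): the second resolvent identity `(G − G′)∇* = G(V_P + V_Q)(G′∇*)` in place of print's walk-expansion cancellation.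
* Nothing is inferred from the manuscript: every step is kernel-checked; the quoted sentences locate the statements.
-/

noncomputable section

open scoped BigOperators Matrix
open Finset

namespace Literature.MathematicalPhysics.QuantumFieldTheory.Balaban1983to89.B9Thm314GFlatV1DivTransfer

open B4Reflection242 (boxDom blk)
open B6MultiLevelBoxOperator (N0 aPrinted)
open B6MultiLevelTorusOperator (TDomains)
open B6Geom246MultiLevelBox (bset blkOf scale_bounds toR)
open B6Geom246MultiLevelTorus (geomT toT triangle_refl_nonneg_T)
open B6RandomWalk (HasMajorant BlockSupp hasMajorant_mono delta3 delta3_pos)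
open B6Ineq2133TwoScaleV1 (onFun onFun_apply)
open B6SectAOperatorsV1 (QsE BondIdx BondIdxSpace)
open B6SectAVectorModelV1 (GE)
open B6GlobalChartV1 (PV toBox blkV1 domT)
open B6Ineq288MultiLevelTorus (dPd)
open B6Ineq268MultiLevelBox (W W_pos W_eq)
open B9Thm314GpFlatTorusGeometry (OmegaC tdistK dOmega dOmega_nonneg)
open B9Thm314GpFlatResolvent (abs_le_sum_of_hasMajorant transfer_top)
open B9Thm314QGGQInvFlatTransfer (tdistK_comm dOmega_le_tdistK_add dOmega_le_add_tdistK tdistK_le_distT_of_top)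
open B6Lemma21Repaired (Ineq261With)
open B6Prop26KLevelSkeletonV1 (pref pref_nonneg)
open B6CubeWindowV1 (GlobalBand)
open LatticeFieldCalculus (bondAvgIter)
open B5Eq118OneStroke (iterBlockOf)
open B8Prop3MultiLevelTorus (abs_QsE_apply_le iterBlockOf_of_bondAvgIter_single_ne_zero lev_le_of_bondAvgIter_single_ne_zero)
open B8Ineq192MultiLevelTorus (geomT_len symmT triangleTB)
open B6LapLegKLevelV1 (DVa)
open B9Thm314GpFlatMultiLevelTorus (consts_260_261 combined_bound)
open B6Prop26GradKLevelV1 (prop26_2136_grad_kLevel_unconditional_pad_V1)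
open B9Thm314PFlatMultiLevelTorus (thm314_P_flat_multiLevelTorus)
open B9Thm314GFlatV1Kernel
open B9Thm314GFlatV1Transfer (tdistK_blk_le_of_top tdistK_blk_blk_le_of_dist tdistK_blk_blk_le dOmega_le_chain dist_tube_le
  sum_le_of_fibre_bound one_le_ratio witness_of_not_pairCT trivial_bound_gen)

section LinEngine

variable {d ℓ : ℕ} {m K : ℕ} {hd : 1 ≤ d + 1} {hL : Odd (ℓ + 1) ∧ 1 < ℓ + 1}
variable {Mh k R : ℕ} {P' : Fin (d + 1) → ℕ}

/-! ## §0  Arithmetic of the linear profile -/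

/-- `c_f²·(t·|c_f|⁻¹) = |c_f|·t`. [folklore] -/
private theorem sq_mul_lin {cf : ℝ} (hcf : cf ≠ 0) (t : ℝ) : cf ^ 2 * (t * |cf|⁻¹) = |cf| * t := by
  have h : |cf| ≠ 0 := abs_ne_zero.mpr hcf
  rw [← sq_abs]
  field_simp

/-- the geometric tail `Σ_{j ∈ [p, n)} r^j ≤ 2r^p` for `0 ≤ r ≤ 1/2`. [folklore] -/
private theorem sum_ite_pow_le {r : ℝ} (hr0 : 0 ≤ r) (hr : r ≤ 1 / 2) (p n : ℕ) :
    ∑ j ∈ Finset.range n, (if p ≤ j then r ^ j else 0) ≤ 2 * r ^ p := by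
  rw [← Finset.sum_filter]
  have hsub : (Finset.range n).filter (fun j => p ≤ j) ⊆ Finset.Ico p (max p n) := by
    intro j hj
    rw [Finset.mem_filter, Finset.mem_range] at hj
    rw [Finset.mem_Ico]
    exact ⟨hj.2, lt_max_of_lt_right hj.1⟩
  refine (Finset.sum_le_sum_of_subset_of_nonneg hsub fun j _ _ => pow_nonneg hr0 j).trans ?_
  refine (geom_sum_Ico_le_of_lt_one hr0 (by linarith)).trans ?_
  rw [div_le_iff₀ (by linarith)]
  nlinarith [pow_nonneg hr0 p]

/-- the reflected geometric sum `Σ_{j ≤ k} r^{k−j} ≤ 2` for `0 ≤ r ≤ 1/2`. [folklore] -/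
private theorem sum_pow_sub_le {r : ℝ} (hr0 : 0 ≤ r) (hr : r ≤ 1 / 2) (k : ℕ) :
    ∑ j ∈ Finset.range (k + 1), r ^ (k - j) ≤ 2 := by
  have e : ∑ j ∈ Finset.range (k + 1), r ^ (k - j) = ∑ j ∈ Finset.range (k + 1), r ^ j := by
    have h := Finset.sum_range_reflect (fun j => r ^ j) (k + 1)
    simp only [Nat.add_sub_cancel] at h
    exact h
  rw [e, Finset.range_eq_Ico]
  refine (geom_sum_Ico_le_of_lt_one hr0 (by linarith)).trans ?_
  rw [pow_zero, div_le_iff₀ (by linarith)]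
  linarith

/-- `a^j/a^n = (a⁻¹)^{n−j}` for `j ≤ n`. [folklore] -/
private theorem pow_div_pow_eq_inv_pow {a : ℝ} (ha : a ≠ 0) {j n : ℕ} (h : j ≤ n) : a ^ j / a ^ n = (a⁻¹) ^ (n - j) := by
  obtain ⟨i, rfl⟩ := Nat.exists_eq_add_of_le h
  rw [Nat.add_sub_cancel_left, pow_add, inv_pow]
  field_simp

/-- **THE LINEAR PROFILE AGAINST ITS TOP VALUE**: `c_f²·(L^{j(q)}·|c_f|⁻¹) ≤ (|c_f|/L^k)·(L^k)²` for every block `q` of a family.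
[cite: Balaban1984PropagatorsII, (2.3)–(2.4) p.224, (2.136) p.247, bookkeeping] -/
theorem sq_mul_lin_le (D₀ : TDomains d ℓ Mh k P' R) {cf : ℝ} (hcf : cf ≠ 0) (q : ↥(bset D₀.toDomains)) :
    cf ^ 2 * ((geomT D₀).len q * |cf|⁻¹) ≤ (|cf| * ((((ℓ : ℝ) + 1) ^ k))⁻¹) * (((ℓ : ℝ) + 1) ^ k) ^ 2 := by
  have hL1 : (1 : ℝ) ≤ (ℓ : ℝ) + 1 := by linarith [(Nat.cast_nonneg ℓ : (0 : ℝ) ≤ ℓ)]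
  have hLk : (0 : ℝ) < ((ℓ : ℝ) + 1) ^ k := by positivity
  rw [sq_mul_lin hcf, geomT_len, mul_one]
  have h1 : ((ℓ : ℝ) + 1) ^ q.1.1 ≤ ((ℓ : ℝ) + 1) ^ k := pow_le_pow_right₀ hL1 (scale_bounds D₀.toDomains q).2
  have e : (|cf| * ((((ℓ : ℝ) + 1) ^ k))⁻¹) * (((ℓ : ℝ) + 1) ^ k) ^ 2 = |cf| * ((ℓ : ℝ) + 1) ^ k := by
    field_simp
  rw [e]
  exact mul_le_mul_of_nonneg_left h1 (abs_nonneg cf)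

/-- **… WITH EQUALITY ON A TOP BLOCK**: `c_f²·(L^{j(q)}·|c_f|⁻¹) = |c_f|·L^k` when `j(q) = k`. [cite: Balaban1984PropagatorsII, (2.136) p.247, bookkeeping] -/
theorem sq_mul_lin_top (D₀ : TDomains d ℓ Mh k P' R) {cf : ℝ} (hcf : cf ≠ 0) {q : ↥(bset D₀.toDomains)} (hq : q.1.1 = k) :
    cf ^ 2 * ((geomT D₀).len q * |cf|⁻¹) = |cf| * ((ℓ : ℝ) + 1) ^ k := by
  rw [sq_mul_lin hcf, geomT_len, mul_one, hq]

/-- non-negativity of the linear profile. [folklore] -/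
private theorem lin_nonneg (D₀ : TDomains d ℓ Mh k P' R) (cf : ℝ) (q : ↥(bset D₀.toDomains)) : 0 ≤ (geomT D₀).len q * |cf|⁻¹ := by
  rw [geomT_len]; positivity

/-- **THE OUTER PREFACTOR TIMES THE ENGINE'S FACTOR IS PRINT'S `Lʲη` OF (2.136)₃**: on a top block, `pref(y)·(|c_f|/L^k) = L^k·|c_f|⁻¹ = L^{j(y)}·|c_f|⁻¹`.
[cite: Balaban1984PropagatorsII, Prop. 2.6 (2.136) p.247, bookkeeping] -/
theorem pref_mul_kappa_of_top (D₀ : TDomains d ℓ Mh k P' R) {cf : ℝ} (hcf : cf ≠ 0) {y : ↥(bset D₀.toDomains)} (hy : y.1.1 = k) :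
    pref cf y * (|cf| * ((((ℓ : ℝ) + 1) ^ k))⁻¹) = (geomT D₀).len y * |cf|⁻¹ := by
  have h : |cf| ≠ 0 := abs_ne_zero.mpr hcf
  have hL1 : (1 : ℝ) ≤ (ℓ : ℝ) + 1 := by linarith [(Nat.cast_nonneg ℓ : (0 : ℝ) ≤ ℓ)]
  have hLk : (((ℓ : ℝ) + 1) ^ k) ≠ 0 := by positivity
  unfold pref
  have e : (((ℓ + 1 : ℕ) : ℝ)) = (ℓ : ℝ) + 1 := by push_cast; ring
  rw [e, geomT_len, mul_one, hy, div_pow, ← sq_abs cf]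
  field_simp

/-! ## §1  The `∂P∂*` letter between the two factors, inner output with the linear profile

For a fine bond `f` (initial point `x`, in the block `p = y(x)` of `{Ω_j}`) and the inner factor's output `g = (G′∇*)μ` (`supp μ ⊂ B(y′)`,
`|μ| ≤ B`, profile `|g(v)| ≤ A·(L^{j′(v)}|c_f|⁻¹)·e^{−δd′(y′(v), y′)}·B` from the (2.136)₃ majorant of `G′∇*`): the three sums of FILE 2 §4 with
every conclusion multiplied by `|c_f|/L^k`. -/

section PPart

variable (hN : ∀ μ, N0 ℓ Mh k P' μ = (PV d ℓ m K hd hL).sitesPerDir 0) (D D' : TDomains d ℓ Mh k P' R) (hk : k ≤ m + K)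

/-- **(CT) PAIRS — BOTH POINTS IN `Ω`**, linear profile: the term `c_f²·|(∂P∂* − ∂P′∂*)(x, v)|·|g(v)|` is at most
`W′(y′(v))⁻¹·A·B·C_Δ·(|c_f|/L^k)·e^{½δd(y,p)}·e^{−½δd(y,y′,Ω)}·e^{−¼δd′(y′, y′(v))}`.
[cite: Balaban1985BackgroundPropagators, Thm 3.14 (3.154) p.427; Balaban1984PropagatorsII, (2.22) p.226, (2.88) p.238, (2.136) p.247] -/
theorem termCT_le_lin (hMh : 1 ≤ Mh) (hP : ∀ μ, 1 ≤ P' μ) {δ CΔ A B cf : ℝ} (hδ : 0 ≤ δ) (hcf : cf ≠ 0) (hCΔ : 0 ≤ CΔ)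
    (hA : 0 ≤ A) (hB : 0 ≤ B)
    (hΔ : ∀ (p q : ℕ × (Fin (d + 1) → ℤ)) (hpD : p ∈ bset D.toDomains) (hpD' : p ∈ bset D'.toDomains)
      (hqD : q ∈ bset D.toDomains) (hqD' : q ∈ bset D'.toDomains), p.1 = k → q.1 = k →
      ∀ (x x' : ↥(boxDom (N0 ℓ Mh k P'))), blkOf D.toDomains x = ⟨p, hpD⟩ → blkOf D.toDomains x' = ⟨q, hqD⟩ →
      ∀ μ ν : Fin (d + 1), |dPd D μ ν x x' - dPd D' μ ν x x'|
        ≤ CΔ * ((((ℓ : ℝ) + 1) ^ k) ^ 2)⁻¹ * ((((ℓ : ℝ) + 1) ^ k) ^ (d + 1))⁻¹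
          * Real.exp (-(δ * min ((geomT D).dist ⟨p, hpD⟩ ⟨q, hqD⟩) ((geomT D').dist ⟨p, hpD'⟩ ⟨q, hqD'⟩)))
          * Real.exp (-(δ * dOmega D D' p.2 q.2)))
    {y : ↥(bset D.toDomains)} (hy : y.1.1 = k) {y' : ↥(bset D'.toDomains)} (hy' : y'.1.1 = k)
    {g : PBond (PV d ℓ m K hd hL) 0 → ℝ}
    (hg : ∀ v, |g v| ≤ A * ((geomT D').len (blkV1 hN D' v) * |cf|⁻¹) * Real.exp (-(δ * (geomT D').dist (blkV1 hN D' v) y')) * B)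
    (f v : PBond (PV d ℓ m K hd hL) 0) (hΩx : D.lev (toBox hN f.src).1 = k ∧ D'.lev (toBox hN f.src).1 = k)
    (hΩv : D.lev (toBox hN v.src).1 = k ∧ D'.lev (toBox hN v.src).1 = k) :
    cf ^ 2 * |dPd D f.dir v.dir (toBox hN f.src) (toBox hN v.src) - dPd D' f.dir v.dir (toBox hN f.src) (toBox hN v.src)| * |g v|
      ≤ (W D'.toDomains (blkV1 hN D' v))⁻¹ * (A * B * CΔ * (|cf| * ((((ℓ : ℝ) + 1) ^ k))⁻¹)
          * (Real.exp (1 / 2 * δ * (geomT D).dist y (blkV1 hN D f)) * Real.exp (-(1 / 2 * δ * dOmega D D' y.1.2 y'.1.2)))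
          * Real.exp (-(1 / 4 * δ * (geomT D').dist y' (blkV1 hN D' v)))) := by
  have hd0 : ∀ s t : ↥(bset D.toDomains), 0 ≤ (geomT D).dist s t := (triangle_refl_nonneg_T D hMh hP).2.2
  have hd0' : ∀ s t : ↥(bset D'.toDomains), 0 ≤ (geomT D').dist s t := (triangle_refl_nonneg_T D' hMh hP).2.2
  have hL1 : (1 : ℝ) ≤ (ℓ : ℝ) + 1 := by linarith [(Nat.cast_nonneg ℓ : (0 : ℝ) ≤ ℓ)]
  set x := toBox hN f.src with hx
  set z := toBox hN v.src with hz
  -- the two common top blocks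
  have hpx1 : (blkV1 hN D f).1 = (k, blk ((ℓ + 1) ^ k) x.1) := by
    have h : D.toDomains.lev x.1 = k := hΩx.1
    show (D.toDomains.lev x.1, blk ((ℓ + 1) ^ D.toDomains.lev x.1) x.1) = _
    rw [h]
  have hpx1' : (blkOf D'.toDomains x).1 = (k, blk ((ℓ + 1) ^ k) x.1) := by
    have h : D'.toDomains.lev x.1 = k := hΩx.2
    show (D'.toDomains.lev x.1, blk ((ℓ + 1) ^ D'.toDomains.lev x.1) x.1) = _
    rw [h]
  have hqz1 : (blkV1 hN D v).1 = (k, blk ((ℓ + 1) ^ k) z.1) := by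
    have h : D.toDomains.lev z.1 = k := hΩv.1
    show (D.toDomains.lev z.1, blk ((ℓ + 1) ^ D.toDomains.lev z.1) z.1) = _
    rw [h]
  have hqz1' : (blkV1 hN D' v).1 = (k, blk ((ℓ + 1) ^ k) z.1) := by
    have h : D'.toDomains.lev z.1 = k := hΩv.2
    show (D'.toDomains.lev z.1, blk ((ℓ + 1) ^ D'.toDomains.lev z.1) z.1) = _
    rw [h]
  have hp₀D : (k, blk ((ℓ + 1) ^ k) x.1) ∈ bset D.toDomains := by rw [← hpx1]; exact (blkV1 hN D f).2
  have hp₀D' : (k, blk ((ℓ + 1) ^ k) x.1) ∈ bset D'.toDomains := by rw [← hpx1']; exact (blkOf D'.toDomains x).2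
  have hq₀D : (k, blk ((ℓ + 1) ^ k) z.1) ∈ bset D.toDomains := by rw [← hqz1]; exact (blkV1 hN D v).2
  have hq₀D' : (k, blk ((ℓ + 1) ^ k) z.1) ∈ bset D'.toDomains := by rw [← hqz1']; exact (blkV1 hN D' v).2
  have hfp : blkV1 hN D f = ⟨(k, blk ((ℓ + 1) ^ k) x.1), hp₀D⟩ := Subtype.ext hpx1
  have hvq : blkV1 hN D v = ⟨(k, blk ((ℓ + 1) ^ k) z.1), hq₀D⟩ := Subtype.ext hqz1
  have hvq' : blkV1 hN D' v = ⟨(k, blk ((ℓ + 1) ^ k) z.1), hq₀D'⟩ := Subtype.ext hqz1'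
  have hdiff := hΔ _ _ hp₀D hp₀D' hq₀D hq₀D' rfl rfl x z hfp hvq f.dir v.dir
  have h2 := hg v
  rw [hvq'] at h2
  rw [hvq', hfp]
  -- sizes of the top blocks
  have hW' : W D'.toDomains ⟨(k, blk ((ℓ + 1) ^ k) z.1), hq₀D'⟩ = (((ℓ : ℝ) + 1) ^ k) ^ (d + 1) := W_eq _ _
  have hWpos : 0 < (((ℓ : ℝ) + 1) ^ k) ^ (d + 1) := by positivity
  have hLk : (0 : ℝ) < ((ℓ : ℝ) + 1) ^ k := by positivity
  have hψ : cf ^ 2 * ((geomT D').len ⟨(k, blk ((ℓ + 1) ^ k) z.1), hq₀D'⟩ * |cf|⁻¹) = |cf| * ((ℓ : ℝ) + 1) ^ k :=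
    sq_mul_lin_top D' hcf rfl
  -- the chain through the two common top blocks
  have hc1 : tdistK (ℓ := ℓ) (Mh := Mh) (k := k) (P := P') y.1.2 (blk ((ℓ + 1) ^ k) x.1)
      ≤ (geomT D).dist y ⟨(k, blk ((ℓ + 1) ^ k) x.1), hp₀D⟩ :=
    tdistK_le_distT_of_top D hMh hP (y := y) (u := ⟨(k, blk ((ℓ + 1) ^ k) x.1), hp₀D⟩) hy rfl
  have hc2 : tdistK (ℓ := ℓ) (Mh := Mh) (k := k) (P := P') (blk ((ℓ + 1) ^ k) z.1) y'.1.2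
      ≤ (geomT D').dist ⟨(k, blk ((ℓ + 1) ^ k) z.1), hq₀D'⟩ y' :=
    tdistK_le_distT_of_top D' hMh hP (y := ⟨(k, blk ((ℓ + 1) ^ k) z.1), hq₀D'⟩) (u := y') rfl hy'
  have hchain : dOmega D D' y.1.2 y'.1.2 ≤ (geomT D).dist y ⟨(k, blk ((ℓ + 1) ^ k) x.1), hp₀D⟩
      + dOmega D D' (blk ((ℓ + 1) ^ k) x.1) (blk ((ℓ + 1) ^ k) z.1) + (geomT D').dist ⟨(k, blk ((ℓ + 1) ^ k) z.1), hq₀D'⟩ y' := by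
    have h1 := dOmega_le_tdistK_add D D' y.1.2 (blk ((ℓ + 1) ^ k) x.1) y'.1.2
    have h2 := dOmega_le_add_tdistK D D' (blk ((ℓ + 1) ^ k) x.1) (blk ((ℓ + 1) ^ k) z.1) y'.1.2
    linarith
  -- the exponent budget
  have hexp : Real.exp (-(δ * min ((geomT D).dist ⟨(k, blk ((ℓ + 1) ^ k) x.1), hp₀D⟩ ⟨(k, blk ((ℓ + 1) ^ k) z.1), hq₀D⟩)
        ((geomT D').dist ⟨(k, blk ((ℓ + 1) ^ k) x.1), hp₀D'⟩ ⟨(k, blk ((ℓ + 1) ^ k) z.1), hq₀D'⟩)))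
      * Real.exp (-(δ * dOmega D D' (blk ((ℓ + 1) ^ k) x.1) (blk ((ℓ + 1) ^ k) z.1)))
      * Real.exp (-(δ * (geomT D').dist ⟨(k, blk ((ℓ + 1) ^ k) z.1), hq₀D'⟩ y'))
      ≤ (Real.exp (1 / 2 * δ * (geomT D).dist y ⟨(k, blk ((ℓ + 1) ^ k) x.1), hp₀D⟩) * Real.exp (-(1 / 2 * δ * dOmega D D' y.1.2 y'.1.2)))
        * Real.exp (-(1 / 4 * δ * (geomT D').dist y' ⟨(k, blk ((ℓ + 1) ^ k) z.1), hq₀D'⟩)) := by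
    have hm0 : 0 ≤ min ((geomT D).dist ⟨(k, blk ((ℓ + 1) ^ k) x.1), hp₀D⟩ ⟨(k, blk ((ℓ + 1) ^ k) z.1), hq₀D⟩)
        ((geomT D').dist ⟨(k, blk ((ℓ + 1) ^ k) x.1), hp₀D'⟩ ⟨(k, blk ((ℓ + 1) ^ k) z.1), hq₀D'⟩) := le_min (hd0 _ _) (hd0' _ _)
    have hΩ0 : 0 ≤ dOmega D D' (blk ((ℓ + 1) ^ k) x.1) (blk ((ℓ + 1) ^ k) z.1) := dOmega_nonneg D D' _ _
    have hd'0 : 0 ≤ (geomT D').dist ⟨(k, blk ((ℓ + 1) ^ k) z.1), hq₀D'⟩ y' := hd0' _ _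
    have hsy : (geomT D').dist y' ⟨(k, blk ((ℓ + 1) ^ k) z.1), hq₀D'⟩ = (geomT D').dist ⟨(k, blk ((ℓ + 1) ^ k) z.1), hq₀D'⟩ y' :=
      symmT D' _ _
    rw [hsy, ← Real.exp_add, ← Real.exp_add, ← Real.exp_add, ← Real.exp_add]
    refine Real.exp_le_exp.2 ?_
    have e1 := mul_le_mul_of_nonneg_left hchain hδ
    have e2 := mul_nonneg hδ hm0
    have e3 := mul_nonneg hδ hΩ0
    have e4 := mul_nonneg hδ hd'0
    rw [mul_add, mul_add] at e1
    linarith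
  have hR1 := le_trans (abs_nonneg _) hdiff
  calc cf ^ 2 * |dPd D f.dir v.dir x z - dPd D' f.dir v.dir x z| * |g v|
      ≤ cf ^ 2 * (CΔ * ((((ℓ : ℝ) + 1) ^ k) ^ 2)⁻¹ * ((((ℓ : ℝ) + 1) ^ k) ^ (d + 1))⁻¹
          * Real.exp (-(δ * min ((geomT D).dist ⟨(k, blk ((ℓ + 1) ^ k) x.1), hp₀D⟩ ⟨(k, blk ((ℓ + 1) ^ k) z.1), hq₀D⟩)
              ((geomT D').dist ⟨(k, blk ((ℓ + 1) ^ k) x.1), hp₀D'⟩ ⟨(k, blk ((ℓ + 1) ^ k) z.1), hq₀D'⟩)))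
          * Real.exp (-(δ * dOmega D D' (blk ((ℓ + 1) ^ k) x.1) (blk ((ℓ + 1) ^ k) z.1))))
        * (A * ((geomT D').len ⟨(k, blk ((ℓ + 1) ^ k) z.1), hq₀D'⟩ * |cf|⁻¹)
          * Real.exp (-(δ * (geomT D').dist ⟨(k, blk ((ℓ + 1) ^ k) z.1), hq₀D'⟩ y')) * B) :=
        mul_le_mul (mul_le_mul_of_nonneg_left hdiff (sq_nonneg cf)) h2 (abs_nonneg _) (mul_nonneg (sq_nonneg cf) hR1)
    _ = ((((ℓ : ℝ) + 1) ^ k) ^ (d + 1))⁻¹ * (A * B * CΔ)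
        * (((((ℓ : ℝ) + 1) ^ k) ^ 2)⁻¹ * (cf ^ 2 * ((geomT D').len ⟨(k, blk ((ℓ + 1) ^ k) z.1), hq₀D'⟩ * |cf|⁻¹)))
        * (Real.exp (-(δ * min ((geomT D).dist ⟨(k, blk ((ℓ + 1) ^ k) x.1), hp₀D⟩ ⟨(k, blk ((ℓ + 1) ^ k) z.1), hq₀D⟩)
              ((geomT D').dist ⟨(k, blk ((ℓ + 1) ^ k) x.1), hp₀D'⟩ ⟨(k, blk ((ℓ + 1) ^ k) z.1), hq₀D'⟩)))
          * Real.exp (-(δ * dOmega D D' (blk ((ℓ + 1) ^ k) x.1) (blk ((ℓ + 1) ^ k) z.1)))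
          * Real.exp (-(δ * (geomT D').dist ⟨(k, blk ((ℓ + 1) ^ k) z.1), hq₀D'⟩ y'))) := by ring
    _ ≤ ((((ℓ : ℝ) + 1) ^ k) ^ (d + 1))⁻¹ * (A * B * CΔ) * (|cf| * ((((ℓ : ℝ) + 1) ^ k))⁻¹)
        * ((Real.exp (1 / 2 * δ * (geomT D).dist y ⟨(k, blk ((ℓ + 1) ^ k) x.1), hp₀D⟩) * Real.exp (-(1 / 2 * δ * dOmega D D' y.1.2 y'.1.2)))
          * Real.exp (-(1 / 4 * δ * (geomT D').dist y' ⟨(k, blk ((ℓ + 1) ^ k) z.1), hq₀D'⟩))) := by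
        have hX : ((((ℓ : ℝ) + 1) ^ k) ^ 2)⁻¹ * (cf ^ 2 * ((geomT D').len ⟨(k, blk ((ℓ + 1) ^ k) z.1), hq₀D'⟩ * |cf|⁻¹))
            = |cf| * ((((ℓ : ℝ) + 1) ^ k))⁻¹ := by
          rw [hψ]
          field_simp
        rw [hX]
        exact mul_le_mul_of_nonneg_left hexp (mul_nonneg (mul_nonneg (inv_nonneg.2 hWpos.le) (mul_nonneg (mul_nonneg hA hB) hCΔ))
          (mul_nonneg (abs_nonneg cf) (inv_nonneg.2 hLk.le)))
    _ = _ := by rw [hW']; ring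

/-- **(¬CT) PAIRS, THE KERNEL OF `{Ω_j}`**, linear profile: the term `c_f²·|(∂P[Ω]∂*)(x, v)|·|g(v)|` is at most
`W(y(v))⁻¹·A·B·C_P·e^{2δ}·(|c_f|/L^k)·(L^{2k}/L^{2j(p)})·e^{½δd(y,p)}·e^{−½δd(y,y′,Ω)}·e^{−¼δd(p, y(v))}` (`|c_f|L^{j′(v)} ≤ |c_f|L^k`, then FILE 2's chain).
[cite: Balaban1985BackgroundPropagators, Thm 3.14 (3.154) p.427, (3.49) p.399; Balaban1984PropagatorsII, (2.88) p.238, (2.136) p.247] -/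
theorem termD_le_lin (hMh : 1 ≤ Mh) (hP : ∀ μ, 1 ≤ P' μ) {δ CP A B cf : ℝ} (hδ : 0 ≤ δ) (hcf : cf ≠ 0) (hCP : 0 ≤ CP)
    (hA : 0 ≤ A) (hB : 0 ≤ B)
    (hPD : ∀ (μ ν : Fin (d + 1)) (x x' : ↥(boxDom (N0 ℓ Mh k P'))),
      |dPd D μ ν x x'| ≤ CP * ((((ℓ : ℝ) + 1) ^ D.lev x.1) ^ 2)⁻¹ * (W D.toDomains (blkOf D.toDomains x'))⁻¹ *
        Real.exp (-(δ * (geomT D).dist (blkOf D.toDomains x) (blkOf D.toDomains x'))))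
    {y : ↥(bset D.toDomains)} (hy : y.1.1 = k) {y' : ↥(bset D'.toDomains)} (hy' : y'.1.1 = k)
    {g : PBond (PV d ℓ m K hd hL) 0 → ℝ}
    (hg : ∀ v, |g v| ≤ A * ((geomT D').len (blkV1 hN D' v) * |cf|⁻¹) * Real.exp (-(δ * (geomT D').dist (blkV1 hN D' v) y')) * B)
    (f v : PBond (PV d ℓ m K hd hL) 0)
    (hw : ¬ ((D.lev (toBox hN f.src).1 = k ∧ D'.lev (toBox hN f.src).1 = k) ∧ (D.lev (toBox hN v.src).1 = k ∧ D'.lev (toBox hN v.src).1 = k))) :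
    cf ^ 2 * |dPd D f.dir v.dir (toBox hN f.src) (toBox hN v.src)| * |g v|
      ≤ (W D.toDomains (blkV1 hN D v))⁻¹ * (A * B * CP * Real.exp (2 * δ) * (|cf| * ((((ℓ : ℝ) + 1) ^ k))⁻¹)
          * (((ℓ : ℝ) + 1) ^ (2 * k) / ((ℓ : ℝ) + 1) ^ (2 * (blkV1 hN D f).1.1))
          * (Real.exp (1 / 2 * δ * (geomT D).dist y (blkV1 hN D f)) * Real.exp (-(1 / 2 * δ * dOmega D D' y.1.2 y'.1.2)))
          * Real.exp (-(1 / 4 * δ * (geomT D).dist (blkV1 hN D f) (blkV1 hN D v)))) := by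
  have hd0 : ∀ s t : ↥(bset D.toDomains), 0 ≤ (geomT D).dist s t := (triangle_refl_nonneg_T D hMh hP).2.2
  have hd0' : ∀ s t : ↥(bset D'.toDomains), 0 ≤ (geomT D').dist s t := (triangle_refl_nonneg_T D' hMh hP).2.2
  have hL1 : (1 : ℝ) ≤ (ℓ : ℝ) + 1 := by linarith [(Nat.cast_nonneg ℓ : (0 : ℝ) ≤ ℓ)]
  set x := toBox hN f.src with hx
  set z := toBox hN v.src with hz
  have h1 := hPD f.dir v.dir x z
  have h2 := hg v
  have hlev : D.lev x.1 = (blkV1 hN D f).1.1 := rfl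
  rw [hlev] at h1
  have hWq : 0 < W D.toDomains (blkV1 hN D v) := W_pos _ _
  have hκ0 : 0 ≤ |cf| * ((((ℓ : ℝ) + 1) ^ k))⁻¹ := by positivity
  have hψ : cf ^ 2 * ((geomT D').len (blkV1 hN D' v) * |cf|⁻¹) ≤ (|cf| * ((((ℓ : ℝ) + 1) ^ k))⁻¹) * (((ℓ : ℝ) + 1) ^ k) ^ 2 :=
    sq_mul_lin_le D' hcf _
  have hratio : (((ℓ : ℝ) + 1) ^ k) ^ 2 * ((((ℓ : ℝ) + 1) ^ (blkV1 hN D f).1.1) ^ 2)⁻¹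
      = ((ℓ : ℝ) + 1) ^ (2 * k) / ((ℓ : ℝ) + 1) ^ (2 * (blkV1 hN D f).1.1) := by
    rw [← pow_mul, ← pow_mul, mul_comm k 2, mul_comm (blkV1 hN D f).1.1 2, div_eq_mul_inv]
  -- the witness chain
  have hc := dOmega_le_chain D D' (witness_of_not_pairCT D D' hw) y.1.2 y'.1.2
  have t1 : tdistK (ℓ := ℓ) (Mh := Mh) (k := k) (P := P') y.1.2 (blk ((ℓ + 1) ^ k) x.1) ≤ (geomT D).dist y (blkV1 hN D f) + 1 := by
    rw [tdistK_comm]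
    have h := tdistK_blk_le_of_top D hMh hP x hy
    rw [symmT D] at h
    exact h
  have t2 : tdistK (ℓ := ℓ) (Mh := Mh) (k := k) (P := P') (blk ((ℓ + 1) ^ k) x.1) (blk ((ℓ + 1) ^ k) z.1)
      ≤ (geomT D).dist (blkV1 hN D f) (blkV1 hN D v) + 2 := tdistK_blk_blk_le D hMh hP x z
  have t3 : tdistK (ℓ := ℓ) (Mh := Mh) (k := k) (P := P') (blk ((ℓ + 1) ^ k) z.1) y'.1.2 ≤ (geomT D').dist (blkV1 hN D' v) y' + 1 :=
    tdistK_blk_le_of_top D' hMh hP z hy'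
  have hchain : dOmega D D' y.1.2 y'.1.2
      ≤ (geomT D).dist y (blkV1 hN D f) + (geomT D).dist (blkV1 hN D f) (blkV1 hN D v) + (geomT D').dist (blkV1 hN D' v) y' + 4 := by
    linarith
  -- the exponent budget
  have hexp : Real.exp (-(δ * (geomT D).dist (blkV1 hN D f) (blkV1 hN D v))) * Real.exp (-(δ * (geomT D').dist (blkV1 hN D' v) y'))
      ≤ Real.exp (2 * δ) * (Real.exp (1 / 2 * δ * (geomT D).dist y (blkV1 hN D f)) * Real.exp (-(1 / 2 * δ * dOmega D D' y.1.2 y'.1.2)))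
        * Real.exp (-(1 / 4 * δ * (geomT D).dist (blkV1 hN D f) (blkV1 hN D v))) := by
    rw [← Real.exp_add, ← Real.exp_add, ← Real.exp_add, ← Real.exp_add]
    refine Real.exp_le_exp.2 ?_
    have e1 := mul_le_mul_of_nonneg_left hchain hδ
    have e2 := mul_nonneg hδ (hd0 (blkV1 hN D f) (blkV1 hN D v))
    have e3 := mul_nonneg hδ (hd0' (blkV1 hN D' v) y')
    rw [mul_add, mul_add, mul_add] at e1
    linarith
  have hR1 := le_trans (abs_nonneg _) h1
  have hfin : (|cf| * ((((ℓ : ℝ) + 1) ^ k))⁻¹) * (((ℓ : ℝ) + 1) ^ k) ^ 2 * ((((ℓ : ℝ) + 1) ^ (blkV1 hN D f).1.1) ^ 2)⁻¹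
      = (|cf| * ((((ℓ : ℝ) + 1) ^ k))⁻¹) * (((ℓ : ℝ) + 1) ^ (2 * k) / ((ℓ : ℝ) + 1) ^ (2 * (blkV1 hN D f).1.1)) := by
    rw [← hratio]; ring
  calc cf ^ 2 * |dPd D f.dir v.dir x z| * |g v|
      ≤ cf ^ 2 * (CP * ((((ℓ : ℝ) + 1) ^ (blkV1 hN D f).1.1) ^ 2)⁻¹ * (W D.toDomains (blkV1 hN D v))⁻¹
          * Real.exp (-(δ * (geomT D).dist (blkV1 hN D f) (blkV1 hN D v))))
        * (A * ((geomT D').len (blkV1 hN D' v) * |cf|⁻¹) * Real.exp (-(δ * (geomT D').dist (blkV1 hN D' v) y')) * B) :=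
        mul_le_mul (mul_le_mul_of_nonneg_left h1 (sq_nonneg cf)) h2 (abs_nonneg _) (mul_nonneg (sq_nonneg cf) hR1)
    _ = (W D.toDomains (blkV1 hN D v))⁻¹ * (A * B * CP)
        * ((cf ^ 2 * ((geomT D').len (blkV1 hN D' v) * |cf|⁻¹)) * ((((ℓ : ℝ) + 1) ^ (blkV1 hN D f).1.1) ^ 2)⁻¹)
        * (Real.exp (-(δ * (geomT D).dist (blkV1 hN D f) (blkV1 hN D v))) * Real.exp (-(δ * (geomT D').dist (blkV1 hN D' v) y'))) := by
        ring
    _ ≤ (W D.toDomains (blkV1 hN D v))⁻¹ * (A * B * CP)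
        * (((|cf| * ((((ℓ : ℝ) + 1) ^ k))⁻¹) * (((ℓ : ℝ) + 1) ^ k) ^ 2) * ((((ℓ : ℝ) + 1) ^ (blkV1 hN D f).1.1) ^ 2)⁻¹)
        * (Real.exp (-(δ * (geomT D).dist (blkV1 hN D f) (blkV1 hN D v))) * Real.exp (-(δ * (geomT D').dist (blkV1 hN D' v) y'))) := by
        have h0 : 0 ≤ (W D.toDomains (blkV1 hN D v))⁻¹ * (A * B * CP) := by positivity
        exact mul_le_mul_of_nonneg_right (mul_le_mul_of_nonneg_left (mul_le_mul_of_nonneg_right hψ (by positivity)) h0)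
          (by positivity)
    _ ≤ (W D.toDomains (blkV1 hN D v))⁻¹ * (A * B * CP)
        * (((|cf| * ((((ℓ : ℝ) + 1) ^ k))⁻¹) * (((ℓ : ℝ) + 1) ^ k) ^ 2) * ((((ℓ : ℝ) + 1) ^ (blkV1 hN D f).1.1) ^ 2)⁻¹)
        * (Real.exp (2 * δ) * (Real.exp (1 / 2 * δ * (geomT D).dist y (blkV1 hN D f)) * Real.exp (-(1 / 2 * δ * dOmega D D' y.1.2 y'.1.2)))
          * Real.exp (-(1 / 4 * δ * (geomT D).dist (blkV1 hN D f) (blkV1 hN D v)))) :=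
        mul_le_mul_of_nonneg_left hexp (by positivity)
    _ = _ := by rw [hfin]; ring

/-- **(¬CT) PAIRS, THE KERNEL OF `{Ω′_j}`**, linear profile: the term `c_f²·|(∂P[Ω′]∂*)(x, v)|·|g(v)|` is at most
`W′(y′(v))⁻¹·A·B·C_P·L²·e^{2δ}·(|c_f|/L^k)·e^{½δd(y,p)}·e^{−½δd(y,y′,Ω)}·e^{−¼δd′(p′, y′(v))}` (`p′ = y′(x)`; transfer (2.60) in `{Ω′_j}`).
[cite: Balaban1985BackgroundPropagators, Thm 3.14 (3.154) p.427, (3.49) p.399; Balaban1984PropagatorsII, (2.60) p.234, (2.88) p.238, (2.136) p.247] -/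
theorem termD'_le_lin (hMh : 1 ≤ Mh) (hP : ∀ μ, 1 ≤ P' μ) (hRM : 1 ≤ R * ((ℓ + 1) * Mh)) {δ CP A B cf : ℝ} (hδ : 0 ≤ δ) (hcf : cf ≠ 0)
    (hCP : 0 ≤ CP) (hA : 0 ≤ A) (hB : 0 ≤ B)
    (hthr : ((ℓ : ℝ) + 1) ^ 2 ≤ Real.exp (1 / 4 * δ * ((R : ℝ) * (((ℓ : ℝ) + 1) * Mh) - 1)))
    (hPD' : ∀ (μ ν : Fin (d + 1)) (x x' : ↥(boxDom (N0 ℓ Mh k P'))),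
      |dPd D' μ ν x x'| ≤ CP * ((((ℓ : ℝ) + 1) ^ D'.lev x.1) ^ 2)⁻¹ * (W D'.toDomains (blkOf D'.toDomains x'))⁻¹ *
        Real.exp (-(δ * (geomT D').dist (blkOf D'.toDomains x) (blkOf D'.toDomains x'))))
    {y : ↥(bset D.toDomains)} (hy : y.1.1 = k) {y' : ↥(bset D'.toDomains)} (hy' : y'.1.1 = k)
    {g : PBond (PV d ℓ m K hd hL) 0 → ℝ}
    (hg : ∀ v, |g v| ≤ A * ((geomT D').len (blkV1 hN D' v) * |cf|⁻¹) * Real.exp (-(δ * (geomT D').dist (blkV1 hN D' v) y')) * B)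
    (f v : PBond (PV d ℓ m K hd hL) 0)
    (hw : ¬ ((D.lev (toBox hN f.src).1 = k ∧ D'.lev (toBox hN f.src).1 = k) ∧ (D.lev (toBox hN v.src).1 = k ∧ D'.lev (toBox hN v.src).1 = k))) :
    cf ^ 2 * |dPd D' f.dir v.dir (toBox hN f.src) (toBox hN v.src)| * |g v|
      ≤ (W D'.toDomains (blkV1 hN D' v))⁻¹ * (A * B * CP * ((ℓ : ℝ) + 1) ^ 2 * Real.exp (2 * δ) * (|cf| * ((((ℓ : ℝ) + 1) ^ k))⁻¹)
          * (Real.exp (1 / 2 * δ * (geomT D).dist y (blkV1 hN D f)) * Real.exp (-(1 / 2 * δ * dOmega D D' y.1.2 y'.1.2)))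
          * Real.exp (-(1 / 4 * δ * (geomT D').dist (blkV1 hN D' f) (blkV1 hN D' v)))) := by
  have hd0 : ∀ s t : ↥(bset D.toDomains), 0 ≤ (geomT D).dist s t := (triangle_refl_nonneg_T D hMh hP).2.2
  have hd0' : ∀ s t : ↥(bset D'.toDomains), 0 ≤ (geomT D').dist s t := (triangle_refl_nonneg_T D' hMh hP).2.2
  have htri' := triangleTB D' hMh hP
  have hL1 : (1 : ℝ) ≤ (ℓ : ℝ) + 1 := by linarith [(Nat.cast_nonneg ℓ : (0 : ℝ) ≤ ℓ)]
  set x := toBox hN f.src with hx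
  set z := toBox hN v.src with hz
  have h1 := hPD' f.dir v.dir x z
  have h2 := hg v
  have hlev : D'.lev x.1 = (blkV1 hN D' f).1.1 := rfl
  rw [hlev] at h1
  have hWq : 0 < W D'.toDomains (blkV1 hN D' v) := W_pos _ _
  have hκ0 : 0 ≤ |cf| * ((((ℓ : ℝ) + 1) ^ k))⁻¹ := by positivity
  -- scale factors: `|c_f|L^{j′(v)} ≤ (|c_f|/L^k)·(L^k)²`, then the transfer in `{Ω′_j}`
  have hψ : cf ^ 2 * ((geomT D').len (blkV1 hN D' v) * |cf|⁻¹) ≤ (|cf| * ((((ℓ : ℝ) + 1) ^ k))⁻¹) * (((ℓ : ℝ) + 1) ^ k) ^ 2 :=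
    sq_mul_lin_le D' hcf _
  have hratio : (((ℓ : ℝ) + 1) ^ k) ^ 2 * ((((ℓ : ℝ) + 1) ^ (blkV1 hN D' f).1.1) ^ 2)⁻¹
      = ((ℓ : ℝ) + 1) ^ (2 * k) / ((ℓ : ℝ) + 1) ^ (2 * (blkV1 hN D' f).1.1) := by
    rw [← pow_mul, ← pow_mul, mul_comm k 2, mul_comm (blkV1 hN D' f).1.1 2, div_eq_mul_inv]
  have htr := transfer_top D' hMh hP hRM hδ hthr (blkV1 hN D' f) y' hy'
  -- the witness chain
  have hc := dOmega_le_chain D D' (witness_of_not_pairCT D D' hw) y.1.2 y'.1.2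
  have t1 : tdistK (ℓ := ℓ) (Mh := Mh) (k := k) (P := P') y.1.2 (blk ((ℓ + 1) ^ k) x.1) ≤ (geomT D).dist y (blkV1 hN D f) + 1 := by
    rw [tdistK_comm]
    have h := tdistK_blk_le_of_top D hMh hP x hy
    rw [symmT D] at h
    exact h
  have t2 : tdistK (ℓ := ℓ) (Mh := Mh) (k := k) (P := P') (blk ((ℓ + 1) ^ k) x.1) (blk ((ℓ + 1) ^ k) z.1)
      ≤ (geomT D').dist (blkV1 hN D' f) (blkV1 hN D' v) + 2 := tdistK_blk_blk_le D' hMh hP x z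
  have t3 : tdistK (ℓ := ℓ) (Mh := Mh) (k := k) (P := P') (blk ((ℓ + 1) ^ k) z.1) y'.1.2 ≤ (geomT D').dist (blkV1 hN D' v) y' + 1 :=
    tdistK_blk_le_of_top D' hMh hP z hy'
  have hchain : dOmega D D' y.1.2 y'.1.2
      ≤ (geomT D).dist y (blkV1 hN D f) + (geomT D').dist (blkV1 hN D' f) (blkV1 hN D' v) + (geomT D').dist (blkV1 hN D' v) y' + 4 := by
    linarith
  have htri : (geomT D').dist (blkV1 hN D' f) y' ≤ (geomT D').dist (blkV1 hN D' f) (blkV1 hN D' v) + (geomT D').dist (blkV1 hN D' v) y' :=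
    htri' _ _ _
  -- the exponent budget: a quarter to the transfer, a half to the chain, a quarter of `d′(p′, y′(v))` kept
  set a := (geomT D').dist (blkV1 hN D' f) (blkV1 hN D' v) with ha
  set b := (geomT D').dist (blkV1 hN D' v) y' with hb
  have ha0 : 0 ≤ a := hd0' _ _
  have hb0 : 0 ≤ b := hd0' _ _
  have hsplit : Real.exp (-(δ * a)) * Real.exp (-(δ * b))
      = Real.exp (-(1 / 4 * δ * (a + b))) * Real.exp (-(1 / 2 * δ * (a + b))) * Real.exp (-(1 / 4 * δ * a)) * Real.exp (-(1 / 4 * δ * b)) := by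
    rw [← Real.exp_add, ← Real.exp_add, ← Real.exp_add, ← Real.exp_add]
    congr 1; ring
  have hA' : ((ℓ : ℝ) + 1) ^ (2 * k) / ((ℓ : ℝ) + 1) ^ (2 * (blkV1 hN D' f).1.1) * Real.exp (-(1 / 4 * δ * (a + b))) ≤ ((ℓ : ℝ) + 1) ^ 2 := by
    refine le_trans (mul_le_mul_of_nonneg_left (Real.exp_le_exp.2 ?_) (by positivity)) htr
    have := mul_le_mul_of_nonneg_left htri hδ
    linarith
  have hB' : Real.exp (-(1 / 2 * δ * (a + b)))
      ≤ Real.exp (2 * δ) * (Real.exp (1 / 2 * δ * (geomT D).dist y (blkV1 hN D f)) * Real.exp (-(1 / 2 * δ * dOmega D D' y.1.2 y'.1.2))) := by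
    rw [← Real.exp_add, ← Real.exp_add]
    refine Real.exp_le_exp.2 ?_
    have e1 := mul_le_mul_of_nonneg_left hchain hδ
    rw [mul_add, mul_add, mul_add] at e1
    linarith
  have hC' : Real.exp (-(1 / 4 * δ * b)) ≤ 1 := Real.exp_le_one_iff.2 (by nlinarith)
  have hkey : ((ℓ : ℝ) + 1) ^ (2 * k) / ((ℓ : ℝ) + 1) ^ (2 * (blkV1 hN D' f).1.1) * (Real.exp (-(δ * a)) * Real.exp (-(δ * b)))
      ≤ ((ℓ : ℝ) + 1) ^ 2 * (Real.exp (2 * δ) * (Real.exp (1 / 2 * δ * (geomT D).dist y (blkV1 hN D f))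
          * Real.exp (-(1 / 2 * δ * dOmega D D' y.1.2 y'.1.2)))) * Real.exp (-(1 / 4 * δ * a)) * 1 := by
    rw [hsplit]
    calc ((ℓ : ℝ) + 1) ^ (2 * k) / ((ℓ : ℝ) + 1) ^ (2 * (blkV1 hN D' f).1.1)
          * (Real.exp (-(1 / 4 * δ * (a + b))) * Real.exp (-(1 / 2 * δ * (a + b))) * Real.exp (-(1 / 4 * δ * a)) * Real.exp (-(1 / 4 * δ * b)))
        = (((ℓ : ℝ) + 1) ^ (2 * k) / ((ℓ : ℝ) + 1) ^ (2 * (blkV1 hN D' f).1.1) * Real.exp (-(1 / 4 * δ * (a + b))))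
          * Real.exp (-(1 / 2 * δ * (a + b))) * Real.exp (-(1 / 4 * δ * a)) * Real.exp (-(1 / 4 * δ * b)) := by ring
      _ ≤ ((ℓ : ℝ) + 1) ^ 2 * (Real.exp (2 * δ) * (Real.exp (1 / 2 * δ * (geomT D).dist y (blkV1 hN D f))
          * Real.exp (-(1 / 2 * δ * dOmega D D' y.1.2 y'.1.2)))) * Real.exp (-(1 / 4 * δ * a)) * 1 := by
          refine mul_le_mul ?_ hC' (by positivity) (by positivity)
          refine mul_le_mul_of_nonneg_right ?_ (by positivity)
          exact mul_le_mul hA' hB' (by positivity) (by positivity)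
  have hR1 := le_trans (abs_nonneg _) h1
  have hfin : ((|cf| * ((((ℓ : ℝ) + 1) ^ k))⁻¹) * (((ℓ : ℝ) + 1) ^ k) ^ 2) * ((((ℓ : ℝ) + 1) ^ (blkV1 hN D' f).1.1) ^ 2)⁻¹
      * (Real.exp (-(δ * a)) * Real.exp (-(δ * b)))
      = (|cf| * ((((ℓ : ℝ) + 1) ^ k))⁻¹)
        * (((ℓ : ℝ) + 1) ^ (2 * k) / ((ℓ : ℝ) + 1) ^ (2 * (blkV1 hN D' f).1.1) * (Real.exp (-(δ * a)) * Real.exp (-(δ * b)))) := by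
    rw [← hratio]; ring
  calc cf ^ 2 * |dPd D' f.dir v.dir x z| * |g v|
      ≤ cf ^ 2 * (CP * ((((ℓ : ℝ) + 1) ^ (blkV1 hN D' f).1.1) ^ 2)⁻¹ * (W D'.toDomains (blkV1 hN D' v))⁻¹ * Real.exp (-(δ * a)))
        * (A * ((geomT D').len (blkV1 hN D' v) * |cf|⁻¹) * Real.exp (-(δ * b)) * B) :=
        mul_le_mul (mul_le_mul_of_nonneg_left h1 (sq_nonneg cf)) h2 (abs_nonneg _) (mul_nonneg (sq_nonneg cf) hR1)
    _ = (W D'.toDomains (blkV1 hN D' v))⁻¹ * (A * B * CP)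
        * ((cf ^ 2 * ((geomT D').len (blkV1 hN D' v) * |cf|⁻¹)) * ((((ℓ : ℝ) + 1) ^ (blkV1 hN D' f).1.1) ^ 2)⁻¹)
        * (Real.exp (-(δ * a)) * Real.exp (-(δ * b))) := by ring
    _ ≤ (W D'.toDomains (blkV1 hN D' v))⁻¹ * (A * B * CP)
        * (((|cf| * ((((ℓ : ℝ) + 1) ^ k))⁻¹) * (((ℓ : ℝ) + 1) ^ k) ^ 2) * ((((ℓ : ℝ) + 1) ^ (blkV1 hN D' f).1.1) ^ 2)⁻¹)
        * (Real.exp (-(δ * a)) * Real.exp (-(δ * b))) := by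
        have h0 : 0 ≤ (W D'.toDomains (blkV1 hN D' v))⁻¹ * (A * B * CP) := by positivity
        exact mul_le_mul_of_nonneg_right (mul_le_mul_of_nonneg_left (mul_le_mul_of_nonneg_right hψ (by positivity)) h0)
          (by positivity)
    _ = (W D'.toDomains (blkV1 hN D' v))⁻¹ * (A * B * CP) * ((|cf| * ((((ℓ : ℝ) + 1) ^ k))⁻¹)
        * (((ℓ : ℝ) + 1) ^ (2 * k) / ((ℓ : ℝ) + 1) ^ (2 * (blkV1 hN D' f).1.1) * (Real.exp (-(δ * a)) * Real.exp (-(δ * b))))) := by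
        rw [mul_assoc _ (_ * _) (Real.exp (-(δ * a)) * Real.exp (-(δ * b))), hfin]
    _ ≤ (W D'.toDomains (blkV1 hN D' v))⁻¹ * (A * B * CP) * ((|cf| * ((((ℓ : ℝ) + 1) ^ k))⁻¹)
        * (((ℓ : ℝ) + 1) ^ 2 * (Real.exp (2 * δ) * (Real.exp (1 / 2 * δ * (geomT D).dist y (blkV1 hN D f))
          * Real.exp (-(1 / 2 * δ * dOmega D D' y.1.2 y'.1.2)))) * Real.exp (-(1 / 4 * δ * a)) * 1)) :=
        mul_le_mul_of_nonneg_left (mul_le_mul_of_nonneg_left hkey hκ0) (by positivity)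
    _ = _ := by ring

/-- **THE `∂P∂*` LETTER BETWEEN THE TWO FACTORS, AT ONE FINE BOND**, linear profile: with `p = y(x)` the block of `f` in `{Ω_j}`,
`|(V_P g)(f)| ≤ (d+1)·c·(C_Δ + C_P e^{2δ}(1 + L²))·A·B·(|c_f|/L^k)·(L^{2k}/L^{2j(p)})·e^{½δd(y,p)}·e^{−½δd(y,y′,Ω)}`.
[cite: Balaban1985BackgroundPropagators, Thm 3.14 (3.154) p.427; Balaban1984PropagatorsII, (2.22) p.226, (2.61) p.234, (2.88) p.238, (2.136) p.247] -/
theorem abs_VP_apply_le_lin (hMh : 1 ≤ Mh) (hP : ∀ μ, 1 ≤ P' μ) (hRM : 1 ≤ R * ((ℓ + 1) * Mh)) {δ c CΔ CP A B cf : ℝ} (hδ : 0 ≤ δ)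
    (hcf : cf ≠ 0) (hCΔ : 0 ≤ CΔ) (hCP : 0 ≤ CP) (hA : 0 ≤ A) (hB : 0 ≤ B) (hc : 0 ≤ c)
    (hthr : ((ℓ : ℝ) + 1) ^ 2 ≤ Real.exp (1 / 4 * δ * ((R : ℝ) * (((ℓ : ℝ) + 1) * Mh) - 1)))
    (h261 : Ineq261With c (geomT D) δ (1 / 4)) (h261' : Ineq261With c (geomT D') δ (1 / 4))
    (hΔ : ∀ (p q : ℕ × (Fin (d + 1) → ℤ)) (hpD : p ∈ bset D.toDomains) (hpD' : p ∈ bset D'.toDomains)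
      (hqD : q ∈ bset D.toDomains) (hqD' : q ∈ bset D'.toDomains), p.1 = k → q.1 = k →
      ∀ (x x' : ↥(boxDom (N0 ℓ Mh k P'))), blkOf D.toDomains x = ⟨p, hpD⟩ → blkOf D.toDomains x' = ⟨q, hqD⟩ →
      ∀ μ ν : Fin (d + 1), |dPd D μ ν x x' - dPd D' μ ν x x'|
        ≤ CΔ * ((((ℓ : ℝ) + 1) ^ k) ^ 2)⁻¹ * ((((ℓ : ℝ) + 1) ^ k) ^ (d + 1))⁻¹
          * Real.exp (-(δ * min ((geomT D).dist ⟨p, hpD⟩ ⟨q, hqD⟩) ((geomT D').dist ⟨p, hpD'⟩ ⟨q, hqD'⟩)))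
          * Real.exp (-(δ * dOmega D D' p.2 q.2)))
    (hPD : ∀ (μ ν : Fin (d + 1)) (x x' : ↥(boxDom (N0 ℓ Mh k P'))),
      |dPd D μ ν x x'| ≤ CP * ((((ℓ : ℝ) + 1) ^ D.lev x.1) ^ 2)⁻¹ * (W D.toDomains (blkOf D.toDomains x'))⁻¹ *
        Real.exp (-(δ * (geomT D).dist (blkOf D.toDomains x) (blkOf D.toDomains x'))))
    (hPD' : ∀ (μ ν : Fin (d + 1)) (x x' : ↥(boxDom (N0 ℓ Mh k P'))),
      |dPd D' μ ν x x'| ≤ CP * ((((ℓ : ℝ) + 1) ^ D'.lev x.1) ^ 2)⁻¹ * (W D'.toDomains (blkOf D'.toDomains x'))⁻¹ *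
        Real.exp (-(δ * (geomT D').dist (blkOf D'.toDomains x) (blkOf D'.toDomains x'))))
    {y : ↥(bset D.toDomains)} (hy : y.1.1 = k) {y' : ↥(bset D'.toDomains)} (hy' : y'.1.1 = k)
    {g : PBond (PV d ℓ m K hd hL) 0 → ℝ}
    (hg : ∀ v, |g v| ≤ A * ((geomT D').len (blkV1 hN D' v) * |cf|⁻¹) * Real.exp (-(δ * (geomT D').dist (blkV1 hN D' v) y')) * B)
    (f : PBond (PV d ℓ m K hd hL) 0) :
    |VP hN D D' cf g f| ≤ ((d : ℝ) + 1) * c * (CΔ + CP * Real.exp (2 * δ) * (1 + ((ℓ : ℝ) + 1) ^ 2)) * A * B * (|cf| * ((((ℓ : ℝ) + 1) ^ k))⁻¹)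
        * (((ℓ : ℝ) + 1) ^ (2 * k) / ((ℓ : ℝ) + 1) ^ (2 * (blkV1 hN D f).1.1)) * (Real.exp (1 / 2 * δ * (geomT D).dist y (blkV1 hN D f)) * Real.exp (-(1 / 2 * δ * dOmega D D' y.1.2 y'.1.2))) := by
  have hWq : ∀ q : ↥(bset D.toDomains), 0 < W D.toDomains q := fun q => W_pos _ _
  have hWq' : ∀ q : ↥(bset D'.toDomains), 0 < W D'.toDomains q := fun q => W_pos _ _
  have hρ1 : 1 ≤ (((ℓ : ℝ) + 1) ^ (2 * k) / ((ℓ : ℝ) + 1) ^ (2 * (blkV1 hN D f).1.1)) := one_le_ratio D _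
  have hρ0 : 0 ≤ (((ℓ : ℝ) + 1) ^ (2 * k) / ((ℓ : ℝ) + 1) ^ (2 * (blkV1 hN D f).1.1)) := le_trans zero_le_one hρ1
  have hκ0 : 0 ≤ |cf| * ((((ℓ : ℝ) + 1) ^ k))⁻¹ := by positivity
  have hE0 : 0 ≤ (Real.exp (1 / 2 * δ * (geomT D).dist y (blkV1 hN D f)) * Real.exp (-(1 / 2 * δ * dOmega D D' y.1.2 y'.1.2))) := by positivity
  -- the expansion in point masses and the splitting of the pairs
  rw [B6Prop23Chain.apply_eq_sum_mat (VP hN D D' cf) g f]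
  have hT : ∀ v, |VP hN D D' cf (Pi.single v (1 : ℝ)) f * g v|
      ≤ (if ((D.lev (toBox hN f.src).1 = k ∧ D'.lev (toBox hN f.src).1 = k) ∧ (D.lev (toBox hN v.src).1 = k ∧ D'.lev (toBox hN v.src).1 = k)) then cf ^ 2 * |dPd D f.dir v.dir (toBox hN f.src) (toBox hN v.src) - dPd D' f.dir v.dir (toBox hN f.src) (toBox hN v.src)| * |g v|
          else 0)
        + (if ((D.lev (toBox hN f.src).1 = k ∧ D'.lev (toBox hN f.src).1 = k) ∧ (D.lev (toBox hN v.src).1 = k ∧ D'.lev (toBox hN v.src).1 = k)) then 0 else cf ^ 2 * |dPd D f.dir v.dir (toBox hN f.src) (toBox hN v.src)| * |g v|)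
        + (if ((D.lev (toBox hN f.src).1 = k ∧ D'.lev (toBox hN f.src).1 = k) ∧ (D.lev (toBox hN v.src).1 = k ∧ D'.lev (toBox hN v.src).1 = k)) then 0 else cf ^ 2 * |dPd D' f.dir v.dir (toBox hN f.src) (toBox hN v.src)| * |g v|) := by
    intro v
    rw [VP_single_apply, abs_mul, abs_mul, abs_of_nonneg (sq_nonneg cf)]
    by_cases hct : ((D.lev (toBox hN f.src).1 = k ∧ D'.lev (toBox hN f.src).1 = k) ∧ (D.lev (toBox hN v.src).1 = k ∧ D'.lev (toBox hN v.src).1 = k))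
    · simp only [if_pos hct]
      linarith
    · simp only [if_neg hct]
      have hab := abs_sub (dPd D f.dir v.dir (toBox hN f.src) (toBox hN v.src)) (dPd D' f.dir v.dir (toBox hN f.src) (toBox hN v.src))
      have h0 : 0 ≤ cf ^ 2 * |g v| := by positivity
      calc cf ^ 2 * |dPd D f.dir v.dir (toBox hN f.src) (toBox hN v.src) - dPd D' f.dir v.dir (toBox hN f.src) (toBox hN v.src)| * |g v|
          = (cf ^ 2 * |g v|) * |dPd D f.dir v.dir (toBox hN f.src) (toBox hN v.src) - dPd D' f.dir v.dir (toBox hN f.src) (toBox hN v.src)| := by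
            ring
        _ ≤ (cf ^ 2 * |g v|) * (|dPd D f.dir v.dir (toBox hN f.src) (toBox hN v.src)| + |dPd D' f.dir v.dir (toBox hN f.src) (toBox hN v.src)|) :=
            mul_le_mul_of_nonneg_left hab h0
        _ = _ := by ring
  -- the three per-term bounds in fibre form
  have hF1 : ∀ v, (if ((D.lev (toBox hN f.src).1 = k ∧ D'.lev (toBox hN f.src).1 = k) ∧ (D.lev (toBox hN v.src).1 = k ∧ D'.lev (toBox hN v.src).1 = k)) then cf ^ 2 * |dPd D f.dir v.dir (toBox hN f.src) (toBox hN v.src) - dPd D' f.dir v.dir (toBox hN f.src) (toBox hN v.src)| * |g v|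
          else 0)
      ≤ (W D'.toDomains (blkV1 hN D' v))⁻¹ * (A * B * CΔ * (|cf| * ((((ℓ : ℝ) + 1) ^ k))⁻¹) * (Real.exp (1 / 2 * δ * (geomT D).dist y (blkV1 hN D f)) * Real.exp (-(1 / 2 * δ * dOmega D D' y.1.2 y'.1.2))) * Real.exp (-(1 / 4 * δ * (geomT D').dist y' (blkV1 hN D' v)))) := by
    intro v
    by_cases hct : ((D.lev (toBox hN f.src).1 = k ∧ D'.lev (toBox hN f.src).1 = k) ∧ (D.lev (toBox hN v.src).1 = k ∧ D'.lev (toBox hN v.src).1 = k))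
    · rw [if_pos hct]
      exact termCT_le_lin hN D D' hMh hP hδ hcf hCΔ hA hB hΔ hy hy' hg f v hct.1 hct.2
    · rw [if_neg hct]
      exact mul_nonneg (inv_nonneg.2 (hWq' _).le) (by positivity)
  have hF2 : ∀ v, (if ((D.lev (toBox hN f.src).1 = k ∧ D'.lev (toBox hN f.src).1 = k) ∧ (D.lev (toBox hN v.src).1 = k ∧ D'.lev (toBox hN v.src).1 = k)) then 0 else cf ^ 2 * |dPd D f.dir v.dir (toBox hN f.src) (toBox hN v.src)| * |g v|)
      ≤ (W D.toDomains (blkV1 hN D v))⁻¹ * (A * B * CP * Real.exp (2 * δ) * (|cf| * ((((ℓ : ℝ) + 1) ^ k))⁻¹) * (((ℓ : ℝ) + 1) ^ (2 * k) / ((ℓ : ℝ) + 1) ^ (2 * (blkV1 hN D f).1.1)) * (Real.exp (1 / 2 * δ * (geomT D).dist y (blkV1 hN D f)) * Real.exp (-(1 / 2 * δ * dOmega D D' y.1.2 y'.1.2)))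
          * Real.exp (-(1 / 4 * δ * (geomT D).dist (blkV1 hN D f) (blkV1 hN D v)))) := by
    intro v
    by_cases hct : ((D.lev (toBox hN f.src).1 = k ∧ D'.lev (toBox hN f.src).1 = k) ∧ (D.lev (toBox hN v.src).1 = k ∧ D'.lev (toBox hN v.src).1 = k))
    · rw [if_pos hct]
      exact mul_nonneg (inv_nonneg.2 (hWq _).le) (by positivity)
    · rw [if_neg hct]
      exact termD_le_lin hN D D' hMh hP hδ hcf hCP hA hB hPD hy hy' hg f v hct
  have hF3 : ∀ v, (if ((D.lev (toBox hN f.src).1 = k ∧ D'.lev (toBox hN f.src).1 = k) ∧ (D.lev (toBox hN v.src).1 = k ∧ D'.lev (toBox hN v.src).1 = k)) then 0 else cf ^ 2 * |dPd D' f.dir v.dir (toBox hN f.src) (toBox hN v.src)| * |g v|)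
      ≤ (W D'.toDomains (blkV1 hN D' v))⁻¹ * (A * B * CP * ((ℓ : ℝ) + 1) ^ 2 * Real.exp (2 * δ) * (|cf| * ((((ℓ : ℝ) + 1) ^ k))⁻¹) * (Real.exp (1 / 2 * δ * (geomT D).dist y (blkV1 hN D f)) * Real.exp (-(1 / 2 * δ * dOmega D D' y.1.2 y'.1.2)))
          * Real.exp (-(1 / 4 * δ * (geomT D').dist (blkV1 hN D' f) (blkV1 hN D' v)))) := by
    intro v
    by_cases hct : ((D.lev (toBox hN f.src).1 = k ∧ D'.lev (toBox hN f.src).1 = k) ∧ (D.lev (toBox hN v.src).1 = k ∧ D'.lev (toBox hN v.src).1 = k))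
    · rw [if_pos hct]
      exact mul_nonneg (inv_nonneg.2 (hWq' _).le) (by positivity)
    · rw [if_neg hct]
      exact termD'_le_lin hN D D' hMh hP hRM hδ hcf hCP hA hB hthr hPD' hy hy' hg f v hct
  have hS1 := sum_le_of_fibre_bound hN D' _ (fun q' => A * B * CΔ * (|cf| * ((((ℓ : ℝ) + 1) ^ k))⁻¹) * (Real.exp (1 / 2 * δ * (geomT D).dist y (blkV1 hN D f)) * Real.exp (-(1 / 2 * δ * dOmega D D' y.1.2 y'.1.2))) * Real.exp (-(1 / 4 * δ * (geomT D').dist y' q')))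
    (fun q' => by positivity) hF1
  have hS2 := sum_le_of_fibre_bound hN D _ (fun q => A * B * CP * Real.exp (2 * δ) * (|cf| * ((((ℓ : ℝ) + 1) ^ k))⁻¹) * (((ℓ : ℝ) + 1) ^ (2 * k) / ((ℓ : ℝ) + 1) ^ (2 * (blkV1 hN D f).1.1)) * (Real.exp (1 / 2 * δ * (geomT D).dist y (blkV1 hN D f)) * Real.exp (-(1 / 2 * δ * dOmega D D' y.1.2 y'.1.2)))
    * Real.exp (-(1 / 4 * δ * (geomT D).dist (blkV1 hN D f) q))) (fun q => by positivity) hF2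
  have hS3 := sum_le_of_fibre_bound hN D' _ (fun q' => A * B * CP * ((ℓ : ℝ) + 1) ^ 2 * Real.exp (2 * δ) * (|cf| * ((((ℓ : ℝ) + 1) ^ k))⁻¹) * (Real.exp (1 / 2 * δ * (geomT D).dist y (blkV1 hN D f)) * Real.exp (-(1 / 2 * δ * dOmega D D' y.1.2 y'.1.2)))
    * Real.exp (-(1 / 4 * δ * (geomT D').dist (blkV1 hN D' f) q'))) (fun q' => by positivity) hF3
  -- (2.61) in each family
  have hG1 : ∑ q' : ↥(bset D'.toDomains), A * B * CΔ * (|cf| * ((((ℓ : ℝ) + 1) ^ k))⁻¹) * (Real.exp (1 / 2 * δ * (geomT D).dist y (blkV1 hN D f)) * Real.exp (-(1 / 2 * δ * dOmega D D' y.1.2 y'.1.2))) * Real.exp (-(1 / 4 * δ * (geomT D').dist y' q'))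
      ≤ A * B * CΔ * (|cf| * ((((ℓ : ℝ) + 1) ^ k))⁻¹) * (Real.exp (1 / 2 * δ * (geomT D).dist y (blkV1 hN D f)) * Real.exp (-(1 / 2 * δ * dOmega D D' y.1.2 y'.1.2))) * c := by
    rw [← Finset.mul_sum]
    exact mul_le_mul_of_nonneg_left (h261' y') (by positivity)
  have hG2 : ∑ q : ↥(bset D.toDomains), A * B * CP * Real.exp (2 * δ) * (|cf| * ((((ℓ : ℝ) + 1) ^ k))⁻¹) * (((ℓ : ℝ) + 1) ^ (2 * k) / ((ℓ : ℝ) + 1) ^ (2 * (blkV1 hN D f).1.1)) * (Real.exp (1 / 2 * δ * (geomT D).dist y (blkV1 hN D f)) * Real.exp (-(1 / 2 * δ * dOmega D D' y.1.2 y'.1.2)))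
      * Real.exp (-(1 / 4 * δ * (geomT D).dist (blkV1 hN D f) q)) ≤ A * B * CP * Real.exp (2 * δ) * (|cf| * ((((ℓ : ℝ) + 1) ^ k))⁻¹) * (((ℓ : ℝ) + 1) ^ (2 * k) / ((ℓ : ℝ) + 1) ^ (2 * (blkV1 hN D f).1.1)) * (Real.exp (1 / 2 * δ * (geomT D).dist y (blkV1 hN D f)) * Real.exp (-(1 / 2 * δ * dOmega D D' y.1.2 y'.1.2))) * c := by
    rw [← Finset.mul_sum]
    exact mul_le_mul_of_nonneg_left (h261 (blkV1 hN D f)) (by positivity)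
  have hG3 : ∑ q' : ↥(bset D'.toDomains), A * B * CP * ((ℓ : ℝ) + 1) ^ 2 * Real.exp (2 * δ) * (|cf| * ((((ℓ : ℝ) + 1) ^ k))⁻¹) * (Real.exp (1 / 2 * δ * (geomT D).dist y (blkV1 hN D f)) * Real.exp (-(1 / 2 * δ * dOmega D D' y.1.2 y'.1.2)))
      * Real.exp (-(1 / 4 * δ * (geomT D').dist (blkV1 hN D' f) q')) ≤ A * B * CP * ((ℓ : ℝ) + 1) ^ 2 * Real.exp (2 * δ) * (|cf| * ((((ℓ : ℝ) + 1) ^ k))⁻¹) * (Real.exp (1 / 2 * δ * (geomT D).dist y (blkV1 hN D f)) * Real.exp (-(1 / 2 * δ * dOmega D D' y.1.2 y'.1.2))) * c := by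
    rw [← Finset.mul_sum]
    exact mul_le_mul_of_nonneg_left (h261' (blkV1 hN D' f)) (by positivity)
  have hd1 : (0 : ℝ) ≤ (d : ℝ) + 1 := by positivity
  -- assembling
  refine (Finset.abs_sum_le_sum_abs _ _).trans ?_
  refine (Finset.sum_le_sum fun v _ => hT v).trans ?_
  rw [Finset.sum_add_distrib, Finset.sum_add_distrib]
  have hfin : ((d : ℝ) + 1) * (A * B * CΔ * (|cf| * ((((ℓ : ℝ) + 1) ^ k))⁻¹) * (Real.exp (1 / 2 * δ * (geomT D).dist y (blkV1 hN D f)) * Real.exp (-(1 / 2 * δ * dOmega D D' y.1.2 y'.1.2))) * c) + ((d : ℝ) + 1) * (A * B * CP * Real.exp (2 * δ) * (|cf| * ((((ℓ : ℝ) + 1) ^ k))⁻¹) * (((ℓ : ℝ) + 1) ^ (2 * k) / ((ℓ : ℝ) + 1) ^ (2 * (blkV1 hN D f).1.1)) * (Real.exp (1 / 2 * δ * (geomT D).dist y (blkV1 hN D f)) * Real.exp (-(1 / 2 * δ * dOmega D D' y.1.2 y'.1.2))) * c)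
      + ((d : ℝ) + 1) * (A * B * CP * ((ℓ : ℝ) + 1) ^ 2 * Real.exp (2 * δ) * (|cf| * ((((ℓ : ℝ) + 1) ^ k))⁻¹) * (Real.exp (1 / 2 * δ * (geomT D).dist y (blkV1 hN D f)) * Real.exp (-(1 / 2 * δ * dOmega D D' y.1.2 y'.1.2))) * c)
      ≤ ((d : ℝ) + 1) * c * (CΔ + CP * Real.exp (2 * δ) * (1 + ((ℓ : ℝ) + 1) ^ 2)) * A * B * (|cf| * ((((ℓ : ℝ) + 1) ^ k))⁻¹) * (((ℓ : ℝ) + 1) ^ (2 * k) / ((ℓ : ℝ) + 1) ^ (2 * (blkV1 hN D f).1.1)) * (Real.exp (1 / 2 * δ * (geomT D).dist y (blkV1 hN D f)) * Real.exp (-(1 / 2 * δ * dOmega D D' y.1.2 y'.1.2))) := by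
    have hk0 : 0 ≤ ((d : ℝ) + 1) * c * A * B * (|cf| * ((((ℓ : ℝ) + 1) ^ k))⁻¹) * (Real.exp (1 / 2 * δ * (geomT D).dist y (blkV1 hN D f)) * Real.exp (-(1 / 2 * δ * dOmega D D' y.1.2 y'.1.2))) * (CΔ + CP * Real.exp (2 * δ) * ((ℓ : ℝ) + 1) ^ 2) * ((((ℓ : ℝ) + 1) ^ (2 * k) / ((ℓ : ℝ) + 1) ^ (2 * (blkV1 hN D f).1.1)) - 1) := by
      have : 0 ≤ (((ℓ : ℝ) + 1) ^ (2 * k) / ((ℓ : ℝ) + 1) ^ (2 * (blkV1 hN D f).1.1)) - 1 := by linarith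
      positivity
    have e : ((d : ℝ) + 1) * c * (CΔ + CP * Real.exp (2 * δ) * (1 + ((ℓ : ℝ) + 1) ^ 2)) * A * B * (|cf| * ((((ℓ : ℝ) + 1) ^ k))⁻¹) * (((ℓ : ℝ) + 1) ^ (2 * k) / ((ℓ : ℝ) + 1) ^ (2 * (blkV1 hN D f).1.1)) * (Real.exp (1 / 2 * δ * (geomT D).dist y (blkV1 hN D f)) * Real.exp (-(1 / 2 * δ * dOmega D D' y.1.2 y'.1.2)))
        - (((d : ℝ) + 1) * (A * B * CΔ * (|cf| * ((((ℓ : ℝ) + 1) ^ k))⁻¹) * (Real.exp (1 / 2 * δ * (geomT D).dist y (blkV1 hN D f)) * Real.exp (-(1 / 2 * δ * dOmega D D' y.1.2 y'.1.2))) * c) + ((d : ℝ) + 1) * (A * B * CP * Real.exp (2 * δ) * (|cf| * ((((ℓ : ℝ) + 1) ^ k))⁻¹) * (((ℓ : ℝ) + 1) ^ (2 * k) / ((ℓ : ℝ) + 1) ^ (2 * (blkV1 hN D f).1.1)) * (Real.exp (1 / 2 * δ * (geomT D).dist y (blkV1 hN D f)) * Real.exp (-(1 / 2 * δ * dOmega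 D D' y.1.2 y'.1.2))) * c)
          + ((d : ℝ) + 1) * (A * B * CP * ((ℓ : ℝ) + 1) ^ 2 * Real.exp (2 * δ) * (|cf| * ((((ℓ : ℝ) + 1) ^ k))⁻¹) * (Real.exp (1 / 2 * δ * (geomT D).dist y (blkV1 hN D f)) * Real.exp (-(1 / 2 * δ * dOmega D D' y.1.2 y'.1.2))) * c))
        = ((d : ℝ) + 1) * c * A * B * (|cf| * ((((ℓ : ℝ) + 1) ^ k))⁻¹) * (Real.exp (1 / 2 * δ * (geomT D).dist y (blkV1 hN D f)) * Real.exp (-(1 / 2 * δ * dOmega D D' y.1.2 y'.1.2))) * (CΔ + CP * Real.exp (2 * δ) * ((ℓ : ℝ) + 1) ^ 2) * ((((ℓ : ℝ) + 1) ^ (2 * k) / ((ℓ : ℝ) + 1) ^ (2 * (blkV1 hN D f).1.1)) - 1) := by ring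
    linarith
  refine le_trans ?_ hfin
  exact add_le_add (add_le_add (hS1.trans (mul_le_mul_of_nonneg_left hG1 hd1)) (hS2.trans (mul_le_mul_of_nonneg_left hG2 hd1)))
    (hS3.trans (mul_le_mul_of_nonneg_left hG3 hd1))

end PPart

/-! ## §2  The `Q*aQ` letter between the two factors, inner output with the linear profile -/

section QPart

variable (hN : ∀ μ, N0 ℓ Mh k P' μ = (PV d ℓ m K hd hL).sitesPerDir 0) (D D' : TDomains d ℓ Mh k P' R) (hk : k ≤ m + K)

/-- **THE INNER PROFILE THROUGH A TUBE WITNESS**, linear profile: if the `k`-lattice point of `f` lies in `Ωᶜ` and `f′` is within torus distance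
`2L^k` of `f`, then `|g(f′)| ≤ A·B·(L^{j′(f′)}|c_f|⁻¹)·e^{(5/2)δ}·e^{½δd(y,p)}·e^{−½δd(y,y′,Ω)}·e^{−½δd′(y′(f′),y′)}`.
[cite: Balaban1985BackgroundPropagators, Thm 3.14 (3.154) p.427; Balaban1984PropagatorsII, (2.136) p.247] -/
theorem gprof_tube_lin (hMh : 1 ≤ Mh) (hP : ∀ μ, 1 ≤ P' μ) {δ A B cf : ℝ} (hδ : 0 ≤ δ) (hA : 0 ≤ A) (hB : 0 ≤ B)
    {y : ↥(bset D.toDomains)} (hy : y.1.1 = k) {y' : ↥(bset D'.toDomains)} (hy' : y'.1.1 = k)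
    {g : PBond (PV d ℓ m K hd hL) 0 → ℝ}
    (hg : ∀ v, |g v| ≤ A * ((geomT D').len (blkV1 hN D' v) * |cf|⁻¹) * Real.exp (-(δ * (geomT D').dist (blkV1 hN D' v) y')) * B)
    (f f' : PBond (PV d ℓ m K hd hL) 0) (hwit : blk ((ℓ + 1) ^ k) (toBox hN f.src).1 ∈ OmegaC D D')
    (hdist : dist (toT (N0 ℓ Mh k P') (toR (toBox hN f.src).1)) (toT (N0 ℓ Mh k P') (toR (toBox hN f'.src).1)) ≤ 2 * (((ℓ + 1) ^ k : ℕ) : ℝ)) :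
    |g f'| ≤ A * B * ((geomT D').len (blkV1 hN D' f') * |cf|⁻¹) * (Real.exp (5 / 2 * δ) * (Real.exp (1 / 2 * δ * (geomT D).dist y (blkV1 hN D f)) * Real.exp (-(1 / 2 * δ * dOmega D D' y.1.2 y'.1.2))))
      * Real.exp (-(1 / 2 * δ * (geomT D').dist (blkV1 hN D' f') y')) := by
  have hd0' : ∀ s t : ↥(bset D'.toDomains), 0 ≤ (geomT D').dist s t := (triangle_refl_nonneg_T D' hMh hP).2.2
  have h2 := hg f'
  have hc := dOmega_le_chain D D' (β₂ := blk ((ℓ + 1) ^ k) (toBox hN f'.src).1) (Or.inl hwit) y.1.2 y'.1.2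
  have t1 : tdistK (ℓ := ℓ) (Mh := Mh) (k := k) (P := P') y.1.2 (blk ((ℓ + 1) ^ k) (toBox hN f.src).1) ≤ (geomT D).dist y (blkV1 hN D f) + 1 := by
    rw [tdistK_comm]
    have h := tdistK_blk_le_of_top D hMh hP (toBox hN f.src) hy
    rw [symmT D] at h
    exact h
  have t2 : tdistK (ℓ := ℓ) (Mh := Mh) (k := k) (P := P') (blk ((ℓ + 1) ^ k) (toBox hN f.src).1) (blk ((ℓ + 1) ^ k) (toBox hN f'.src).1) ≤ 2 + 1 :=
    tdistK_blk_blk_le_of_dist hdist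
  have t3 : tdistK (ℓ := ℓ) (Mh := Mh) (k := k) (P := P') (blk ((ℓ + 1) ^ k) (toBox hN f'.src).1) y'.1.2 ≤ (geomT D').dist (blkV1 hN D' f') y' + 1 :=
    tdistK_blk_le_of_top D' hMh hP (toBox hN f'.src) hy'
  have hchain : dOmega D D' y.1.2 y'.1.2 ≤ (geomT D).dist y (blkV1 hN D f) + (geomT D').dist (blkV1 hN D' f') y' + 5 := by linarith
  have hexp : Real.exp (-(δ * (geomT D').dist (blkV1 hN D' f') y'))
      ≤ (Real.exp (5 / 2 * δ) * (Real.exp (1 / 2 * δ * (geomT D).dist y (blkV1 hN D f)) * Real.exp (-(1 / 2 * δ * dOmega D D' y.1.2 y'.1.2)))) * Real.exp (-(1 / 2 * δ * (geomT D').dist (blkV1 hN D' f') y')) := by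
    rw [← Real.exp_add, ← Real.exp_add, ← Real.exp_add]
    refine Real.exp_le_exp.2 ?_
    have e1 := mul_le_mul_of_nonneg_left hchain hδ
    have e2 := mul_nonneg hδ (hd0' (blkV1 hN D' f') y')
    rw [mul_add, mul_add] at e1
    linarith
  have hψ0 := lin_nonneg D' cf (blkV1 hN D' f')
  calc |g f'| ≤ A * ((geomT D').len (blkV1 hN D' f') * |cf|⁻¹) * Real.exp (-(δ * (geomT D').dist (blkV1 hN D' f') y')) * B := h2
    _ = A * B * ((geomT D').len (blkV1 hN D' f') * |cf|⁻¹) * Real.exp (-(δ * (geomT D').dist (blkV1 hN D' f') y')) := by ring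
    _ ≤ A * B * ((geomT D').len (blkV1 hN D' f') * |cf|⁻¹) * ((Real.exp (5 / 2 * δ) * (Real.exp (1 / 2 * δ * (geomT D).dist y (blkV1 hN D f)) * Real.exp (-(1 / 2 * δ * dOmega D D' y.1.2 y'.1.2))))
        * Real.exp (-(1 / 2 * δ * (geomT D').dist (blkV1 hN D' f') y'))) :=
        mul_le_mul_of_nonneg_left hexp (mul_nonneg (mul_nonneg hA hB) hψ0)
    _ = _ := by ring

/-- **THE SURVIVING INDEX BONDS OF `{Ω_j}`** (`Q*v` with the truncated weighted averages `v` of FILE 1), linear profile: at every fine bond `f` in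
the block `p` of `{Ω_j}`, `|(Q*v)(f)| ≤ 2b₁·A·B·e^{(5/2)δ}·(|c_f|/L^k)·(L^{2k}/L^{2j(p)})·e^{½δd(y,p)}·e^{−½δd(y,y′,Ω)}`.
[cite: Balaban1985BackgroundPropagators, Thm 3.14 (3.154) p.427; Balaban1984PropagatorsII, (2.16) p.225, (2.18)–(2.20) p.226, (2.3) p.224, (2.136) p.247] -/
theorem abs_QsE_trunc_le_lin (hk1 : 1 ≤ k) (hMh : 1 ≤ Mh) (hP : ∀ μ, 1 ≤ P' μ) {δ b₁ A B cf : ℝ} (hδ : 0 ≤ δ) (hcf : cf ≠ 0) (hb₁ : 0 ≤ b₁)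
    (hA : 0 ≤ A) (hB : 0 ≤ B) {w : BondIdx (domT hN D hk) → ℝ} (hw0 : ∀ i, 0 ≤ w i)
    (hwb : ∀ i, w i ≤ b₁ * cf ^ 2 * ((((ℓ : ℝ) + 1) ^ (i.1.1 : ℕ)) ^ (d + 1)) * (((((ℓ : ℝ) + 1) ^ (i.1.1 : ℕ)) ^ 2))⁻¹)
    {y : ↥(bset D.toDomains)} (hy : y.1.1 = k) {y' : ↥(bset D'.toDomains)} (hy' : y'.1.1 = k)
    {g : PBond (PV d ℓ m K hd hL) 0 → ℝ}
    (hg : ∀ v, |g v| ≤ A * ((geomT D').len (blkV1 hN D' v) * |cf|⁻¹) * Real.exp (-(δ * (geomT D').dist (blkV1 hN D' v) y')) * B)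
    (f : PBond (PV d ℓ m K hd hL) 0) :
    |QsE (domT hN D hk) (trunc hN D D' hk w g) f| ≤ 2 * b₁ * A * B * Real.exp (5 / 2 * δ) * (|cf| * ((((ℓ : ℝ) + 1) ^ k))⁻¹) * (((ℓ : ℝ) + 1) ^ (2 * k) / ((ℓ : ℝ) + 1) ^ (2 * (blkV1 hN D f).1.1)) * (Real.exp (1 / 2 * δ * (geomT D).dist y (blkV1 hN D f)) * Real.exp (-(1 / 2 * δ * dOmega D D' y.1.2 y'.1.2))) := by
  have hd0' : ∀ s t : ↥(bset D'.toDomains), 0 ≤ (geomT D').dist s t := (triangle_refl_nonneg_T D' hMh hP).2.2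
  have hL2 : (2 : ℝ) ≤ (ℓ : ℝ) + 1 := by
    have h1 : (1 : ℝ) ≤ (ℓ : ℝ) := by exact_mod_cast (show 1 ≤ ℓ by have := hL.2; omega)
    linarith
  have hL0 : (0 : ℝ) < (ℓ : ℝ) + 1 := by linarith
  have hL1 : (1 : ℝ) ≤ (ℓ : ℝ) + 1 := by linarith
  have hLk0 : (0 : ℝ) < ((ℓ : ℝ) + 1) ^ k := by positivity
  have hE0 : 0 ≤ Real.exp (5 / 2 * δ) * (Real.exp (1 / 2 * δ * (geomT D).dist y (blkV1 hN D f)) * Real.exp (-(1 / 2 * δ * dOmega D D' y.1.2 y'.1.2))) := by positivity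
  -- the bound on `|g|` over the tube of a surviving index bond charging `f`
  have hM : ∀ i : BondIdx (domT hN D hk), ¬ IsCT hN D D' hk i.1 →
      bondAvgIter (P := PV d ℓ m K hd hL) (i.1.1 : ℕ) (Pi.single f (1 : ℝ)) i.1.2 ≠ 0 →
      ∀ f', bondAvgIter (P := PV d ℓ m K hd hL) (i.1.1 : ℕ) (Pi.single f' (1 : ℝ)) i.1.2 ≠ 0 →
        |g f'| ≤ A * B * (((ℓ : ℝ) + 1) ^ k * |cf|⁻¹) * (Real.exp (5 / 2 * δ) * (Real.exp (1 / 2 * δ * (geomT D).dist y (blkV1 hN D f)) * Real.exp (-(1 / 2 * δ * dOmega D D' y.1.2 y'.1.2)))) := by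
    intro i hct hq f' hq'
    have hjk : (i.1.1 : ℕ) ≤ k := Nat.lt_succ_iff.1 i.1.1.isLt
    have hjm : (i.1.1 : ℕ) ≤ m + K := le_trans hjk hk
    have hwit := witness_of_not_isCT hN D D' hk hk1 i hct f hq
    have hloc := iterBlockOf_of_bondAvgIter_single_ne_zero (P := PV d ℓ m K hd hL)
      (show (i.1.1 : ℕ) ≤ (PV d ℓ m K hd hL).m + (PV d ℓ m K hd hL).K from hjm) hq
    have hloc' := iterBlockOf_of_bondAvgIter_single_ne_zero (P := PV d ℓ m K hd hL)
      (show (i.1.1 : ℕ) ≤ (PV d ℓ m K hd hL).m + (PV d ℓ m K hd hL).K from hjm) hq'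
    have hdist := dist_tube_le hN hjm hjk i.1.2 hloc hloc'
    have h := gprof_tube_lin hN D D' hMh hP hδ hA hB hy hy' hg f f' hwit hdist
    have hψle : (geomT D').len (blkV1 hN D' f') * |cf|⁻¹ ≤ ((ℓ : ℝ) + 1) ^ k * |cf|⁻¹ := by
      rw [geomT_len, mul_one]
      exact mul_le_mul_of_nonneg_right (pow_le_pow_right₀ hL1 (scale_bounds D'.toDomains _).2) (inv_nonneg.2 (abs_nonneg _))
    have hexp1 : Real.exp (-(1 / 2 * δ * (geomT D').dist (blkV1 hN D' f') y')) ≤ 1 :=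
      Real.exp_le_one_iff.2 (neg_nonpos.2 (mul_nonneg (mul_nonneg (by norm_num) hδ) (hd0' _ _)))
    calc |g f'| ≤ A * B * ((geomT D').len (blkV1 hN D' f') * |cf|⁻¹) * (Real.exp (5 / 2 * δ) * (Real.exp (1 / 2 * δ * (geomT D).dist y (blkV1 hN D f)) * Real.exp (-(1 / 2 * δ * dOmega D D' y.1.2 y'.1.2))))
          * Real.exp (-(1 / 2 * δ * (geomT D').dist (blkV1 hN D' f') y')) := h
      _ ≤ A * B * (((ℓ : ℝ) + 1) ^ k * |cf|⁻¹) * (Real.exp (5 / 2 * δ) * (Real.exp (1 / 2 * δ * (geomT D).dist y (blkV1 hN D f)) * Real.exp (-(1 / 2 * δ * dOmega D D' y.1.2 y'.1.2)))) * 1 :=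
          mul_le_mul (mul_le_mul_of_nonneg_right (mul_le_mul_of_nonneg_left hψle (mul_nonneg hA hB)) hE0) hexp1
            (Real.exp_pos _).le (by positivity)
      _ = _ := mul_one _
  -- the level profile of the truncated weighted averages
  have hv : ∀ i : BondIdx (domT hN D hk), bondAvgIter (i.1.1 : ℕ) (Pi.single f (1 : ℝ)) i.1.2 ≠ 0 →
      |trunc hN D D' hk w g i| ≤ (fun j : ℕ => if (blkV1 hN D f).1.1 ≤ j then
        b₁ * A * B * (Real.exp (5 / 2 * δ) * (Real.exp (1 / 2 * δ * (geomT D).dist y (blkV1 hN D f)) * Real.exp (-(1 / 2 * δ * dOmega D D' y.1.2 y'.1.2)))) * (|cf| * ((ℓ : ℝ) + 1) ^ k)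
          * ((((ℓ : ℝ) + 1) ^ j) ^ (d + 1) * ((((ℓ : ℝ) + 1) ^ j) ^ 2)⁻¹) else 0) i.1.1 := by
    intro i hq
    beta_reduce
    rw [trunc_apply]
    by_cases hct : IsCT hN D D' hk i.1
    · rw [if_pos hct, abs_zero]
      split_ifs
      · positivity
      · exact le_rfl
    · rw [if_neg hct]
      have hcov : (blkV1 hN D f).1.1 ≤ (i.1.1 : ℕ) := lev_le_of_bondAvgIter_single_ne_zero hN D hk i f hq
      rw [if_pos hcov]
      have hQ : |bondAvgIter (P := PV d ℓ m K hd hL) (i.1.1 : ℕ) g i.1.2|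
          ≤ A * B * (((ℓ : ℝ) + 1) ^ k * |cf|⁻¹) * (Real.exp (5 / 2 * δ) * (Real.exp (1 / 2 * δ * (geomT D).dist y (blkV1 hN D f)) * Real.exp (-(1 / 2 * δ * dOmega D D' y.1.2 y'.1.2)))) := by
        refine (abs_bondAvgIter_le_sum_qk (k := k) i.1 g).trans ?_
        have hle : ∀ f', qk (k := k) i.1 f' * |g f'| ≤ qk (k := k) i.1 f' * (A * B * (((ℓ : ℝ) + 1) ^ k * |cf|⁻¹) * (Real.exp (5 / 2 * δ) * (Real.exp (1 / 2 * δ * (geomT D).dist y (blkV1 hN D f)) * Real.exp (-(1 / 2 * δ * dOmega D D' y.1.2 y'.1.2))))) := by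
          intro f'
          by_cases hq' : bondAvgIter (P := PV d ℓ m K hd hL) (i.1.1 : ℕ) (Pi.single f' (1 : ℝ)) i.1.2 = 0
          · have h0 : qk (k := k) i.1 f' = 0 := hq'
            rw [h0, zero_mul, zero_mul]
          · exact mul_le_mul_of_nonneg_left (hM i hct hq f' hq') (qk_nonneg (k := k) i.1 f')
        refine (Finset.sum_le_sum fun f' _ => hle f').trans ?_
        rw [← Finset.sum_mul, sum_qk, one_mul]
      rw [abs_mul, abs_of_nonneg (hw0 i)]
      have hwb0 : 0 ≤ b₁ * cf ^ 2 * ((((ℓ : ℝ) + 1) ^ (i.1.1 : ℕ)) ^ (d + 1)) * (((((ℓ : ℝ) + 1) ^ (i.1.1 : ℕ)) ^ 2))⁻¹ := by positivity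
      calc w i * |bondAvgIter (P := PV d ℓ m K hd hL) (i.1.1 : ℕ) g i.1.2|
          ≤ (b₁ * cf ^ 2 * ((((ℓ : ℝ) + 1) ^ (i.1.1 : ℕ)) ^ (d + 1)) * (((((ℓ : ℝ) + 1) ^ (i.1.1 : ℕ)) ^ 2))⁻¹)
            * (A * B * (((ℓ : ℝ) + 1) ^ k * |cf|⁻¹) * (Real.exp (5 / 2 * δ) * (Real.exp (1 / 2 * δ * (geomT D).dist y (blkV1 hN D f)) * Real.exp (-(1 / 2 * δ * dOmega D D' y.1.2 y'.1.2))))) :=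
            mul_le_mul (hwb i) hQ (abs_nonneg _) hwb0
        _ = b₁ * A * B * (Real.exp (5 / 2 * δ) * (Real.exp (1 / 2 * δ * (geomT D).dist y (blkV1 hN D f)) * Real.exp (-(1 / 2 * δ * dOmega D D' y.1.2 y'.1.2))))
            * (cf ^ 2 * (((ℓ : ℝ) + 1) ^ k * |cf|⁻¹))
            * ((((ℓ : ℝ) + 1) ^ (i.1.1 : ℕ)) ^ (d + 1) * ((((ℓ : ℝ) + 1) ^ (i.1.1 : ℕ)) ^ 2)⁻¹) := by ring
        _ = _ := by rw [sq_mul_lin hcf]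
  have hg0 : ∀ j : ℕ, 0 ≤ (fun j : ℕ => if (blkV1 hN D f).1.1 ≤ j then
        b₁ * A * B * (Real.exp (5 / 2 * δ) * (Real.exp (1 / 2 * δ * (geomT D).dist y (blkV1 hN D f)) * Real.exp (-(1 / 2 * δ * dOmega D D' y.1.2 y'.1.2)))) * (|cf| * ((ℓ : ℝ) + 1) ^ k)
          * ((((ℓ : ℝ) + 1) ^ j) ^ (d + 1) * ((((ℓ : ℝ) + 1) ^ j) ^ 2)⁻¹) else 0) j := by
    intro j
    beta_reduce
    split_ifs
    · positivity
    · exact le_rfl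
  have h := abs_QsE_apply_le (domT hN D hk) (trunc hN D D' hk w g) f _ hg0 hv
  refine h.trans ?_
  rw [B8Prop3MultiLevelTorus.PV_L]
  show ∑ j ∈ Finset.range (k + 1), (fun j : ℕ => if (blkV1 hN D f).1.1 ≤ j then
        b₁ * A * B * (Real.exp (5 / 2 * δ) * (Real.exp (1 / 2 * δ * (geomT D).dist y (blkV1 hN D f)) * Real.exp (-(1 / 2 * δ * dOmega D D' y.1.2 y'.1.2)))) * (|cf| * ((ℓ : ℝ) + 1) ^ k)
          * ((((ℓ : ℝ) + 1) ^ j) ^ (d + 1) * ((((ℓ : ℝ) + 1) ^ j) ^ 2)⁻¹) else 0) j * ((((ℓ : ℝ) + 1) ^ (d + 1))⁻¹) ^ j ≤ _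
  have hterm : ∀ j ∈ Finset.range (k + 1), (fun j : ℕ => if (blkV1 hN D f).1.1 ≤ j then
        b₁ * A * B * (Real.exp (5 / 2 * δ) * (Real.exp (1 / 2 * δ * (geomT D).dist y (blkV1 hN D f)) * Real.exp (-(1 / 2 * δ * dOmega D D' y.1.2 y'.1.2)))) * (|cf| * ((ℓ : ℝ) + 1) ^ k)
          * ((((ℓ : ℝ) + 1) ^ j) ^ (d + 1) * ((((ℓ : ℝ) + 1) ^ j) ^ 2)⁻¹) else 0) j * ((((ℓ : ℝ) + 1) ^ (d + 1))⁻¹) ^ j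
      = b₁ * A * B * (Real.exp (5 / 2 * δ) * (Real.exp (1 / 2 * δ * (geomT D).dist y (blkV1 hN D f)) * Real.exp (-(1 / 2 * δ * dOmega D D' y.1.2 y'.1.2)))) * (|cf| * ((ℓ : ℝ) + 1) ^ k)
          * (if (blkV1 hN D f).1.1 ≤ j then ((((ℓ : ℝ) + 1) ^ 2)⁻¹) ^ j else 0) := by
    intro j _
    beta_reduce
    split_ifs
    · have e1 : (((ℓ : ℝ) + 1) ^ j) ^ (d + 1) * ((((ℓ : ℝ) + 1) ^ (d + 1))⁻¹) ^ j = 1 := by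
        rw [← pow_mul, inv_pow, ← pow_mul, mul_comm j (d + 1), mul_inv_cancel₀ (by positivity)]
      have e2 : ((((ℓ : ℝ) + 1) ^ j) ^ 2)⁻¹ = ((((ℓ : ℝ) + 1) ^ 2)⁻¹) ^ j := by
        rw [← pow_mul, mul_comm j 2, pow_mul, inv_pow]
      calc b₁ * A * B * (Real.exp (5 / 2 * δ) * (Real.exp (1 / 2 * δ * (geomT D).dist y (blkV1 hN D f)) * Real.exp (-(1 / 2 * δ * dOmega D D' y.1.2 y'.1.2)))) * (|cf| * ((ℓ : ℝ) + 1) ^ k)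
            * ((((ℓ : ℝ) + 1) ^ j) ^ (d + 1) * ((((ℓ : ℝ) + 1) ^ j) ^ 2)⁻¹) * ((((ℓ : ℝ) + 1) ^ (d + 1))⁻¹) ^ j
          = b₁ * A * B * (Real.exp (5 / 2 * δ) * (Real.exp (1 / 2 * δ * (geomT D).dist y (blkV1 hN D f)) * Real.exp (-(1 / 2 * δ * dOmega D D' y.1.2 y'.1.2)))) * (|cf| * ((ℓ : ℝ) + 1) ^ k) * ((((ℓ : ℝ) + 1) ^ j) ^ 2)⁻¹
            * ((((ℓ : ℝ) + 1) ^ j) ^ (d + 1) * ((((ℓ : ℝ) + 1) ^ (d + 1))⁻¹) ^ j) := by ring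
        _ = _ := by rw [e1, mul_one, e2]
    · rw [zero_mul, mul_zero]
  rw [Finset.sum_congr rfl hterm, ← Finset.mul_sum]
  have hr0 : (0 : ℝ) ≤ (((ℓ : ℝ) + 1) ^ 2)⁻¹ := by positivity
  have hr : (((ℓ : ℝ) + 1) ^ 2)⁻¹ ≤ 1 / 2 := by
    rw [inv_eq_one_div]
    have h4 : (4 : ℝ) ≤ ((ℓ : ℝ) + 1) ^ 2 := by nlinarith
    exact (one_div_le_one_div_of_le (by norm_num) h4).trans (by norm_num)
  have hsum := sum_ite_pow_le hr0 hr (blkV1 hN D f).1.1 (k + 1)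
  have hC0 : 0 ≤ b₁ * A * B * (Real.exp (5 / 2 * δ) * (Real.exp (1 / 2 * δ * (geomT D).dist y (blkV1 hN D f)) * Real.exp (-(1 / 2 * δ * dOmega D D' y.1.2 y'.1.2)))) * (|cf| * ((ℓ : ℝ) + 1) ^ k) := by positivity
  refine (mul_le_mul_of_nonneg_left hsum hC0).trans (le_of_eq ?_)
  have e3 : (((ℓ : ℝ) + 1) ^ k) ^ 2 * ((((ℓ : ℝ) + 1) ^ 2)⁻¹) ^ (blkV1 hN D f).1.1 = (((ℓ : ℝ) + 1) ^ (2 * k) / ((ℓ : ℝ) + 1) ^ (2 * (blkV1 hN D f).1.1)) := by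
    rw [inv_pow, ← pow_mul, ← pow_mul, mul_comm k 2, div_eq_mul_inv]
  rw [← e3]
  field_simp

/-- **THE SURVIVING INDEX BONDS OF `{Ω′_j}`** (`Q′*v′`), linear profile: at every fine bond `f` in the block `p` of `{Ω_j}`,
`|(Q′*v′)(f)| ≤ 2b₁·A·B·L²·e^{(5/2)δ}·(|c_f|/L^k)·e^{½δd(y,p)}·e^{−½δd(y,y′,Ω)}` — column mass + coverage in `{Ω′_j}` + the transfer (2.60) in
`{Ω′_j}` + the weight band + the tube witness + `Σ_{j ≤ k} L^{j}/L^{2k} ≤ 2L^{−k}`.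
[cite: Balaban1985BackgroundPropagators, Thm 3.14 (3.154) p.427; Balaban1984PropagatorsII, (2.16) p.225, (2.18)–(2.20) p.226, (2.60) p.234, (2.136) p.247] -/
theorem abs_QsE_trunc'_le_lin (hk1 : 1 ≤ k) (hMh : 1 ≤ Mh) (hP : ∀ μ, 1 ≤ P' μ) (hRM : 1 ≤ R * ((ℓ + 1) * Mh)) {δ b₁ A B cf : ℝ}
    (hδ : 0 ≤ δ) (hcf : cf ≠ 0) (hb₁ : 0 ≤ b₁) (hA : 0 ≤ A) (hB : 0 ≤ B)
    (hthr : ((ℓ : ℝ) + 1) ^ 2 ≤ Real.exp (1 / 4 * δ * ((R : ℝ) * (((ℓ : ℝ) + 1) * Mh) - 1)))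
    {w' : BondIdx (domT hN D' hk) → ℝ} (hw0' : ∀ i', 0 ≤ w' i')
    (hwb' : ∀ i', w' i' ≤ b₁ * cf ^ 2 * ((((ℓ : ℝ) + 1) ^ (i'.1.1 : ℕ)) ^ (d + 1)) * (((((ℓ : ℝ) + 1) ^ (i'.1.1 : ℕ)) ^ 2))⁻¹)
    {y : ↥(bset D.toDomains)} (hy : y.1.1 = k) {y' : ↥(bset D'.toDomains)} (hy' : y'.1.1 = k)
    {g : PBond (PV d ℓ m K hd hL) 0 → ℝ}
    (hg : ∀ v, |g v| ≤ A * ((geomT D').len (blkV1 hN D' v) * |cf|⁻¹) * Real.exp (-(δ * (geomT D').dist (blkV1 hN D' v) y')) * B)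
    (f : PBond (PV d ℓ m K hd hL) 0) :
    |QsE (domT hN D' hk) (trunc' hN D D' hk w' g) f| ≤ 2 * b₁ * A * B * ((ℓ : ℝ) + 1) ^ 2 * Real.exp (5 / 2 * δ) * (|cf| * ((((ℓ : ℝ) + 1) ^ k))⁻¹) * (Real.exp (1 / 2 * δ * (geomT D).dist y (blkV1 hN D f)) * Real.exp (-(1 / 2 * δ * dOmega D D' y.1.2 y'.1.2))) := by
  have hd0' : ∀ s t : ↥(bset D'.toDomains), 0 ≤ (geomT D').dist s t := (triangle_refl_nonneg_T D' hMh hP).2.2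
  have hL2 : (2 : ℝ) ≤ (ℓ : ℝ) + 1 := by
    have h1 : (1 : ℝ) ≤ (ℓ : ℝ) := by exact_mod_cast (show 1 ≤ ℓ by have := hL.2; omega)
    linarith
  have hL0 : (0 : ℝ) < (ℓ : ℝ) + 1 := by linarith
  have hL1 : (1 : ℝ) ≤ (ℓ : ℝ) + 1 := by linarith
  have hLk0 : (0 : ℝ) < ((ℓ : ℝ) + 1) ^ k := by positivity
  have hE0 : 0 ≤ Real.exp (5 / 2 * δ) * (Real.exp (1 / 2 * δ * (geomT D).dist y (blkV1 hN D f)) * Real.exp (-(1 / 2 * δ * dOmega D D' y.1.2 y'.1.2))) := by positivity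
  -- the bound on `c_f²|g|` over the tube of a surviving index bond of `{Ω′_j}` charging `f`, with the transfer in `{Ω′_j}`
  have hM : ∀ i' : BondIdx (domT hN D' hk), ¬ IsCT hN D D' hk i'.1 →
      bondAvgIter (P := PV d ℓ m K hd hL) (i'.1.1 : ℕ) (Pi.single f (1 : ℝ)) i'.1.2 ≠ 0 →
      ∀ f', bondAvgIter (P := PV d ℓ m K hd hL) (i'.1.1 : ℕ) (Pi.single f' (1 : ℝ)) i'.1.2 ≠ 0 →
        cf ^ 2 * |g f'| ≤ A * B * (((ℓ : ℝ) + 1) ^ 2 * ((|cf| * ((ℓ : ℝ) + 1) ^ (i'.1.1 : ℕ))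
          * (((ℓ : ℝ) + 1) ^ (2 * (i'.1.1 : ℕ)) / ((ℓ : ℝ) + 1) ^ (2 * k)))) * (Real.exp (5 / 2 * δ) * (Real.exp (1 / 2 * δ * (geomT D).dist y (blkV1 hN D f)) * Real.exp (-(1 / 2 * δ * dOmega D D' y.1.2 y'.1.2)))) := by
    intro i' hct hq f' hq'
    have hjk : (i'.1.1 : ℕ) ≤ k := Nat.lt_succ_iff.1 i'.1.1.isLt
    have hjm : (i'.1.1 : ℕ) ≤ m + K := le_trans hjk hk
    have hwit := witness_of_not_isCT' hN D D' hk hk1 i' hct f hq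
    have hloc := iterBlockOf_of_bondAvgIter_single_ne_zero (P := PV d ℓ m K hd hL)
      (show (i'.1.1 : ℕ) ≤ (PV d ℓ m K hd hL).m + (PV d ℓ m K hd hL).K from hjm) hq
    have hloc' := iterBlockOf_of_bondAvgIter_single_ne_zero (P := PV d ℓ m K hd hL)
      (show (i'.1.1 : ℕ) ≤ (PV d ℓ m K hd hL).m + (PV d ℓ m K hd hL).K from hjm) hq'
    have hdist := dist_tube_le hN hjm hjk i'.1.2 hloc hloc'
    have h := gprof_tube_lin hN D D' hMh hP hδ hA hB hy hy' hg f f' hwit hdist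
    -- coverage in `{Ω′_j}` and the transfer
    have hcov' : (blkV1 hN D' f').1.1 ≤ (i'.1.1 : ℕ) := lev_le_of_bondAvgIter_single_ne_zero hN D' hk i' f' hq'
    have htr := transfer_top D' hMh hP hRM hδ hthr (blkV1 hN D' f') y' hy'
    have hpos : (0 : ℝ) < ((ℓ : ℝ) + 1) ^ (2 * k) / ((ℓ : ℝ) + 1) ^ (2 * (blkV1 hN D' f').1.1) := by positivity
    have hexpq : Real.exp (-(1 / 4 * δ * (geomT D').dist (blkV1 hN D' f') y'))
        ≤ ((ℓ : ℝ) + 1) ^ 2 * (((ℓ : ℝ) + 1) ^ (2 * (blkV1 hN D' f').1.1) / ((ℓ : ℝ) + 1) ^ (2 * k)) := by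
      rw [mul_comm] at htr
      have h1 := (le_div_iff₀ hpos).2 htr
      refine h1.trans (le_of_eq ?_)
      rw [div_div_eq_mul_div]
      field_simp
    have hexph : Real.exp (-(1 / 2 * δ * (geomT D').dist (blkV1 hN D' f') y'))
        ≤ Real.exp (-(1 / 4 * δ * (geomT D').dist (blkV1 hN D' f') y')) :=
      Real.exp_le_exp.2 (by nlinarith [hd0' (blkV1 hN D' f') y'])
    have hψ : cf ^ 2 * ((geomT D').len (blkV1 hN D' f') * |cf|⁻¹) = |cf| * ((ℓ : ℝ) + 1) ^ (blkV1 hN D' f').1.1 := by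
      rw [sq_mul_lin hcf, geomT_len, mul_one]
    have hsc1 : |cf| * ((ℓ : ℝ) + 1) ^ (blkV1 hN D' f').1.1 ≤ |cf| * ((ℓ : ℝ) + 1) ^ (i'.1.1 : ℕ) :=
      mul_le_mul_of_nonneg_left (pow_le_pow_right₀ hL1 hcov') (abs_nonneg cf)
    have hsc2 : ((ℓ : ℝ) + 1) ^ (2 * (blkV1 hN D' f').1.1) / ((ℓ : ℝ) + 1) ^ (2 * k)
        ≤ ((ℓ : ℝ) + 1) ^ (2 * (i'.1.1 : ℕ)) / ((ℓ : ℝ) + 1) ^ (2 * k) :=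
      div_le_div_of_nonneg_right (pow_le_pow_right₀ hL1 (by omega)) (by positivity)
    calc cf ^ 2 * |g f'| ≤ cf ^ 2 * (A * B * ((geomT D').len (blkV1 hN D' f') * |cf|⁻¹) * (Real.exp (5 / 2 * δ) * (Real.exp (1 / 2 * δ * (geomT D).dist y (blkV1 hN D f)) * Real.exp (-(1 / 2 * δ * dOmega D D' y.1.2 y'.1.2))))
          * Real.exp (-(1 / 2 * δ * (geomT D').dist (blkV1 hN D' f') y'))) := mul_le_mul_of_nonneg_left h (sq_nonneg cf)
      _ = A * B * ((cf ^ 2 * ((geomT D').len (blkV1 hN D' f') * |cf|⁻¹)) * Real.exp (-(1 / 2 * δ * (geomT D').dist (blkV1 hN D' f') y')))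
          * (Real.exp (5 / 2 * δ) * (Real.exp (1 / 2 * δ * (geomT D).dist y (blkV1 hN D f)) * Real.exp (-(1 / 2 * δ * dOmega D D' y.1.2 y'.1.2)))) := by ring
      _ ≤ A * B * ((|cf| * ((ℓ : ℝ) + 1) ^ (i'.1.1 : ℕ)) * (((ℓ : ℝ) + 1) ^ 2 * (((ℓ : ℝ) + 1) ^ (2 * (i'.1.1 : ℕ)) / ((ℓ : ℝ) + 1) ^ (2 * k))))
          * (Real.exp (5 / 2 * δ) * (Real.exp (1 / 2 * δ * (geomT D).dist y (blkV1 hN D f)) * Real.exp (-(1 / 2 * δ * dOmega D D' y.1.2 y'.1.2)))) := by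
          refine mul_le_mul_of_nonneg_right (mul_le_mul_of_nonneg_left ?_ (mul_nonneg hA hB)) hE0
          rw [hψ]
          refine mul_le_mul hsc1 (hexph.trans (hexpq.trans ?_)) (Real.exp_pos _).le (by positivity)
          exact mul_le_mul_of_nonneg_left hsc2 (by positivity)
      _ = _ := by ring
  -- the level profile of the truncated weighted averages of `{Ω′_j}`
  have hv : ∀ i' : BondIdx (domT hN D' hk), bondAvgIter (i'.1.1 : ℕ) (Pi.single f (1 : ℝ)) i'.1.2 ≠ 0 →
      |trunc' hN D D' hk w' g i'| ≤ (fun j : ℕ => b₁ * A * B * ((ℓ : ℝ) + 1) ^ 2 * (Real.exp (5 / 2 * δ) * (Real.exp (1 / 2 * δ * (geomT D).dist y (blkV1 hN D f)) * Real.exp (-(1 / 2 * δ * dOmega D D' y.1.2 y'.1.2)))) * |cf|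
        * ((((ℓ : ℝ) + 1) ^ j) ^ (d + 1) * (((ℓ : ℝ) + 1) ^ j / ((ℓ : ℝ) + 1) ^ (2 * k)))) i'.1.1 := by
    intro i' hq
    beta_reduce
    rw [trunc'_apply]
    by_cases hct : IsCT hN D D' hk i'.1
    · rw [if_pos hct, abs_zero]
      positivity
    · rw [if_neg hct]
      have hQ : cf ^ 2 * |bondAvgIter (P := PV d ℓ m K hd hL) (i'.1.1 : ℕ) g i'.1.2|
          ≤ A * B * (((ℓ : ℝ) + 1) ^ 2 * ((|cf| * ((ℓ : ℝ) + 1) ^ (i'.1.1 : ℕ))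
            * (((ℓ : ℝ) + 1) ^ (2 * (i'.1.1 : ℕ)) / ((ℓ : ℝ) + 1) ^ (2 * k)))) * (Real.exp (5 / 2 * δ) * (Real.exp (1 / 2 * δ * (geomT D).dist y (blkV1 hN D f)) * Real.exp (-(1 / 2 * δ * dOmega D D' y.1.2 y'.1.2)))) := by
        have h1 := abs_bondAvgIter_le_sum_qk (k := k) i'.1 g
        have hle : ∀ f', qk (k := k) i'.1 f' * (cf ^ 2 * |g f'|) ≤ qk (k := k) i'.1 f' * (A * B * (((ℓ : ℝ) + 1) ^ 2
            * ((|cf| * ((ℓ : ℝ) + 1) ^ (i'.1.1 : ℕ)) * (((ℓ : ℝ) + 1) ^ (2 * (i'.1.1 : ℕ)) / ((ℓ : ℝ) + 1) ^ (2 * k))))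
            * (Real.exp (5 / 2 * δ) * (Real.exp (1 / 2 * δ * (geomT D).dist y (blkV1 hN D f)) * Real.exp (-(1 / 2 * δ * dOmega D D' y.1.2 y'.1.2))))) := by
          intro f'
          by_cases hq' : bondAvgIter (P := PV d ℓ m K hd hL) (i'.1.1 : ℕ) (Pi.single f' (1 : ℝ)) i'.1.2 = 0
          · have h0 : qk (k := k) i'.1 f' = 0 := hq'
            rw [h0, zero_mul, zero_mul]
          · exact mul_le_mul_of_nonneg_left (hM i' hct hq f' hq') (qk_nonneg (k := k) i'.1 f')
        calc cf ^ 2 * |bondAvgIter (P := PV d ℓ m K hd hL) (i'.1.1 : ℕ) g i'.1.2|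
            ≤ cf ^ 2 * ∑ f', qk (k := k) i'.1 f' * |g f'| := mul_le_mul_of_nonneg_left h1 (sq_nonneg cf)
          _ = ∑ f', qk (k := k) i'.1 f' * (cf ^ 2 * |g f'|) := by
              rw [Finset.mul_sum]
              exact Finset.sum_congr rfl fun f' _ => by ring
          _ ≤ _ := Finset.sum_le_sum fun f' _ => hle f'
          _ = _ := by rw [← Finset.sum_mul, sum_qk, one_mul]
      rw [abs_mul, abs_of_nonneg (hw0' i')]
      have hb0 : 0 ≤ b₁ * (((ℓ : ℝ) + 1) ^ (i'.1.1 : ℕ)) ^ (d + 1) * ((((ℓ : ℝ) + 1) ^ (i'.1.1 : ℕ)) ^ 2)⁻¹ := by positivity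
      have hne : (((ℓ : ℝ) + 1) ^ (i'.1.1 : ℕ)) ^ 2 ≠ 0 := by positivity
      have e22 : ((ℓ : ℝ) + 1) ^ (2 * (i'.1.1 : ℕ)) = (((ℓ : ℝ) + 1) ^ (i'.1.1 : ℕ)) ^ 2 := by
        rw [mul_comm, pow_mul]
      calc w' i' * |bondAvgIter (P := PV d ℓ m K hd hL) (i'.1.1 : ℕ) g i'.1.2|
          ≤ (b₁ * cf ^ 2 * ((((ℓ : ℝ) + 1) ^ (i'.1.1 : ℕ)) ^ (d + 1)) * (((((ℓ : ℝ) + 1) ^ (i'.1.1 : ℕ)) ^ 2))⁻¹)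
            * |bondAvgIter (P := PV d ℓ m K hd hL) (i'.1.1 : ℕ) g i'.1.2| := mul_le_mul_of_nonneg_right (hwb' i') (abs_nonneg _)
        _ = b₁ * (((ℓ : ℝ) + 1) ^ (i'.1.1 : ℕ)) ^ (d + 1) * ((((ℓ : ℝ) + 1) ^ (i'.1.1 : ℕ)) ^ 2)⁻¹
            * (cf ^ 2 * |bondAvgIter (P := PV d ℓ m K hd hL) (i'.1.1 : ℕ) g i'.1.2|) := by ring
        _ ≤ b₁ * (((ℓ : ℝ) + 1) ^ (i'.1.1 : ℕ)) ^ (d + 1) * ((((ℓ : ℝ) + 1) ^ (i'.1.1 : ℕ)) ^ 2)⁻¹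
            * (A * B * (((ℓ : ℝ) + 1) ^ 2 * ((|cf| * ((ℓ : ℝ) + 1) ^ (i'.1.1 : ℕ))
              * (((ℓ : ℝ) + 1) ^ (2 * (i'.1.1 : ℕ)) / ((ℓ : ℝ) + 1) ^ (2 * k)))) * (Real.exp (5 / 2 * δ) * (Real.exp (1 / 2 * δ * (geomT D).dist y (blkV1 hN D f)) * Real.exp (-(1 / 2 * δ * dOmega D D' y.1.2 y'.1.2))))) :=
            mul_le_mul_of_nonneg_left hQ hb0
        _ = b₁ * A * B * ((ℓ : ℝ) + 1) ^ 2 * (Real.exp (5 / 2 * δ) * (Real.exp (1 / 2 * δ * (geomT D).dist y (blkV1 hN D f)) * Real.exp (-(1 / 2 * δ * dOmega D D' y.1.2 y'.1.2)))) * |cf|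
            * ((((ℓ : ℝ) + 1) ^ (i'.1.1 : ℕ)) ^ (d + 1) * (((ℓ : ℝ) + 1) ^ (i'.1.1 : ℕ) / ((ℓ : ℝ) + 1) ^ (2 * k)))
            * (((((ℓ : ℝ) + 1) ^ (i'.1.1 : ℕ)) ^ 2)⁻¹ * ((ℓ : ℝ) + 1) ^ (2 * (i'.1.1 : ℕ))) := by ring
        _ = _ := by rw [e22, inv_mul_cancel₀ hne, mul_one]
  have hg0 : ∀ j : ℕ, 0 ≤ (fun j : ℕ => b₁ * A * B * ((ℓ : ℝ) + 1) ^ 2 * (Real.exp (5 / 2 * δ) * (Real.exp (1 / 2 * δ * (geomT D).dist y (blkV1 hN D f)) * Real.exp (-(1 / 2 * δ * dOmega D D' y.1.2 y'.1.2)))) * |cf|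
        * ((((ℓ : ℝ) + 1) ^ j) ^ (d + 1) * (((ℓ : ℝ) + 1) ^ j / ((ℓ : ℝ) + 1) ^ (2 * k)))) j := by
    intro j
    beta_reduce
    positivity
  have h := abs_QsE_apply_le (domT hN D' hk) (trunc' hN D D' hk w' g) f _ hg0 hv
  refine h.trans ?_
  rw [B8Prop3MultiLevelTorus.PV_L]
  show ∑ j ∈ Finset.range (k + 1), (fun j : ℕ => b₁ * A * B * ((ℓ : ℝ) + 1) ^ 2 * (Real.exp (5 / 2 * δ) * (Real.exp (1 / 2 * δ * (geomT D).dist y (blkV1 hN D f)) * Real.exp (-(1 / 2 * δ * dOmega D D' y.1.2 y'.1.2)))) * |cf|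
        * ((((ℓ : ℝ) + 1) ^ j) ^ (d + 1) * (((ℓ : ℝ) + 1) ^ j / ((ℓ : ℝ) + 1) ^ (2 * k)))) j
        * ((((ℓ : ℝ) + 1) ^ (d + 1))⁻¹) ^ j ≤ _
  have hterm : ∀ j ∈ Finset.range (k + 1), (fun j : ℕ => b₁ * A * B * ((ℓ : ℝ) + 1) ^ 2 * (Real.exp (5 / 2 * δ) * (Real.exp (1 / 2 * δ * (geomT D).dist y (blkV1 hN D f)) * Real.exp (-(1 / 2 * δ * dOmega D D' y.1.2 y'.1.2)))) * |cf|
        * ((((ℓ : ℝ) + 1) ^ j) ^ (d + 1) * (((ℓ : ℝ) + 1) ^ j / ((ℓ : ℝ) + 1) ^ (2 * k)))) j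
        * ((((ℓ : ℝ) + 1) ^ (d + 1))⁻¹) ^ j
      = b₁ * A * B * ((ℓ : ℝ) + 1) ^ 2 * (Real.exp (5 / 2 * δ) * (Real.exp (1 / 2 * δ * (geomT D).dist y (blkV1 hN D f)) * Real.exp (-(1 / 2 * δ * dOmega D D' y.1.2 y'.1.2)))) * |cf|
          * ((((ℓ : ℝ) + 1) ^ k)⁻¹ * ((((ℓ : ℝ) + 1))⁻¹) ^ (k - j)) := by
    intro j hj
    have hjk : j ≤ k := Nat.lt_succ_iff.1 (Finset.mem_range.1 hj)
    beta_reduce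
    have e1 : (((ℓ : ℝ) + 1) ^ j) ^ (d + 1) * ((((ℓ : ℝ) + 1) ^ (d + 1))⁻¹) ^ j = 1 := by
      rw [← pow_mul, inv_pow, ← pow_mul, mul_comm j (d + 1), mul_inv_cancel₀ (by positivity)]
    have e2 : ((ℓ : ℝ) + 1) ^ j / ((ℓ : ℝ) + 1) ^ (2 * k) = (((ℓ : ℝ) + 1) ^ k)⁻¹ * ((((ℓ : ℝ) + 1))⁻¹) ^ (k - j) := by
      rw [← pow_div_pow_eq_inv_pow hL0.ne' hjk, two_mul, pow_add]
      field_simp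
    calc b₁ * A * B * ((ℓ : ℝ) + 1) ^ 2 * (Real.exp (5 / 2 * δ) * (Real.exp (1 / 2 * δ * (geomT D).dist y (blkV1 hN D f)) * Real.exp (-(1 / 2 * δ * dOmega D D' y.1.2 y'.1.2)))) * |cf|
          * ((((ℓ : ℝ) + 1) ^ j) ^ (d + 1) * (((ℓ : ℝ) + 1) ^ j / ((ℓ : ℝ) + 1) ^ (2 * k))) * ((((ℓ : ℝ) + 1) ^ (d + 1))⁻¹) ^ j
        = b₁ * A * B * ((ℓ : ℝ) + 1) ^ 2 * (Real.exp (5 / 2 * δ) * (Real.exp (1 / 2 * δ * (geomT D).dist y (blkV1 hN D f)) * Real.exp (-(1 / 2 * δ * dOmega D D' y.1.2 y'.1.2)))) * |cf|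
          * (((ℓ : ℝ) + 1) ^ j / ((ℓ : ℝ) + 1) ^ (2 * k))
          * ((((ℓ : ℝ) + 1) ^ j) ^ (d + 1) * ((((ℓ : ℝ) + 1) ^ (d + 1))⁻¹) ^ j) := by ring
      _ = _ := by rw [e1, mul_one, e2]
  rw [Finset.sum_congr rfl hterm, ← Finset.mul_sum, ← Finset.mul_sum]
  have hr0 : (0 : ℝ) ≤ (((ℓ : ℝ) + 1))⁻¹ := by positivity
  have hr : (((ℓ : ℝ) + 1))⁻¹ ≤ 1 / 2 := by
    rw [inv_eq_one_div]
    exact one_div_le_one_div_of_le (by norm_num) hL2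
  have hsum := sum_pow_sub_le hr0 hr k
  have hC0 : 0 ≤ b₁ * A * B * ((ℓ : ℝ) + 1) ^ 2 * (Real.exp (5 / 2 * δ) * (Real.exp (1 / 2 * δ * (geomT D).dist y (blkV1 hN D f)) * Real.exp (-(1 / 2 * δ * dOmega D D' y.1.2 y'.1.2)))) * |cf| * (((ℓ : ℝ) + 1) ^ k)⁻¹ := by
    positivity
  calc b₁ * A * B * ((ℓ : ℝ) + 1) ^ 2 * (Real.exp (5 / 2 * δ) * (Real.exp (1 / 2 * δ * (geomT D).dist y (blkV1 hN D f)) * Real.exp (-(1 / 2 * δ * dOmega D D' y.1.2 y'.1.2)))) * |cf|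
        * ((((ℓ : ℝ) + 1) ^ k)⁻¹ * ∑ j ∈ Finset.range (k + 1), ((((ℓ : ℝ) + 1))⁻¹) ^ (k - j))
      = b₁ * A * B * ((ℓ : ℝ) + 1) ^ 2 * (Real.exp (5 / 2 * δ) * (Real.exp (1 / 2 * δ * (geomT D).dist y (blkV1 hN D f)) * Real.exp (-(1 / 2 * δ * dOmega D D' y.1.2 y'.1.2)))) * |cf| * (((ℓ : ℝ) + 1) ^ k)⁻¹
        * ∑ j ∈ Finset.range (k + 1), ((((ℓ : ℝ) + 1))⁻¹) ^ (k - j) := by ring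
    _ ≤ b₁ * A * B * ((ℓ : ℝ) + 1) ^ 2 * (Real.exp (5 / 2 * δ) * (Real.exp (1 / 2 * δ * (geomT D).dist y (blkV1 hN D f)) * Real.exp (-(1 / 2 * δ * dOmega D D' y.1.2 y'.1.2)))) * |cf| * (((ℓ : ℝ) + 1) ^ k)⁻¹ * 2 :=
        mul_le_mul_of_nonneg_left hsum hC0
    _ = _ := by ring

end QPart

/-! ## §3  The engine for the linear inner profile, and the abstract theorem -/

section Engine

variable (hN : ∀ μ, N0 ℓ Mh k P' μ = (PV d ℓ m K hd hL).sitesPerDir 0) (D D' : TDomains d ℓ Mh k P' R) (hk : k ≤ m + K)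

/-- **THE TWO LETTERS TOGETHER, AT ONE FINE BOND**, linear profile: `|((V_P + V_Q)g)(f)| ≤ Θ·A·B·(|c_f|/L^k)·(L^{2k}/L^{2j(p)})·e^{½δd(y,p)}·e^{−½δd(y,y′,Ω)}`
with FILE 2's `Θ = (d+1)c(C_Δ + C_P e^{2δ}(1+L²)) + 2b₁e^{(5/2)δ}(1+L²)`.
[cite: Balaban1985BackgroundPropagators, Thm 3.14 (3.154) p.427; Balaban1984PropagatorsII, (2.19)–(2.22) p.226, (2.136) p.247] -/
theorem abs_V_apply_le_lin (hk1 : 1 ≤ k) (hMh : 1 ≤ Mh) (hP : ∀ μ, 1 ≤ P' μ) (hRM : 1 ≤ R * ((ℓ + 1) * Mh))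
    {δ c CΔ CP b₁ A B cf : ℝ} (hδ : 0 ≤ δ) (hcf : cf ≠ 0) (hCΔ : 0 ≤ CΔ) (hCP : 0 ≤ CP) (hb₁ : 0 ≤ b₁) (hA : 0 ≤ A) (hB : 0 ≤ B)
    (hc : 0 ≤ c) (hthr : ((ℓ : ℝ) + 1) ^ 2 ≤ Real.exp (1 / 4 * δ * ((R : ℝ) * (((ℓ : ℝ) + 1) * Mh) - 1)))
    (h261 : Ineq261With c (geomT D) δ (1 / 4)) (h261' : Ineq261With c (geomT D') δ (1 / 4))
    (hΔ : ∀ (p q : ℕ × (Fin (d + 1) → ℤ)) (hpD : p ∈ bset D.toDomains) (hpD' : p ∈ bset D'.toDomains)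
      (hqD : q ∈ bset D.toDomains) (hqD' : q ∈ bset D'.toDomains), p.1 = k → q.1 = k →
      ∀ (x x' : ↥(boxDom (N0 ℓ Mh k P'))), blkOf D.toDomains x = ⟨p, hpD⟩ → blkOf D.toDomains x' = ⟨q, hqD⟩ →
      ∀ μ ν : Fin (d + 1), |dPd D μ ν x x' - dPd D' μ ν x x'|
        ≤ CΔ * ((((ℓ : ℝ) + 1) ^ k) ^ 2)⁻¹ * ((((ℓ : ℝ) + 1) ^ k) ^ (d + 1))⁻¹
          * Real.exp (-(δ * min ((geomT D).dist ⟨p, hpD⟩ ⟨q, hqD⟩) ((geomT D').dist ⟨p, hpD'⟩ ⟨q, hqD'⟩)))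
          * Real.exp (-(δ * dOmega D D' p.2 q.2)))
    (hPD : ∀ (μ ν : Fin (d + 1)) (x x' : ↥(boxDom (N0 ℓ Mh k P'))),
      |dPd D μ ν x x'| ≤ CP * ((((ℓ : ℝ) + 1) ^ D.lev x.1) ^ 2)⁻¹ * (W D.toDomains (blkOf D.toDomains x'))⁻¹ *
        Real.exp (-(δ * (geomT D).dist (blkOf D.toDomains x) (blkOf D.toDomains x'))))
    (hPD' : ∀ (μ ν : Fin (d + 1)) (x x' : ↥(boxDom (N0 ℓ Mh k P'))),
      |dPd D' μ ν x x'| ≤ CP * ((((ℓ : ℝ) + 1) ^ D'.lev x.1) ^ 2)⁻¹ * (W D'.toDomains (blkOf D'.toDomains x'))⁻¹ *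
        Real.exp (-(δ * (geomT D').dist (blkOf D'.toDomains x) (blkOf D'.toDomains x'))))
    {w : BondIdx (domT hN D hk) → ℝ} {w' : BondIdx (domT hN D' hk) → ℝ} (hw0 : ∀ i, 0 ≤ w i) (hw0' : ∀ i', 0 ≤ w' i')
    (hwb : ∀ i, w i ≤ b₁ * cf ^ 2 * ((((ℓ : ℝ) + 1) ^ (i.1.1 : ℕ)) ^ (d + 1)) * (((((ℓ : ℝ) + 1) ^ (i.1.1 : ℕ)) ^ 2))⁻¹)
    (hwb' : ∀ i', w' i' ≤ b₁ * cf ^ 2 * ((((ℓ : ℝ) + 1) ^ (i'.1.1 : ℕ)) ^ (d + 1)) * (((((ℓ : ℝ) + 1) ^ (i'.1.1 : ℕ)) ^ 2))⁻¹)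
    (hww : ∀ (i : BondIdx (domT hN D hk)) (i' : BondIdx (domT hN D' hk)), i.1 = i'.1 → w i = w' i')
    {y : ↥(bset D.toDomains)} (hy : y.1.1 = k) {y' : ↥(bset D'.toDomains)} (hy' : y'.1.1 = k)
    {g : PBond (PV d ℓ m K hd hL) 0 → ℝ}
    (hg : ∀ v, |g v| ≤ A * ((geomT D').len (blkV1 hN D' v) * |cf|⁻¹) * Real.exp (-(δ * (geomT D').dist (blkV1 hN D' v) y')) * B)
    (f : PBond (PV d ℓ m K hd hL) 0) :
    |(VP hN D D' cf + VQ hN D D' hk w w') g f| ≤ (((d : ℝ) + 1) * c * (CΔ + CP * Real.exp (2 * δ) * (1 + ((ℓ : ℝ) + 1) ^ 2)) + 2 * b₁ * Real.exp (5 / 2 * δ) * (1 + ((ℓ : ℝ) + 1) ^ 2)) * A * B * (|cf| * ((((ℓ : ℝ) + 1) ^ k))⁻¹) * (((ℓ : ℝ) + 1) ^ (2 * k) / ((ℓ : ℝ) + 1) ^ (2 * (blkV1 hN D f).1.1)) * (Real.exp (1 / 2 * δ * (geomT D).dist y (blkV1 hN D f)) * Real.exp (-(1 / 2 * δ * dOmega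 D D' y.1.2 y'.1.2))) := by
  have hVP := abs_VP_apply_le_lin hN D D' hMh hP hRM hδ hcf hCΔ hCP hA hB hc hthr h261 h261' hΔ hPD hPD' hy hy' hg f
  have hQ1 := abs_QsE_trunc_le_lin hN D D' hk hk1 hMh hP hδ hcf hb₁ hA hB hw0 hwb hy hy' hg f
  have hQ2 := abs_QsE_trunc'_le_lin hN D D' hk hk1 hMh hP hRM hδ hcf hb₁ hA hB hthr hw0' hwb' hy hy' hg f
  have hρ1 : 1 ≤ (((ℓ : ℝ) + 1) ^ (2 * k) / ((ℓ : ℝ) + 1) ^ (2 * (blkV1 hN D f).1.1)) := one_le_ratio D _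
  have hκ0 : 0 ≤ |cf| * ((((ℓ : ℝ) + 1) ^ k))⁻¹ := by positivity
  have hVQ : |VQ hN D D' hk w w' g f| ≤ 2 * b₁ * A * B * ((ℓ : ℝ) + 1) ^ 2 * Real.exp (5 / 2 * δ) * (|cf| * ((((ℓ : ℝ) + 1) ^ k))⁻¹) * (Real.exp (1 / 2 * δ * (geomT D).dist y (blkV1 hN D f)) * Real.exp (-(1 / 2 * δ * dOmega D D' y.1.2 y'.1.2)))
      + 2 * b₁ * A * B * Real.exp (5 / 2 * δ) * (|cf| * ((((ℓ : ℝ) + 1) ^ k))⁻¹) * (((ℓ : ℝ) + 1) ^ (2 * k) / ((ℓ : ℝ) + 1) ^ (2 * (blkV1 hN D f).1.1)) * (Real.exp (1 / 2 * δ * (geomT D).dist y (blkV1 hN D f)) * Real.exp (-(1 / 2 * δ * dOmega D D' y.1.2 y'.1.2))) := by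
    rw [VQ_apply_eq hN D D' hk hww g f]
    exact (abs_sub _ _).trans (add_le_add hQ2 hQ1)
  rw [LinearMap.add_apply, Pi.add_apply]
  refine (abs_add_le _ _).trans ((add_le_add hVP hVQ).trans ?_)
  have h1 : 2 * b₁ * A * B * ((ℓ : ℝ) + 1) ^ 2 * Real.exp (5 / 2 * δ) * (|cf| * ((((ℓ : ℝ) + 1) ^ k))⁻¹) * (Real.exp (1 / 2 * δ * (geomT D).dist y (blkV1 hN D f)) * Real.exp (-(1 / 2 * δ * dOmega D D' y.1.2 y'.1.2)))
      ≤ 2 * b₁ * A * B * ((ℓ : ℝ) + 1) ^ 2 * Real.exp (5 / 2 * δ) * (|cf| * ((((ℓ : ℝ) + 1) ^ k))⁻¹) * (Real.exp (1 / 2 * δ * (geomT D).dist y (blkV1 hN D f)) * Real.exp (-(1 / 2 * δ * dOmega D D' y.1.2 y'.1.2))) * (((ℓ : ℝ) + 1) ^ (2 * k) / ((ℓ : ℝ) + 1) ^ (2 * (blkV1 hN D f).1.1)) :=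
    le_mul_of_one_le_right (by positivity) hρ1
  have e : (((d : ℝ) + 1) * c * (CΔ + CP * Real.exp (2 * δ) * (1 + ((ℓ : ℝ) + 1) ^ 2)) + 2 * b₁ * Real.exp (5 / 2 * δ) * (1 + ((ℓ : ℝ) + 1) ^ 2)) * A * B * (|cf| * ((((ℓ : ℝ) + 1) ^ k))⁻¹) * (((ℓ : ℝ) + 1) ^ (2 * k) / ((ℓ : ℝ) + 1) ^ (2 * (blkV1 hN D f).1.1)) * (Real.exp (1 / 2 * δ * (geomT D).dist y (blkV1 hN D f)) * Real.exp (-(1 / 2 * δ * dOmega D D' y.1.2 y'.1.2)))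
      = ((d : ℝ) + 1) * c * (CΔ + CP * Real.exp (2 * δ) * (1 + ((ℓ : ℝ) + 1) ^ 2)) * A * B * (|cf| * ((((ℓ : ℝ) + 1) ^ k))⁻¹) * (((ℓ : ℝ) + 1) ^ (2 * k) / ((ℓ : ℝ) + 1) ^ (2 * (blkV1 hN D f).1.1)) * (Real.exp (1 / 2 * δ * (geomT D).dist y (blkV1 hN D f)) * Real.exp (-(1 / 2 * δ * dOmega D D' y.1.2 y'.1.2)))
        + (2 * b₁ * A * B * ((ℓ : ℝ) + 1) ^ 2 * Real.exp (5 / 2 * δ) * (|cf| * ((((ℓ : ℝ) + 1) ^ k))⁻¹) * (Real.exp (1 / 2 * δ * (geomT D).dist y (blkV1 hN D f)) * Real.exp (-(1 / 2 * δ * dOmega D D' y.1.2 y'.1.2))) * (((ℓ : ℝ) + 1) ^ (2 * k) / ((ℓ : ℝ) + 1) ^ (2 * (blkV1 hN D f).1.1))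
          + 2 * b₁ * A * B * Real.exp (5 / 2 * δ) * (|cf| * ((((ℓ : ℝ) + 1) ^ k))⁻¹) * (((ℓ : ℝ) + 1) ^ (2 * k) / ((ℓ : ℝ) + 1) ^ (2 * (blkV1 hN D f).1.1)) * (Real.exp (1 / 2 * δ * (geomT D).dist y (blkV1 hN D f)) * Real.exp (-(1 / 2 * δ * dOmega D D' y.1.2 y'.1.2)))) := by ring
  rw [e]
  linarith

/-- **THE ENGINE FOR AN OUTER FACTOR WITH A GENERAL PREFACTOR `φ` AND AN INNER OUTPUT WITH THE LINEAR PROFILE**: under a majorant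
`A′·φ(y)·e^{−δd}` of `T` and the profile `A·(L^{j′(v)}|c_f|⁻¹)·e^{−δd′}·B` of `g`, `|(T(V_P + V_Q)g)(x)| ≤ ΘL²c·A′A·B·(|c_f|/L^k)·φ(y)·e^{−½δd(y,y′,Ω)}`
for `x ∈ B(y)` — block decomposition against the majorant, transfer (2.60), sum (2.61).
[cite: Balaban1985BackgroundPropagators, Thm 3.14 (3.154) p.427; Balaban1984PropagatorsII, (2.60)–(2.61) p.234, (2.136) p.247] -/
theorem engine_lin (hk1 : 1 ≤ k) (hMh : 1 ≤ Mh) (hP : ∀ μ, 1 ≤ P' μ) (hRM : 1 ≤ R * ((ℓ + 1) * Mh))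
    {δ c CΔ CP b₁ A B cf : ℝ} (hδ : 0 ≤ δ) (hcf : cf ≠ 0) (hCΔ : 0 ≤ CΔ) (hCP : 0 ≤ CP) (hb₁ : 0 ≤ b₁) (hA : 0 ≤ A) (hB : 0 ≤ B)
    (hc : 0 ≤ c) (hthr : ((ℓ : ℝ) + 1) ^ 2 ≤ Real.exp (1 / 4 * δ * ((R : ℝ) * (((ℓ : ℝ) + 1) * Mh) - 1)))
    (h261 : Ineq261With c (geomT D) δ (1 / 4)) (h261' : Ineq261With c (geomT D') δ (1 / 4))
    (hΔ : ∀ (p q : ℕ × (Fin (d + 1) → ℤ)) (hpD : p ∈ bset D.toDomains) (hpD' : p ∈ bset D'.toDomains)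
      (hqD : q ∈ bset D.toDomains) (hqD' : q ∈ bset D'.toDomains), p.1 = k → q.1 = k →
      ∀ (x x' : ↥(boxDom (N0 ℓ Mh k P'))), blkOf D.toDomains x = ⟨p, hpD⟩ → blkOf D.toDomains x' = ⟨q, hqD⟩ →
      ∀ μ ν : Fin (d + 1), |dPd D μ ν x x' - dPd D' μ ν x x'|
        ≤ CΔ * ((((ℓ : ℝ) + 1) ^ k) ^ 2)⁻¹ * ((((ℓ : ℝ) + 1) ^ k) ^ (d + 1))⁻¹
          * Real.exp (-(δ * min ((geomT D).dist ⟨p, hpD⟩ ⟨q, hqD⟩) ((geomT D').dist ⟨p, hpD'⟩ ⟨q, hqD'⟩)))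
          * Real.exp (-(δ * dOmega D D' p.2 q.2)))
    (hPD : ∀ (μ ν : Fin (d + 1)) (x x' : ↥(boxDom (N0 ℓ Mh k P'))),
      |dPd D μ ν x x'| ≤ CP * ((((ℓ : ℝ) + 1) ^ D.lev x.1) ^ 2)⁻¹ * (W D.toDomains (blkOf D.toDomains x'))⁻¹ *
        Real.exp (-(δ * (geomT D).dist (blkOf D.toDomains x) (blkOf D.toDomains x'))))
    (hPD' : ∀ (μ ν : Fin (d + 1)) (x x' : ↥(boxDom (N0 ℓ Mh k P'))),
      |dPd D' μ ν x x'| ≤ CP * ((((ℓ : ℝ) + 1) ^ D'.lev x.1) ^ 2)⁻¹ * (W D'.toDomains (blkOf D'.toDomains x'))⁻¹ *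
        Real.exp (-(δ * (geomT D').dist (blkOf D'.toDomains x) (blkOf D'.toDomains x'))))
    {w : BondIdx (domT hN D hk) → ℝ} {w' : BondIdx (domT hN D' hk) → ℝ} (hw0 : ∀ i, 0 ≤ w i) (hw0' : ∀ i', 0 ≤ w' i')
    (hwb : ∀ i, w i ≤ b₁ * cf ^ 2 * ((((ℓ : ℝ) + 1) ^ (i.1.1 : ℕ)) ^ (d + 1)) * (((((ℓ : ℝ) + 1) ^ (i.1.1 : ℕ)) ^ 2))⁻¹)
    (hwb' : ∀ i', w' i' ≤ b₁ * cf ^ 2 * ((((ℓ : ℝ) + 1) ^ (i'.1.1 : ℕ)) ^ (d + 1)) * (((((ℓ : ℝ) + 1) ^ (i'.1.1 : ℕ)) ^ 2))⁻¹)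
    (hww : ∀ (i : BondIdx (domT hN D hk)) (i' : BondIdx (domT hN D' hk)), i.1 = i'.1 → w i = w' i')
    {T : Module.End ℝ (PBond (PV d ℓ m K hd hL) 0 → ℝ)} {A' : ℝ} (hA' : 0 ≤ A') {φ : ↥(bset D.toDomains) → ℝ} (hφ : ∀ a, 0 ≤ φ a)
    (hT : HasMajorant (g := geomT D) (blkV1 hN D) T (fun a b => A' * φ a * Real.exp (-(δ * (geomT D).dist a b))))
    {y : ↥(bset D.toDomains)} (hy : y.1.1 = k) {y' : ↥(bset D'.toDomains)} (hy' : y'.1.1 = k)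
    {g : PBond (PV d ℓ m K hd hL) 0 → ℝ}
    (hg : ∀ v, |g v| ≤ A * ((geomT D').len (blkV1 hN D' v) * |cf|⁻¹) * Real.exp (-(δ * (geomT D').dist (blkV1 hN D' v) y')) * B)
    (x : PBond (PV d ℓ m K hd hL) 0) (hx : blkV1 hN D x = y) :
    |T ((VP hN D D' cf + VQ hN D D' hk w w') g) x|
      ≤ (((d : ℝ) + 1) * c * (CΔ + CP * Real.exp (2 * δ) * (1 + ((ℓ : ℝ) + 1) ^ 2)) + 2 * b₁ * Real.exp (5 / 2 * δ) * (1 + ((ℓ : ℝ) + 1) ^ 2)) * ((ℓ : ℝ) + 1) ^ 2 * c * (A' * A) * B * (|cf| * ((((ℓ : ℝ) + 1) ^ k))⁻¹) * φ y * Real.exp (-(1 / 2 * δ * dOmega D D' y.1.2 y'.1.2)) := by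
  have hκ0 : 0 ≤ |cf| * ((((ℓ : ℝ) + 1) ^ k))⁻¹ := by positivity
  have hU := abs_le_sum_of_hasMajorant (g := geomT D) (blkV1 hN D) hT ((VP hN D D' cf + VQ hN D D' hk w w') g)
    (fun p => (((d : ℝ) + 1) * c * (CΔ + CP * Real.exp (2 * δ) * (1 + ((ℓ : ℝ) + 1) ^ 2)) + 2 * b₁ * Real.exp (5 / 2 * δ) * (1 + ((ℓ : ℝ) + 1) ^ 2)) * A * B * (|cf| * ((((ℓ : ℝ) + 1) ^ k))⁻¹) * (((ℓ : ℝ) + 1) ^ (2 * k) / ((ℓ : ℝ) + 1) ^ (2 * p.1.1))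
      * (Real.exp (1 / 2 * δ * (geomT D).dist y p) * Real.exp (-(1 / 2 * δ * dOmega D D' y.1.2 y'.1.2))))
    (fun p => by positivity) (fun f => abs_V_apply_le_lin hN D D' hk hk1 hMh hP hRM hδ hcf hCΔ hCP hb₁ hA hB hc hthr h261 h261' hΔ hPD hPD' hw0 hw0' hwb hwb' hww hy hy' hg f) x
  refine hU.trans ?_
  rw [hx]
  have hφy := hφ y
  have hterm : ∀ p : ↥(bset D.toDomains),
      A' * φ y * Real.exp (-(δ * (geomT D).dist y p))
        * ((((d : ℝ) + 1) * c * (CΔ + CP * Real.exp (2 * δ) * (1 + ((ℓ : ℝ) + 1) ^ 2)) + 2 * b₁ * Real.exp (5 / 2 * δ) * (1 + ((ℓ : ℝ) + 1) ^ 2)) * A * B * (|cf| * ((((ℓ : ℝ) + 1) ^ k))⁻¹) * (((ℓ : ℝ) + 1) ^ (2 * k) / ((ℓ : ℝ) + 1) ^ (2 * p.1.1))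
          * (Real.exp (1 / 2 * δ * (geomT D).dist y p) * Real.exp (-(1 / 2 * δ * dOmega D D' y.1.2 y'.1.2))))
      ≤ (((d : ℝ) + 1) * c * (CΔ + CP * Real.exp (2 * δ) * (1 + ((ℓ : ℝ) + 1) ^ 2)) + 2 * b₁ * Real.exp (5 / 2 * δ) * (1 + ((ℓ : ℝ) + 1) ^ 2)) * ((ℓ : ℝ) + 1) ^ 2 * (A' * A) * B * (|cf| * ((((ℓ : ℝ) + 1) ^ k))⁻¹) * φ y * Real.exp (-(1 / 2 * δ * dOmega D D' y.1.2 y'.1.2))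
        * Real.exp (-(1 / 4 * δ * (geomT D).dist y p)) := by
    intro p
    have htr := transfer_top D hMh hP hRM hδ hthr p y hy
    rw [symmT D p y] at htr
    have hsplit : Real.exp (-(δ * (geomT D).dist y p)) * Real.exp (1 / 2 * δ * (geomT D).dist y p)
        = Real.exp (-(1 / 4 * δ * (geomT D).dist y p)) * Real.exp (-(1 / 4 * δ * (geomT D).dist y p)) := by
      rw [← Real.exp_add, ← Real.exp_add]
      congr 1; ring
    calc A' * φ y * Real.exp (-(δ * (geomT D).dist y p))
          * ((((d : ℝ) + 1) * c * (CΔ + CP * Real.exp (2 * δ) * (1 + ((ℓ : ℝ) + 1) ^ 2)) + 2 * b₁ * Real.exp (5 / 2 * δ) * (1 + ((ℓ : ℝ) + 1) ^ 2)) * A * B * (|cf| * ((((ℓ : ℝ) + 1) ^ k))⁻¹) * (((ℓ : ℝ) + 1) ^ (2 * k) / ((ℓ : ℝ) + 1) ^ (2 * p.1.1))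
            * (Real.exp (1 / 2 * δ * (geomT D).dist y p) * Real.exp (-(1 / 2 * δ * dOmega D D' y.1.2 y'.1.2))))
        = (((d : ℝ) + 1) * c * (CΔ + CP * Real.exp (2 * δ) * (1 + ((ℓ : ℝ) + 1) ^ 2)) + 2 * b₁ * Real.exp (5 / 2 * δ) * (1 + ((ℓ : ℝ) + 1) ^ 2)) * (A' * A) * B * (|cf| * ((((ℓ : ℝ) + 1) ^ k))⁻¹) * φ y * Real.exp (-(1 / 2 * δ * dOmega D D' y.1.2 y'.1.2))
          * ((((ℓ : ℝ) + 1) ^ (2 * k) / ((ℓ : ℝ) + 1) ^ (2 * p.1.1))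
            * (Real.exp (-(δ * (geomT D).dist y p)) * Real.exp (1 / 2 * δ * (geomT D).dist y p))) := by ring
      _ = (((d : ℝ) + 1) * c * (CΔ + CP * Real.exp (2 * δ) * (1 + ((ℓ : ℝ) + 1) ^ 2)) + 2 * b₁ * Real.exp (5 / 2 * δ) * (1 + ((ℓ : ℝ) + 1) ^ 2)) * (A' * A) * B * (|cf| * ((((ℓ : ℝ) + 1) ^ k))⁻¹) * φ y * Real.exp (-(1 / 2 * δ * dOmega D D' y.1.2 y'.1.2))
          * ((((ℓ : ℝ) + 1) ^ (2 * k) / ((ℓ : ℝ) + 1) ^ (2 * p.1.1) * Real.exp (-(1 / 4 * δ * (geomT D).dist y p)))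
            * Real.exp (-(1 / 4 * δ * (geomT D).dist y p))) := by rw [hsplit]; ring
      _ ≤ (((d : ℝ) + 1) * c * (CΔ + CP * Real.exp (2 * δ) * (1 + ((ℓ : ℝ) + 1) ^ 2)) + 2 * b₁ * Real.exp (5 / 2 * δ) * (1 + ((ℓ : ℝ) + 1) ^ 2)) * (A' * A) * B * (|cf| * ((((ℓ : ℝ) + 1) ^ k))⁻¹) * φ y * Real.exp (-(1 / 2 * δ * dOmega D D' y.1.2 y'.1.2))
          * (((ℓ : ℝ) + 1) ^ 2 * Real.exp (-(1 / 4 * δ * (geomT D).dist y p))) := by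
          have h0 : 0 ≤ (((d : ℝ) + 1) * c * (CΔ + CP * Real.exp (2 * δ) * (1 + ((ℓ : ℝ) + 1) ^ 2)) + 2 * b₁ * Real.exp (5 / 2 * δ) * (1 + ((ℓ : ℝ) + 1) ^ 2)) * (A' * A) * B * (|cf| * ((((ℓ : ℝ) + 1) ^ k))⁻¹) * φ y * Real.exp (-(1 / 2 * δ * dOmega D D' y.1.2 y'.1.2)) := by
            positivity
          exact mul_le_mul_of_nonneg_left (mul_le_mul_of_nonneg_right htr (Real.exp_pos _).le) h0
      _ = _ := by ring
  refine (Finset.sum_le_sum fun p _ => hterm p).trans ?_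
  rw [← Finset.mul_sum]
  have h0 : 0 ≤ (((d : ℝ) + 1) * c * (CΔ + CP * Real.exp (2 * δ) * (1 + ((ℓ : ℝ) + 1) ^ 2)) + 2 * b₁ * Real.exp (5 / 2 * δ) * (1 + ((ℓ : ℝ) + 1) ^ 2)) * ((ℓ : ℝ) + 1) ^ 2 * (A' * A) * B * (|cf| * ((((ℓ : ℝ) + 1) ^ k))⁻¹) * φ y * Real.exp (-(1 / 2 * δ * dOmega D D' y.1.2 y'.1.2)) := by
    positivity
  calc (((d : ℝ) + 1) * c * (CΔ + CP * Real.exp (2 * δ) * (1 + ((ℓ : ℝ) + 1) ^ 2)) + 2 * b₁ * Real.exp (5 / 2 * δ) * (1 + ((ℓ : ℝ) + 1) ^ 2)) * ((ℓ : ℝ) + 1) ^ 2 * (A' * A) * B * (|cf| * ((((ℓ : ℝ) + 1) ^ k))⁻¹) * φ y * Real.exp (-(1 / 2 * δ * dOmega D D' y.1.2 y'.1.2))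
        * ∑ p : ↥(bset D.toDomains), Real.exp (-(1 / 4 * δ * (geomT D).dist y p))
      ≤ (((d : ℝ) + 1) * c * (CΔ + CP * Real.exp (2 * δ) * (1 + ((ℓ : ℝ) + 1) ^ 2)) + 2 * b₁ * Real.exp (5 / 2 * δ) * (1 + ((ℓ : ℝ) + 1) ^ 2)) * ((ℓ : ℝ) + 1) ^ 2 * (A' * A) * B * (|cf| * ((((ℓ : ℝ) + 1) ^ k))⁻¹) * φ y * Real.exp (-(1 / 2 * δ * dOmega D D' y.1.2 y'.1.2)) * c :=
        mul_le_mul_of_nonneg_left (h261 y) h0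
    _ = _ := by ring

/-- **THE ABSTRACT THEOREM FOR THE (2.136)₃ MEMBER**: for operators `T, T′` carrying majorants `A₃·(L^{j(y)}|c_f|⁻¹)·e^{−δd}`,
`A₃·(L^{j(y)}|c_f|⁻¹)·e^{−δd′}` in the two families (the printed shape of (2.136)₃), an outer operator `G_D` carrying the (2.136)₁ majorant
`A·pref·e^{−δd}`, and the identity `T − T′ = G_D(V_P + V_Q)T′`:
`|(Tμ)(x) − (T′μ)(x)| ≤ √(2A₃)·√(ΘL²cAA₃)·(L^k|c_f|⁻¹)·B·e^{−½δ·min(d,d′)(y,y′)}·e^{−¼δ·d(y,y′,Ω)}`.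
[cite: Balaban1985BackgroundPropagators, Thm 3.14 (3.153)–(3.154) pp.426–427; Balaban1984PropagatorsII, (2.22) p.226, Prop. 2.6 (2.136) p.247] -/
theorem resolvent_diff_bound_lin (hk1 : 1 ≤ k) (hMh : 1 ≤ Mh) (hP : ∀ μ, 1 ≤ P' μ) (hRM : 1 ≤ R * ((ℓ + 1) * Mh))
    {δ c CΔ CP b₁ A B cf : ℝ} (hδ : 0 ≤ δ) (hcf : cf ≠ 0) (hCΔ : 0 ≤ CΔ) (hCP : 0 ≤ CP) (hb₁ : 0 ≤ b₁) (hA : 0 ≤ A) (hB : 0 ≤ B)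
    (hc : 0 ≤ c) (hthr : ((ℓ : ℝ) + 1) ^ 2 ≤ Real.exp (1 / 4 * δ * ((R : ℝ) * (((ℓ : ℝ) + 1) * Mh) - 1)))
    (h261 : Ineq261With c (geomT D) δ (1 / 4)) (h261' : Ineq261With c (geomT D') δ (1 / 4))
    (hΔ : ∀ (p q : ℕ × (Fin (d + 1) → ℤ)) (hpD : p ∈ bset D.toDomains) (hpD' : p ∈ bset D'.toDomains)
      (hqD : q ∈ bset D.toDomains) (hqD' : q ∈ bset D'.toDomains), p.1 = k → q.1 = k →
      ∀ (x x' : ↥(boxDom (N0 ℓ Mh k P'))), blkOf D.toDomains x = ⟨p, hpD⟩ → blkOf D.toDomains x' = ⟨q, hqD⟩ →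
      ∀ μ ν : Fin (d + 1), |dPd D μ ν x x' - dPd D' μ ν x x'|
        ≤ CΔ * ((((ℓ : ℝ) + 1) ^ k) ^ 2)⁻¹ * ((((ℓ : ℝ) + 1) ^ k) ^ (d + 1))⁻¹
          * Real.exp (-(δ * min ((geomT D).dist ⟨p, hpD⟩ ⟨q, hqD⟩) ((geomT D').dist ⟨p, hpD'⟩ ⟨q, hqD'⟩)))
          * Real.exp (-(δ * dOmega D D' p.2 q.2)))
    (hPD : ∀ (μ ν : Fin (d + 1)) (x x' : ↥(boxDom (N0 ℓ Mh k P'))),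
      |dPd D μ ν x x'| ≤ CP * ((((ℓ : ℝ) + 1) ^ D.lev x.1) ^ 2)⁻¹ * (W D.toDomains (blkOf D.toDomains x'))⁻¹ *
        Real.exp (-(δ * (geomT D).dist (blkOf D.toDomains x) (blkOf D.toDomains x'))))
    (hPD' : ∀ (μ ν : Fin (d + 1)) (x x' : ↥(boxDom (N0 ℓ Mh k P'))),
      |dPd D' μ ν x x'| ≤ CP * ((((ℓ : ℝ) + 1) ^ D'.lev x.1) ^ 2)⁻¹ * (W D'.toDomains (blkOf D'.toDomains x'))⁻¹ *
        Real.exp (-(δ * (geomT D').dist (blkOf D'.toDomains x) (blkOf D'.toDomains x'))))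
    {w : BondIdx (domT hN D hk) → ℝ} {w' : BondIdx (domT hN D' hk) → ℝ} (hw0 : ∀ i, 0 ≤ w i) (hw0' : ∀ i', 0 ≤ w' i')
    (hwb : ∀ i, w i ≤ b₁ * cf ^ 2 * ((((ℓ : ℝ) + 1) ^ (i.1.1 : ℕ)) ^ (d + 1)) * (((((ℓ : ℝ) + 1) ^ (i.1.1 : ℕ)) ^ 2))⁻¹)
    (hwb' : ∀ i', w' i' ≤ b₁ * cf ^ 2 * ((((ℓ : ℝ) + 1) ^ (i'.1.1 : ℕ)) ^ (d + 1)) * (((((ℓ : ℝ) + 1) ^ (i'.1.1 : ℕ)) ^ 2))⁻¹)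
    (hww : ∀ (i : BondIdx (domT hN D hk)) (i' : BondIdx (domT hN D' hk)), i.1 = i'.1 → w i = w' i')
    {T T' GD : Module.End ℝ (PBond (PV d ℓ m K hd hL) 0 → ℝ)} {A₃ : ℝ} (hA₃ : 0 ≤ A₃)
    (hT : HasMajorant (g := geomT D) (blkV1 hN D) T (fun a b => A₃ * ((geomT D).len a * |cf|⁻¹) * Real.exp (-(δ * (geomT D).dist a b))))
    (hT' : HasMajorant (g := geomT D') (blkV1 hN D') T' (fun a b => A₃ * ((geomT D').len a * |cf|⁻¹) * Real.exp (-(δ * (geomT D').dist a b))))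
    (hGD : HasMajorant (g := geomT D) (blkV1 hN D) GD (fun a b => A * pref cf a * Real.exp (-(δ * (geomT D).dist a b))))
    (hres : T - T' = GD ∘ₗ (VP hN D D' cf + VQ hN D D' hk w w') ∘ₗ T')
    {y : ↥(bset D.toDomains)} (hy : y.1.1 = k) (hyD' : y.1 ∈ bset D'.toDomains)
    {y' : ↥(bset D'.toDomains)} (hy' : y'.1.1 = k) (hy'D : y'.1 ∈ bset D.toDomains)
    {μ : PBond (PV d ℓ m K hd hL) 0 → ℝ} (hμ : BlockSupp (g := geomT D') (blkV1 hN D') μ y' B)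
    (x : PBond (PV d ℓ m K hd hL) 0) (hx : blkV1 hN D x = y) :
    |T μ x - T' μ x| ≤ Real.sqrt (2 * A₃) * Real.sqrt ((((d : ℝ) + 1) * c * (CΔ + CP * Real.exp (2 * δ) * (1 + ((ℓ : ℝ) + 1) ^ 2)) + 2 * b₁ * Real.exp (5 / 2 * δ) * (1 + ((ℓ : ℝ) + 1) ^ 2)) * ((ℓ : ℝ) + 1) ^ 2 * c * (A * A₃)) * (((geomT D).len y * |cf|⁻¹) * B)
      * Real.exp (-(1 / 2 * δ * min ((geomT D).dist y ⟨y'.1, hy'D⟩) ((geomT D').dist ⟨y.1, hyD'⟩ y')))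
      * Real.exp (-(1 / 4 * δ * dOmega D D' y.1.2 y'.1.2)) := by
  have hg : ∀ v, |T' μ v| ≤ A₃ * ((geomT D').len (blkV1 hN D' v) * |cf|⁻¹) * Real.exp (-(δ * (geomT D').dist (blkV1 hN D' v) y')) * B :=
    fun v => hT' y' μ B hμ v
  have hEq : T μ x - T' μ x = GD ((VP hN D D' cf + VQ hN D D' hk w w') (T' μ)) x := by
    have h := congrFun (LinearMap.congr_fun hres μ) x
    rw [LinearMap.sub_apply, Pi.sub_apply, LinearMap.comp_apply, LinearMap.comp_apply] at h
    exact h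
  have hφ0 : ∀ a : ↥(bset D.toDomains), 0 ≤ (geomT D).len a * |cf|⁻¹ := fun a => lin_nonneg D cf a
  have hφ : (fun a : ↥(bset D'.toDomains) => (geomT D').len a * |cf|⁻¹) ⟨y.1, hyD'⟩
      = (fun a : ↥(bset D.toDomains) => (geomT D).len a * |cf|⁻¹) y := by
    simp only [geomT_len]
  have h1 := trivial_bound_gen hN D D' hδ hA₃ (φ := fun a => (geomT D).len a * |cf|⁻¹) (φ' := fun a => (geomT D').len a * |cf|⁻¹)
    hφ0 hT hT' hyD' hy'D hφ hμ x hx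
  have h2 := engine_lin hN D D' hk hk1 hMh hP hRM hδ hcf hCΔ hCP hb₁ hA₃ hμ.nonneg hc hthr h261 h261' hΔ hPD hPD' hw0 hw0' hwb hwb' hww hA
    (φ := fun a => pref cf a) (fun a => pref_nonneg cf a) hGD hy hy' hg x hx
  rw [← hEq] at h2
  have hκ : pref cf y * (|cf| * ((((ℓ : ℝ) + 1) ^ k))⁻¹) = (geomT D).len y * |cf|⁻¹ := pref_mul_kappa_of_top D hcf hy
  have h2' : |T μ x - T' μ x| ≤ ((((d : ℝ) + 1) * c * (CΔ + CP * Real.exp (2 * δ) * (1 + ((ℓ : ℝ) + 1) ^ 2)) + 2 * b₁ * Real.exp (5 / 2 * δ) * (1 + ((ℓ : ℝ) + 1) ^ 2)) * ((ℓ : ℝ) + 1) ^ 2 * c * (A * A₃)) * (((geomT D).len y * |cf|⁻¹) * B)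
      * Real.exp (-(1 / 2 * δ * dOmega D D' y.1.2 y'.1.2)) := by
    refine le_of_le_of_eq h2 ?_
    rw [← hκ]
    ring
  have hp0 := hφ0 y
  exact combined_bound (by positivity) (by positivity) (by positivity) h1 h2'

end Engine

/-! ## §4  THEOREM 3.14 AT `U = 1`: the (2.136)₃ member (`G∇*`) for `G = Δ_a⁻¹`, modulo its one-family majorants -/

/-- **THEOREM 3.14 AT `U = 1` — THE (2.136)₃ MEMBER (`G∇*`) WITH THE FACTOR (3.154) FOR THE GENUINE `k`-LEVEL `G = Δ_a⁻¹` OF TWO NESTED FAMILIES ON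
THE V1 TORUS, MODULO THE ONE-FAMILY (2.136)₃ MAJORANTS**: for all `A₃ ≥ 0`, `δ₃ > 0` there are `δ, C, M₀ > 0`, `N₀ > 0` such that, whenever
`G[Ω]∇*_ν` and `G[Ω′]∇*_ν` (`onFun GE * DVa ν c_f`) carry the majorants `A₃·(L^{j(y)}|c_f|⁻¹)·e^{−δ₃d}` in their families (hypotheses `hT3`,
`hT3'`, the printed shape of (2.136)₃), `|(G[Ω]∇*_νμ)(x) − (G[Ω′]∇*_νμ)(x)| ≤ C·(L^k|c_f|⁻¹)·B·e^{−δ·min(d(y,y′), d′(y,y′))}·e^{−δ·d(y,y′,Ω)}` for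
`x ∈ B(y)`, `supp μ ⊂ B(y′)`, `|μ| ≤ B`, `y, y′ ∈ Ω^{(k)}` common top blocks.
[cite: Balaban1985BackgroundPropagators, Thm 3.14 (3.153)–(3.154) pp.426–427; Balaban1984PropagatorsII, Prop. 2.6 (2.136) p.247, (2.19)–(2.22) p.226] -/
theorem thm314_Gdiv_flat_V1_of_majorants (d ℓ : ℕ) (hd : 1 ≤ d + 1) (hL : Odd (ℓ + 1) ∧ 1 < ℓ + 1) {b₀ b₁ : ℝ} (hb₀ : 0 < b₀)
    (hb₁ : b₀ ≤ b₁) {A₃ δ₃ : ℝ} (hA₃ : 0 ≤ A₃) (hδ₃ : 0 < δ₃) :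
    ∃ δ C M₀ : ℝ, ∃ N₀ : ℕ, 0 < δ ∧ 0 < C ∧ 0 < M₀ ∧ 0 < N₀ ∧
      ∀ (m K : ℕ) {Mh k R : ℕ} {P' : Fin (d + 1) → ℕ}
        (hN : ∀ μ, N0 ℓ Mh k P' μ = (PV d ℓ m K hd hL).sitesPerDir 0) (D D' : TDomains d ℓ Mh k P' R) (hk : k ≤ m + K),
        1 ≤ k → ∀ {a : ℕ}, Mh = (ℓ + 1) ^ a → 8 ≤ Mh → 2 * (ℓ + 1) ^ 2 ≤ R → (∀ μ, 5 * (ℓ + 1) ≤ P' μ) → 4 ≤ ℓ →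
        M₀ ≤ ((ℓ : ℝ) + 1) * Mh → N₀ + 1 ≤ R * ((ℓ + 1) * Mh) →
        ∀ {cf : ℝ} (hcf : cf ≠ 0) {w : BondIdx (domT hN D hk) → ℝ} (hw : ∀ i, 0 < w i)
          {w' : BondIdx (domT hN D' hk) → ℝ} (hw' : ∀ i', 0 < w' i'),
        GlobalBand b₀ b₁ cf w → GlobalBand b₀ b₁ cf w' →
        (∀ (i : BondIdx (domT hN D hk)) (i' : BondIdx (domT hN D' hk)), i.1 = i'.1 → w i = w' i') →
        ∀ (ν : Fin (d + 1)),
        HasMajorant (g := geomT D) (blkV1 hN D) (onFun (GE (domT hN D hk) hcf hw) * DVa ν cf)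
          (fun a b => A₃ * ((geomT D).len a * |cf|⁻¹) * Real.exp (-(δ₃ * (geomT D).dist a b))) →
        HasMajorant (g := geomT D') (blkV1 hN D') (onFun (GE (domT hN D' hk) hcf hw') * DVa ν cf)
          (fun a b => A₃ * ((geomT D').len a * |cf|⁻¹) * Real.exp (-(δ₃ * (geomT D').dist a b))) →
        ∀ (y : ↥(bset D.toDomains)) (hyD' : y.1 ∈ bset D'.toDomains) (y' : ↥(bset D'.toDomains)) (hy'D : y'.1 ∈ bset D.toDomains),
        y.1.1 = k → y'.1.1 = k →
        ∀ (μ : PBond (PV d ℓ m K hd hL) 0 → ℝ) (B : ℝ), BlockSupp (g := geomT D') (blkV1 hN D') μ y' B →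
        ∀ x : PBond (PV d ℓ m K hd hL) 0, blkV1 hN D x = y →
          |(onFun (GE (domT hN D hk) hcf hw) * DVa ν cf : Module.End ℝ (PBond (PV d ℓ m K hd hL) 0 → ℝ)) μ x
              - (onFun (GE (domT hN D' hk) hcf hw') * DVa ν cf : Module.End ℝ (PBond (PV d ℓ m K hd hL) 0 → ℝ)) μ x|
            ≤ C * ((geomT D).len y * |cf|⁻¹ * B)
              * Real.exp (-(δ * min ((geomT D).dist y ⟨y'.1, hy'D⟩) ((geomT D').dist ⟨y.1, hyD'⟩ y')))
              * Real.exp (-(δ * dOmega D D' y.1.2 y'.1.2)) := by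
  have hℓ : 1 ≤ ℓ := by have := hL.2; omega
  have hL1 : (1 : ℝ) ≤ (ℓ : ℝ) + 1 := by linarith [(Nat.cast_nonneg ℓ : (0 : ℝ) ≤ ℓ)]
  -- (2.136)₁ for `G = Δ_a⁻¹` (p38), at `α = ½`, `σ = σ₁` — the OUTER factor
  obtain ⟨σ₁, hσ₁, hT1⟩ := prop26_2136_grad_kLevel_unconditional_pad_V1 d ℓ hd hL hb₀ hb₁
  obtain ⟨A, M₂, hA, hM₂, hG1⟩ := hT1 σ₁ hσ₁ le_rfl (1 / 2) (by norm_num) (by norm_num)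
  have hδG0 : 0 < delta3 (1 / 2) (2 * σ₁) := delta3_pos (by norm_num) (by linarith)
  -- the two-family (3.49)₄ difference (gen 19) and the one-family (3.49)₄ (FILE 1) at the printed weights
  have hL2 : (1 : ℝ) < (((ℓ : ℝ) + 1)) ^ 2 := by
    have : (2 : ℝ) ≤ (ℓ : ℝ) + 1 := by
      have : (1 : ℝ) ≤ ℓ := by exact_mod_cast hℓ
      linarith
    nlinarith
  have hamin : 0 < 1 - ((((ℓ : ℝ) + 1)) ^ 2)⁻¹ := by rw [sub_pos]; exact inv_lt_one_of_one_lt₀ hL2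
  obtain ⟨hwin, hrec⟩ := B6Prop22KLevelCensus.KIdx.aPrinted_windows hℓ
  obtain ⟨δ₅, C₅, M₅, N₅, hδ₅, hC₅, hM₅, hN₅, h5⟩ :=
    thm314_P_flat_multiLevelTorus d ℓ hℓ (1 - ((((ℓ : ℝ) + 1)) ^ 2)⁻¹) 1 1 1 hamin one_pos
  obtain ⟨ρ, BP, MP, NP, hρ, hBP, hMP, hNP, hPk⟩ := dPd_le d ℓ hℓ
  -- the common rate and the thresholds of (2.60)/(2.61)
  obtain ⟨δ, hδ0, hδG, hδ5, hδρ, hδ3⟩ : ∃ δ : ℝ, 0 < δ ∧ δ ≤ delta3 (1 / 2) (2 * σ₁) ∧ δ ≤ δ₅ ∧ δ ≤ ρ ∧ δ ≤ δ₃ :=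
    ⟨min (min (delta3 (1 / 2) (2 * σ₁)) δ₃) (min δ₅ ρ), lt_min (lt_min hδG0 hδ₃) (lt_min hδ₅ hρ),
      (min_le_left _ _).trans (min_le_left _ _), (min_le_right _ _).trans (min_le_left _ _),
      (min_le_right _ _).trans (min_le_right _ _), (min_le_left _ _).trans (min_le_right _ _)⟩
  obtain ⟨Nc, c, hNc, hc, hcon⟩ := consts_260_261 d ℓ hδ0
  have hb₁0 : 0 ≤ b₁ := hb₀.le.trans hb₁
  refine ⟨δ / 4, (Real.sqrt (2 * A₃) * Real.sqrt ((((d : ℝ) + 1) * c * (C₅ + BP * Real.exp (2 * δ) * (1 + ((ℓ : ℝ) + 1) ^ 2)) + 2 * b₁ * Real.exp (5 / 2 * δ) * (1 + ((ℓ : ℝ) + 1) ^ 2)) * ((ℓ : ℝ) + 1) ^ 2 * c * (A * A₃)) + 1), max M₂ (max M₅ MP), max Nc (max N₅ NP), by positivity, by positivity, lt_max_of_lt_left hM₂,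
    lt_max_of_lt_left hNc, ?_⟩
  intro m K Mh k R P' hN D D' hk hk1 a hMha hM8 hR2 hP5 hℓ4 hM hRN cf hcf w hw w' hw' hwb hwb' hww ν hT3 hT3' y hyD' y' hy'D hy hy' μ B hμ x hx
  -- sizes
  have hMh1 : 1 ≤ Mh := by omega
  have hMh3 : 3 ≤ Mh := by omega
  have hP1 : ∀ μ, 1 ≤ P' μ := fun μ => le_trans (by omega) (hP5 μ)
  have hP4 : ∀ μ, 4 ≤ P' μ := fun μ => le_trans (by omega) (hP5 μ)
  have hR2' : 2 * (ℓ + 1) ≤ R := le_trans (Nat.mul_le_mul_left 2 (by rw [pow_two]; exact Nat.le_mul_self _)) hR2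
  have hRM1 : 1 ≤ R * ((ℓ + 1) * Mh) := le_trans (Nat.le_add_left 1 _) hRN
  have hM2' : M₂ ≤ ((ℓ : ℝ) + 1) * Mh := (le_max_left _ _).trans hM
  have hM5' : M₅ ≤ ((ℓ : ℝ) + 1) * Mh := ((le_max_left _ _).trans (le_max_right _ _)).trans hM
  have hMP' : MP ≤ ((ℓ : ℝ) + 1) * Mh := ((le_max_right _ _).trans (le_max_right _ _)).trans hM
  have hNc' : Nc + 1 ≤ R * ((ℓ + 1) * Mh) := le_trans (Nat.succ_le_succ (le_max_left _ _)) hRN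
  have hN5' : N₅ + 1 ≤ R * ((ℓ + 1) * Mh) := le_trans (Nat.succ_le_succ ((le_max_left _ _).trans (le_max_right _ _))) hRN
  have hNP' : NP + 1 ≤ R * ((ℓ + 1) * Mh) := le_trans (Nat.succ_le_succ ((le_max_right _ _).trans (le_max_right _ _))) hRN
  obtain ⟨hthr, h261⟩ := hcon k Mh R P' hMh1 hP1 hNc'
  have hd0 : ∀ s t : ↥(bset D.toDomains), 0 ≤ (geomT D).dist s t := (triangle_refl_nonneg_T D hMh1 hP1).2.2
  have hd0' : ∀ s t : ↥(bset D'.toDomains), 0 ≤ (geomT D').dist s t := (triangle_refl_nonneg_T D' hMh1 hP1).2.2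
  -- the (2.136)₁ majorant of the outer factor and the (2.136)₃ majorants of the two operators, at the common rate
  have hGD1 := (hG1 m K hN D hk hk1 hMha hM8 hR2 hP5 hℓ4 hM2' hcf hw hwb).1
  have hGD : HasMajorant (g := geomT D) (blkV1 hN D) (onFun (GE (domT hN D hk) hcf hw))
      (fun a b => A * pref cf a * Real.exp (-(δ * (geomT D).dist a b))) :=
    hasMajorant_mono (g := geomT D) (blkV1 hN D) hGD1 fun a b =>
      mul_le_mul_of_nonneg_left (Real.exp_le_exp.2 (neg_le_neg (mul_le_mul_of_nonneg_right hδG (hd0 a b))))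
        (mul_nonneg hA (pref_nonneg _ _))
  have hT : HasMajorant (g := geomT D) (blkV1 hN D) (onFun (GE (domT hN D hk) hcf hw) * DVa ν cf)
      (fun a b => A₃ * ((geomT D).len a * |cf|⁻¹) * Real.exp (-(δ * (geomT D).dist a b))) :=
    hasMajorant_mono (g := geomT D) (blkV1 hN D) hT3 fun a b =>
      mul_le_mul_of_nonneg_left (Real.exp_le_exp.2 (neg_le_neg (mul_le_mul_of_nonneg_right hδ3 (hd0 a b))))
        (mul_nonneg hA₃ (lin_nonneg D cf a))
  have hT' : HasMajorant (g := geomT D') (blkV1 hN D') (onFun (GE (domT hN D' hk) hcf hw') * DVa ν cf)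
      (fun a b => A₃ * ((geomT D').len a * |cf|⁻¹) * Real.exp (-(δ * (geomT D').dist a b))) :=
    hasMajorant_mono (g := geomT D') (blkV1 hN D') hT3' fun a b =>
      mul_le_mul_of_nonneg_left (Real.exp_le_exp.2 (neg_le_neg (mul_le_mul_of_nonneg_right hδ3 (hd0' a b))))
        (mul_nonneg hA₃ (lin_nonneg D' cf a))
  have hres : onFun (GE (domT hN D hk) hcf hw) * DVa ν cf - onFun (GE (domT hN D' hk) hcf hw') * DVa ν cf
      = onFun (GE (domT hN D hk) hcf hw) ∘ₗ (VP hN D D' cf + VQ hN D D' hk w w') ∘ₗ (onFun (GE (domT hN D' hk) hcf hw') * DVa ν cf) := by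
    rw [← sub_mul, onFun_GE_sub hN D D' hk hℓ hMh1 hP1 hcf hw hw', Module.End.mul_eq_comp, Module.End.mul_eq_comp,
      LinearMap.comp_assoc, LinearMap.comp_assoc]
  -- the two-family (3.49)₄ difference at the common rate
  have hΔ : ∀ (p q : ℕ × (Fin (d + 1) → ℤ)) (hpD : p ∈ bset D.toDomains) (hpD' : p ∈ bset D'.toDomains)
      (hqD : q ∈ bset D.toDomains) (hqD' : q ∈ bset D'.toDomains), p.1 = k → q.1 = k →
      ∀ (x x' : ↥(boxDom (N0 ℓ Mh k P'))), blkOf D.toDomains x = ⟨p, hpD⟩ → blkOf D.toDomains x' = ⟨q, hqD⟩ →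
      ∀ μ ν : Fin (d + 1), |dPd D μ ν x x' - dPd D' μ ν x x'|
        ≤ C₅ * ((((ℓ : ℝ) + 1) ^ k) ^ 2)⁻¹ * ((((ℓ : ℝ) + 1) ^ k) ^ (d + 1))⁻¹
          * Real.exp (-(δ * min ((geomT D).dist ⟨p, hpD⟩ ⟨q, hqD⟩) ((geomT D').dist ⟨p, hpD'⟩ ⟨q, hqD'⟩)))
          * Real.exp (-(δ * dOmega D D' p.2 q.2)) := by
    intro p q hpD hpD' hqD hqD' hp hq x₁ x₂ hx₁ hx₂ μ₁ ν₁
    obtain ⟨-, -, -, h4⟩ := h5 k Mh R hMh3 hM5' hR2' hN5' P' hP1 hP4 D D' (aPrinted ℓ 1) (fun _ => 1) hwin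
      (fun i _ => ⟨le_rfl, le_rfl⟩) hrec p q hpD hpD' hqD hqD' hp hq x₁ x₂ hx₁ hx₂
    have h := h4 μ₁ ν₁
    rw [member4_eq_dPd, member4_eq_dPd] at h
    refine h.trans ?_
    have h0 : 0 ≤ C₅ * ((((ℓ : ℝ) + 1) ^ k) ^ 2)⁻¹ * ((((ℓ : ℝ) + 1) ^ k) ^ (d + 1))⁻¹ := by positivity
    have hm0 : 0 ≤ min ((geomT D).dist ⟨p, hpD⟩ ⟨q, hqD⟩) ((geomT D').dist ⟨p, hpD'⟩ ⟨q, hqD'⟩) := le_min (hd0 _ _) (hd0' _ _)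
    have hΩ0 : 0 ≤ dOmega D D' p.2 q.2 := dOmega_nonneg D D' _ _
    have e1 : Real.exp (-(δ₅ * min ((geomT D).dist ⟨p, hpD⟩ ⟨q, hqD⟩) ((geomT D').dist ⟨p, hpD'⟩ ⟨q, hqD'⟩)))
        ≤ Real.exp (-(δ * min ((geomT D).dist ⟨p, hpD⟩ ⟨q, hqD⟩) ((geomT D').dist ⟨p, hpD'⟩ ⟨q, hqD'⟩))) :=
      Real.exp_le_exp.2 (neg_le_neg (mul_le_mul_of_nonneg_right hδ5 hm0))
    have e2 : Real.exp (-(δ₅ * dOmega D D' p.2 q.2)) ≤ Real.exp (-(δ * dOmega D D' p.2 q.2)) :=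
      Real.exp_le_exp.2 (neg_le_neg (mul_le_mul_of_nonneg_right hδ5 hΩ0))
    exact mul_le_mul (mul_le_mul_of_nonneg_left e1 h0) e2 (Real.exp_pos _).le (mul_nonneg h0 (Real.exp_pos _).le)
  -- the one-family (3.49)₄ bounds at the common rate
  have hPD : ∀ (μ ν : Fin (d + 1)) (x x' : ↥(boxDom (N0 ℓ Mh k P'))),
      |dPd D μ ν x x'| ≤ BP * ((((ℓ : ℝ) + 1) ^ D.lev x.1) ^ 2)⁻¹ * (W D.toDomains (blkOf D.toDomains x'))⁻¹ *
        Real.exp (-(δ * (geomT D).dist (blkOf D.toDomains x) (blkOf D.toDomains x'))) := by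
    intro μ₁ ν₁ x₁ x₂
    refine (hPk k Mh R hMh3 hMP' hR2' hNP' P' hP4 D μ₁ ν₁ x₁ x₂).trans ?_
    have hW0 : 0 < W D.toDomains (blkOf D.toDomains x₂) := W_pos _ _
    exact mul_le_mul_of_nonneg_left (Real.exp_le_exp.2 (neg_le_neg (mul_le_mul_of_nonneg_right hδρ (hd0 _ _)))) (by positivity)
  have hPD' : ∀ (μ ν : Fin (d + 1)) (x x' : ↥(boxDom (N0 ℓ Mh k P'))),
      |dPd D' μ ν x x'| ≤ BP * ((((ℓ : ℝ) + 1) ^ D'.lev x.1) ^ 2)⁻¹ * (W D'.toDomains (blkOf D'.toDomains x'))⁻¹ *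
        Real.exp (-(δ * (geomT D').dist (blkOf D'.toDomains x) (blkOf D'.toDomains x'))) := by
    intro μ₁ ν₁ x₁ x₂
    refine (hPk k Mh R hMh3 hMP' hR2' hNP' P' hP4 D' μ₁ ν₁ x₁ x₂).trans ?_
    have hW0 : 0 < W D'.toDomains (blkOf D'.toDomains x₂) := W_pos _ _
    exact mul_le_mul_of_nonneg_left (Real.exp_le_exp.2 (neg_le_neg (mul_le_mul_of_nonneg_right hδρ (hd0' _ _)))) (by positivity)
  -- the weights
  have hw0 : ∀ i, 0 ≤ w i := fun i => (hw i).le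
  have hw0' : ∀ i', 0 ≤ w' i' := fun i' => (hw' i').le
  have hwB := fun i => w_le_of_band hN D hk hcf hwb i
  have hwB' := fun i' => w_le_of_band hN D' hk hcf hwb' i'
  -- §3's abstract theorem
  have hmain := resolvent_diff_bound_lin hN D D' hk hk1 hMh1 hP1 hRM1 hδ0.le hcf hC₅.le hBP.le hb₁0 hA hμ.nonneg hc hthr (h261 D) (h261 D')
    hΔ hPD hPD' hw0 hw0' hwB hwB' hww hA₃ hT hT' hGD hres hy hyD' hy' hy'D hμ x hx
  refine hmain.trans ?_
  -- the rates `½δ`, `¼δ` weakened to `δ/4`, the constant enlarged by `1`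
  have hF : 0 ≤ (geomT D).len y * |cf|⁻¹ * B := mul_nonneg (lin_nonneg D cf y) hμ.nonneg
  have hm0 : 0 ≤ min ((geomT D).dist y ⟨y'.1, hy'D⟩) ((geomT D').dist ⟨y.1, hyD'⟩ y') := le_min (hd0 _ _) (hd0' _ _)
  have e1 : Real.exp (-(1 / 2 * δ * min ((geomT D).dist y ⟨y'.1, hy'D⟩) ((geomT D').dist ⟨y.1, hyD'⟩ y')))
      ≤ Real.exp (-(δ / 4 * min ((geomT D).dist y ⟨y'.1, hy'D⟩) ((geomT D').dist ⟨y.1, hyD'⟩ y'))) :=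
    Real.exp_le_exp.2 (by nlinarith [mul_nonneg hδ0.le hm0])
  have e2 : Real.exp (-(1 / 4 * δ * dOmega D D' y.1.2 y'.1.2)) = Real.exp (-(δ / 4 * dOmega D D' y.1.2 y'.1.2)) := by
    congr 1; ring
  have hK0 : 0 ≤ Real.sqrt (2 * A₃) * Real.sqrt ((((d : ℝ) + 1) * c * (C₅ + BP * Real.exp (2 * δ) * (1 + ((ℓ : ℝ) + 1) ^ 2)) + 2 * b₁ * Real.exp (5 / 2 * δ) * (1 + ((ℓ : ℝ) + 1) ^ 2)) * ((ℓ : ℝ) + 1) ^ 2 * c * (A * A₃)) :=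
    mul_nonneg (Real.sqrt_nonneg _) (Real.sqrt_nonneg _)
  have hK1 : Real.sqrt (2 * A₃) * Real.sqrt ((((d : ℝ) + 1) * c * (C₅ + BP * Real.exp (2 * δ) * (1 + ((ℓ : ℝ) + 1) ^ 2)) + 2 * b₁ * Real.exp (5 / 2 * δ) * (1 + ((ℓ : ℝ) + 1) ^ 2)) * ((ℓ : ℝ) + 1) ^ 2 * c * (A * A₃)) ≤ (Real.sqrt (2 * A₃) * Real.sqrt ((((d : ℝ) + 1) * c * (C₅ + BP * Real.exp (2 * δ) * (1 + ((ℓ : ℝ) + 1) ^ 2)) + 2 * b₁ * Real.exp (5 / 2 * δ) * (1 + ((ℓ : ℝ) + 1) ^ 2)) * ((ℓ : ℝ) + 1) ^ 2 * c * (A * A₃)) + 1) := le_add_of_nonneg_right zero_le_one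
  rw [e2]
  exact mul_le_mul (mul_le_mul (mul_le_mul_of_nonneg_right hK1 hF) e1 (Real.exp_pos _).le
    (mul_nonneg (hK0.trans hK1) hF)) le_rfl (Real.exp_pos _).le
    (mul_nonneg (mul_nonneg (hK0.trans hK1) hF) (Real.exp_pos _).le)

end LinEngine

/-! # The `L²` members of Theorem 3.14 for `G` (Schur's test on a block pair) -/

open B6RandomWalkKernel (apply_eq_sum_single)
open B6SchurTorusBound (sum_sq_le_abs)
open B9Thm314GpFlatTorusGeometry (mem_OmegaC_iff_exists)
open B9Thm314GpFlatL2 (dOmega_comm)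
open B6Ineq2140KLevelV1 (onFun_GE_single_symm)
open B6GradLegKLevelV1 (DV)
open B6GEDVaTransposeV1 (onFun_GE_DVa_single_transpose onFun_DV_GE_single_transpose)
open B9Thm314GFlatV1Transfer (thm314_G_flat_V1 thm314_gradG_flat_V1)

variable {d : ℕ}

/-! ## §5  `Ωᶜ` and `d(y,y′,Ω)` are symmetric in the two families -/

section Swap

variable {ℓ Mh k R : ℕ} {P : Fin (d + 1) → ℕ} (D D' : TDomains d ℓ Mh k P R)

/-- `Ωᶜ ∩ T^{(k)}` for `(Ω, Ω′)` is the same set as for `(Ω′, Ω)` (`Ω = Ω_k ∩ Ω′_k`). [cite: Balaban1985BackgroundPropagators, (3.154) p.427 («Ω = Ω_k ∩ Ω′_k»)] -/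
theorem OmegaC_comm : OmegaC D D' = OmegaC D' D := by
  ext β
  rw [mem_OmegaC_iff_exists, mem_OmegaC_iff_exists]
  constructor
  · rintro ⟨x, hβ, hx⟩
    exact ⟨x, hβ, fun h => hx ⟨h.2, h.1⟩⟩
  · rintro ⟨x, hβ, hx⟩
    exact ⟨x, hβ, fun h => hx ⟨h.2, h.1⟩⟩

/-- hence `d(y, y′, Ω)` computed for `(Ω′, Ω)` equals the one for `(Ω, Ω′)`. [cite: Balaban1985BackgroundPropagators, (3.154) p.427] -/
theorem dOmega_swap (β β' : Fin (d + 1) → ℤ) : dOmega D' D β β' = dOmega D D' β β' := by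
  unfold dOmega
  rw [OmegaC_comm D' D]

end Swap

/-! ## §6  Row sums of a kernel over a block from a sup bound on block-supported test functions -/

section RowSum

variable {S : Type} [DecidableEq S] {X : Type} [Fintype X] [DecidableEq X]

/-- **ROW SUMS FROM A SUP BOUND** (pointwise form of p22's `rowSum_le_of_hasMajorant`): if `|(Tμ)(x)| ≤ K·B` for every `μ` supported in the block
`Δ(y′)` with `|μ| ≤ B` (`B ≥ 0`), then `Σ_{x′ ∈ Δ(y′)} |T(x, x′)| ≤ K` (test against the sign pattern of the row `x`).
[cite: Balaban1984PropagatorsII, (2.51)–(2.52) p.232 (operators and their kernels; derivation ours)] -/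
theorem rowSum_le_of_blockBound (blk : X → S) (T : Module.End ℝ (X → ℝ)) (y' : S) (x : X) {K : ℝ}
    (h : ∀ (μ : X → ℝ) (B : ℝ), 0 ≤ B → (∀ x', blk x' = y' → |μ x'| ≤ B) → (∀ x', blk x' ≠ y' → μ x' = 0) → |T μ x| ≤ K * B) :
    ∑ x' ∈ univ.filter (fun x' => blk x' = y'), |T (Pi.single x' 1) x| ≤ K := by
  set μ : X → ℝ := fun x' => if blk x' = y' then (if 0 ≤ T (Pi.single x' 1) x then 1 else -1) else 0 with hμ
  have hμ_in : ∀ x', blk x' = y' → μ x' * T (Pi.single x' 1) x = |T (Pi.single x' 1) x| ∧ |μ x'| ≤ 1 := by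
    intro x' hx'
    by_cases h0 : 0 ≤ T (Pi.single x' 1) x
    · have hval : μ x' = 1 := by simp only [hμ, hx', h0, if_true]
      rw [hval, one_mul, abs_of_nonneg h0, abs_one]
      exact ⟨rfl, le_rfl⟩
    · have hval : μ x' = -1 := by simp only [hμ, hx', h0, if_true, if_false]
      rw [hval, neg_one_mul, abs_of_neg (lt_of_not_ge h0), abs_neg, abs_one]
      exact ⟨rfl, le_rfl⟩
  have hμ_out : ∀ x', blk x' ≠ y' → μ x' = 0 := fun x' hx' => by simp only [hμ, hx', if_false]
  have h1 := h μ 1 zero_le_one (fun x' hx' => (hμ_in x' hx').2) hμ_out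
  rw [mul_one] at h1
  have hexp : T μ x = ∑ x' ∈ univ.filter (fun x' => blk x' = y'), |T (Pi.single x' 1) x| := by
    rw [apply_eq_sum_single, Finset.sum_filter]
    refine Finset.sum_congr rfl fun x' _ => ?_
    by_cases hx' : blk x' = y'
    · rw [if_pos hx', (hμ_in x' hx').1]
    · rw [if_neg hx', hμ_out x' hx', zero_mul]
  rw [← hexp]
  exact (le_abs_self _).trans h1

end RowSum

/-! ## §7  THEOREM 3.14 AT `U = 1`: the `L²` member (2.140)₁ for `G = Δ_a⁻¹` -/

section L2

variable {ℓ : ℕ} {m K : ℕ} {hd : 1 ≤ d + 1} {hL : Odd (ℓ + 1) ∧ 1 < ℓ + 1}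
variable {Mh k R : ℕ} {P' : Fin (d + 1) → ℕ}

/-- `pref` on a top block is `(L^k/c_f)²`. [cite: Balaban1984PropagatorsII, (2.136) p.247, bookkeeping] -/
theorem pref_of_top (D₀ : TDomains d ℓ Mh k P' R) (cf : ℝ) {y : ↥(bset D₀.toDomains)} (hy : y.1.1 = k) :
    pref cf y = ((((ℓ + 1 : ℕ) : ℝ)) ^ k / cf) ^ 2 := by
  unfold pref
  rw [hy]

/-- **THEOREM 3.14 AT `U = 1` — THE `L²` MEMBER (2.140)₁ WITH THE FACTOR (3.154) FOR THE GENUINE `k`-LEVEL `G = Δ_a⁻¹` OF TWO NESTED FAMILIES ON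
THE V1 TORUS**: `Σ_x (ζ(x)((G[Ω] − G[Ω′])J)(x))² ≤ (C·(L^k/c_f)²·e^{−δ·min(d(y,y′),d′(y,y′))}·e^{−δ·d(y,y′,Ω)}·s)²·Σ_x J(x)²` for `supp ζ ⊂ B(y)`,
`|ζ| ≤ s`, `supp J ⊂ B′(y′)`, `y, y′ ∈ Ω^{(k)}` common top blocks (Schur's test on FILE 2's sup member in both orders of the families).
[cite: Balaban1985BackgroundPropagators, Thm 3.14 (3.153)–(3.154) pp.426–427; Balaban1984PropagatorsII, Prop. 2.6 (2.140) p.247, (2.136) p.247] -/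
theorem thm314_G_l2_flat_V1 (d ℓ : ℕ) (hd : 1 ≤ d + 1) (hL : Odd (ℓ + 1) ∧ 1 < ℓ + 1) {b₀ b₁ : ℝ} (hb₀ : 0 < b₀) (hb₁ : b₀ ≤ b₁) :
    ∃ δ C M₀ : ℝ, ∃ N₀ : ℕ, 0 < δ ∧ 0 < C ∧ 0 < M₀ ∧ 0 < N₀ ∧
      ∀ (m K : ℕ) {Mh k R : ℕ} {P' : Fin (d + 1) → ℕ}
        (hN : ∀ μ, N0 ℓ Mh k P' μ = (PV d ℓ m K hd hL).sitesPerDir 0) (D D' : TDomains d ℓ Mh k P' R) (hk : k ≤ m + K),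
        1 ≤ k → ∀ {a : ℕ}, Mh = (ℓ + 1) ^ a → 8 ≤ Mh → 2 * (ℓ + 1) ^ 2 ≤ R → (∀ μ, 5 * (ℓ + 1) ≤ P' μ) → 4 ≤ ℓ →
        M₀ ≤ ((ℓ : ℝ) + 1) * Mh → N₀ + 1 ≤ R * ((ℓ + 1) * Mh) →
        ∀ {cf : ℝ} (hcf : cf ≠ 0) {w : BondIdx (domT hN D hk) → ℝ} (hw : ∀ i, 0 < w i)
          {w' : BondIdx (domT hN D' hk) → ℝ} (hw' : ∀ i', 0 < w' i'),
        GlobalBand b₀ b₁ cf w → GlobalBand b₀ b₁ cf w' →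
        (∀ (i : BondIdx (domT hN D hk)) (i' : BondIdx (domT hN D' hk)), i.1 = i'.1 → w i = w' i') →
        ∀ (y : ↥(bset D.toDomains)) (hyD' : y.1 ∈ bset D'.toDomains) (y' : ↥(bset D'.toDomains)) (hy'D : y'.1 ∈ bset D.toDomains),
        y.1.1 = k → y'.1.1 = k →
        ∀ (ζ J : PBond (PV d ℓ m K hd hL) 0 → ℝ) (s : ℝ), (∀ x, blkV1 hN D x ≠ y → ζ x = 0) → (∀ x, |ζ x| ≤ s) →
        (∀ x, blkV1 hN D' x ≠ y' → J x = 0) →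
          ∑ x, (ζ x * (onFun (GE (domT hN D hk) hcf hw) J x - onFun (GE (domT hN D' hk) hcf hw') J x)) ^ 2
            ≤ (C * pref cf y
                * Real.exp (-(δ * min ((geomT D).dist y ⟨y'.1, hy'D⟩) ((geomT D').dist ⟨y.1, hyD'⟩ y')))
                * Real.exp (-(δ * dOmega D D' y.1.2 y'.1.2)) * s) ^ 2 * ∑ x, J x ^ 2 := by
  obtain ⟨δ, C, M₀, N₀, hδ, hC, hM₀, hN₀, hmain⟩ := thm314_G_flat_V1 d ℓ hd hL hb₀ hb₁
  refine ⟨δ, C, M₀, N₀, hδ, hC, hM₀, hN₀, ?_⟩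
  intro m K Mh k R P' hN D D' hk hk1 a hMha hM8 hR2 hP5 hℓ4 hM hRN cf hcf w hw w' hw' hwb hwb' hww y hyD' y' hy'D hy hy' ζ J s hζ hζs hJ
  have hMh1 : 1 ≤ Mh := by omega
  have hP1 : ∀ μ, 1 ≤ P' μ := fun μ => le_trans (by omega) (hP5 μ)
  have hd0 : ∀ u t : ↥(bset D.toDomains), 0 ≤ (geomT D).dist u t := (triangle_refl_nonneg_T D hMh1 hP1).2.2
  have hd0' : ∀ u t : ↥(bset D'.toDomains), 0 ≤ (geomT D').dist u t := (triangle_refl_nonneg_T D' hMh1 hP1).2.2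
  -- the operator and the common constant of the block pair
  set T : Module.End ℝ (PBond (PV d ℓ m K hd hL) 0 → ℝ) := onFun (GE (domT hN D hk) hcf hw) - onFun (GE (domT hN D' hk) hcf hw') with hT
  set Kc : ℝ := C * pref cf y * Real.exp (-(δ * min ((geomT D).dist y ⟨y'.1, hy'D⟩) ((geomT D').dist ⟨y.1, hyD'⟩ y')))
    * Real.exp (-(δ * dOmega D D' y.1.2 y'.1.2)) with hKc
  have hKc0 : 0 ≤ Kc :=
    mul_nonneg (mul_nonneg (mul_nonneg hC.le (pref_nonneg _ _)) (Real.exp_pos _).le) (Real.exp_pos _).le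
  -- rows: FILE 2's sup member for `(Ω, Ω′)`
  have hrowB : ∀ x : PBond (PV d ℓ m K hd hL) 0, blkV1 hN D x = y →
      ∀ (μ : PBond (PV d ℓ m K hd hL) 0 → ℝ) (B : ℝ), 0 ≤ B → (∀ x', blkV1 hN D' x' = y' → |μ x'| ≤ B) →
        (∀ x', blkV1 hN D' x' ≠ y' → μ x' = 0) → |T μ x| ≤ Kc * B := by
    intro x hx μ B hB hbd hoff
    have hμ : BlockSupp (g := geomT D') (blkV1 hN D') μ y' B := ⟨hB, hbd, hoff⟩
    have h := hmain m K hN D D' hk hk1 hMha hM8 hR2 hP5 hℓ4 hM hRN hcf hw hw' hwb hwb' hww y hyD' y' hy'D hy hy' μ B hμ x hx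
    have e : T μ x = onFun (GE (domT hN D hk) hcf hw) μ x - onFun (GE (domT hN D' hk) hcf hw') μ x := by
      rw [hT, LinearMap.sub_apply, Pi.sub_apply]
    rw [e]
    refine h.trans (le_of_eq ?_)
    rw [hKc]; ring
  -- columns: FILE 2's sup member for `(Ω′, Ω)` with `y, y′` exchanged, and the symmetry of the two kernels
  have hpref : pref cf (D := D') y' = pref cf y := by
    rw [pref_of_top D' cf hy', pref_of_top D cf hy]
  have hmin : min ((geomT D').dist y' ⟨y.1, hyD'⟩) ((geomT D).dist ⟨y'.1, hy'D⟩ y)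
      = min ((geomT D).dist y ⟨y'.1, hy'D⟩) ((geomT D').dist ⟨y.1, hyD'⟩ y') := by
    rw [symmT D' y' ⟨y.1, hyD'⟩, symmT D ⟨y'.1, hy'D⟩ y, min_comm]
  have hΩ : dOmega D' D y'.1.2 y.1.2 = dOmega D D' y.1.2 y'.1.2 := by
    rw [dOmega_swap D D', dOmega_comm D D']
  have hcolB : ∀ x' : PBond (PV d ℓ m K hd hL) 0, blkV1 hN D' x' = y' →
      ∀ (μ : PBond (PV d ℓ m K hd hL) 0 → ℝ) (B : ℝ), 0 ≤ B → (∀ x, blkV1 hN D x = y → |μ x| ≤ B) →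
        (∀ x, blkV1 hN D x ≠ y → μ x = 0) → |T μ x'| ≤ Kc * B := by
    intro x' hx' μ B hB hbd hoff
    have hμ : BlockSupp (g := geomT D) (blkV1 hN D) μ y B := ⟨hB, hbd, hoff⟩
    have h := hmain m K hN D' D hk hk1 hMha hM8 hR2 hP5 hℓ4 hM hRN hcf hw' hw hwb' hwb (fun i' i h => (hww i i' h.symm).symm)
      y' hy'D y hyD' hy' hy μ B hμ x' hx'
    have e : T μ x' = onFun (GE (domT hN D hk) hcf hw) μ x' - onFun (GE (domT hN D' hk) hcf hw') μ x' := by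
      rw [hT, LinearMap.sub_apply, Pi.sub_apply]
    rw [e, abs_sub_comm]
    refine h.trans (le_of_eq ?_)
    rw [hpref, hmin, hΩ, hKc]; ring
  -- the kernel of `T` truncated to `B(y) × B′(y′)`; it is symmetric (both `G[Ω]`, `G[Ω′]` are self-adjoint)
  set Tk : PBond (PV d ℓ m K hd hL) 0 → PBond (PV d ℓ m K hd hL) 0 → ℝ :=
    fun x x' => if blkV1 hN D x = y ∧ blkV1 hN D' x' = y' then T (Pi.single x' 1) x else 0 with hTk
  have hsymm : ∀ x x' : PBond (PV d ℓ m K hd hL) 0, T (Pi.single x' 1) x = T (Pi.single x 1) x' := by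
    intro x x'
    rw [hT, LinearMap.sub_apply, Pi.sub_apply, LinearMap.sub_apply, Pi.sub_apply,
      onFun_GE_single_symm (domT hN D hk) hcf hw x' x, onFun_GE_single_symm (domT hN D' hk) hcf hw' x' x]
  have hrow : ∀ x, ∑ x', |Tk x x'| ≤ Kc := by
    intro x
    by_cases hx : blkV1 hN D x = y
    · calc ∑ x', |Tk x x'| = ∑ x' ∈ univ.filter (fun x' => blkV1 hN D' x' = y'), |T (Pi.single x' 1) x| := by
            rw [Finset.sum_filter]
            refine Finset.sum_congr rfl fun x' _ => ?_
            by_cases hx' : blkV1 hN D' x' = y' <;> simp [hTk, hx, hx']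
        _ ≤ Kc := rowSum_le_of_blockBound (blkV1 hN D') T y' x (hrowB x hx)
    · have h0 : ∑ x', |Tk x x'| = 0 := Finset.sum_eq_zero fun x' _ => by simp [hTk, hx]
      rw [h0]
      exact hKc0
  have hcol : ∀ x', ∑ x, |Tk x x'| ≤ Kc := by
    intro x'
    by_cases hx' : blkV1 hN D' x' = y'
    · calc ∑ x, |Tk x x'| = ∑ x ∈ univ.filter (fun x => blkV1 hN D x = y), |T (Pi.single x 1) x'| := by
            rw [Finset.sum_filter]
            refine Finset.sum_congr rfl fun x _ => ?_
            by_cases hx : blkV1 hN D x = y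
            · rw [if_pos hx, ← hsymm x x']
              simp [hTk, hx, hx']
            · simp [hTk, hx]
        _ ≤ Kc := rowSum_le_of_blockBound (blkV1 hN D) T y x' (hcolB x' hx')
    · have h0 : ∑ x, |Tk x x'| = 0 := Finset.sum_eq_zero fun x _ => by simp [hTk, hx']
      rw [h0]
      exact hKc0
  -- on the rows of `B(y)`, `(TJ)(x) = Σ_{x′} Tk(x,x′)J(x′)` since `J` vanishes off `B′(y′)`
  have hTJ : ∀ x, blkV1 hN D x = y → T J x = ∑ x', Tk x x' * J x' := by
    intro x hx
    rw [apply_eq_sum_single]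
    refine Finset.sum_congr rfl fun x' _ => ?_
    by_cases hx' : blkV1 hN D' x' = y'
    · simp [hTk, hx, hx', mul_comm]
    · rw [hJ x' hx']
      simp [hTk, hx']
  have hs2 : ∀ x, ζ x ^ 2 ≤ s ^ 2 := fun x => by
    rw [← sq_abs (ζ x)]
    exact pow_le_pow_left₀ (abs_nonneg _) (hζs x) 2
  have hpt : ∀ x, (ζ x * T J x) ^ 2 ≤ s ^ 2 * (∑ x', Tk x x' * J x') ^ 2 := by
    intro x
    by_cases hx : blkV1 hN D x = y
    · rw [hTJ x hx, mul_pow]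
      exact mul_le_mul_of_nonneg_right (hs2 x) (sq_nonneg _)
    · rw [hζ x hx, zero_mul, zero_pow two_ne_zero]
      exact mul_nonneg (sq_nonneg _) (sq_nonneg _)
  have hS := sum_sq_le_abs Tk J hKc0 hrow hcol
  have e : ∀ x, ζ x * (onFun (GE (domT hN D hk) hcf hw) J x - onFun (GE (domT hN D' hk) hcf hw') J x) = ζ x * T J x := by
    intro x
    rw [hT, LinearMap.sub_apply, Pi.sub_apply]
  calc ∑ x, (ζ x * (onFun (GE (domT hN D hk) hcf hw) J x - onFun (GE (domT hN D' hk) hcf hw') J x)) ^ 2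
      = ∑ x, (ζ x * T J x) ^ 2 := Finset.sum_congr rfl fun x _ => by rw [e x]
    _ ≤ ∑ x, s ^ 2 * (∑ x', Tk x x' * J x') ^ 2 := Finset.sum_le_sum fun x _ => hpt x
    _ = s ^ 2 * ∑ x, (∑ x', Tk x x' * J x') ^ 2 := by rw [Finset.mul_sum]
    _ ≤ s ^ 2 * (Kc * Kc * ∑ x', J x' ^ 2) := mul_le_mul_of_nonneg_left hS (sq_nonneg _)
    _ = (Kc * s) ^ 2 * ∑ x, J x ^ 2 := by ring
    _ = _ := by rw [hKc]

end L2


/-! ## §8  Schur's test on one block pair for an operator and its transpose, two block maps -/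

section Schur

variable {S S' X : Type} [DecidableEq S] [DecidableEq S'] [Fintype X] [DecidableEq X]

/-- **SCHUR'S TEST ON ONE BLOCK PAIR, OPERATOR AND TRANSPOSE**: rows of `T` on `Δ(y) × Δ′(y′)` bounded by `K`, rows of `Tᵗ` on `Δ′(y′) × Δ(y)` bounded by
`K′` (both from sup bounds on block-supported test functions) give `Σ_x (ζ(x)(TJ)(x))² ≤ s²KK′·Σ_x J(x)²`.
[cite: Balaban1984PropagatorsII, Prop. 2.6 (2.140) p.247 (shape); (2.51)–(2.52) p.232; derivation ours (Schur test)] -/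
theorem sum_sq_le_of_blockBounds (blk : X → S) (blk' : X → S') (T Tt : Module.End ℝ (X → ℝ)) (y : S) (y' : S') {K K' : ℝ}
    (hK : 0 ≤ K) (hK' : 0 ≤ K') (htr : ∀ x x', Tt (Pi.single x 1) x' = T (Pi.single x' 1) x)
    (hrow : ∀ x, blk x = y → ∀ (μ : X → ℝ) (B : ℝ), 0 ≤ B → (∀ x', blk' x' = y' → |μ x'| ≤ B) → (∀ x', blk' x' ≠ y' → μ x' = 0) →
      |T μ x| ≤ K * B)
    (hcol : ∀ x', blk' x' = y' → ∀ (μ : X → ℝ) (B : ℝ), 0 ≤ B → (∀ x, blk x = y → |μ x| ≤ B) → (∀ x, blk x ≠ y → μ x = 0) →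
      |Tt μ x'| ≤ K' * B)
    (ζ J : X → ℝ) {s : ℝ} (hζ : ∀ x, blk x ≠ y → ζ x = 0) (hζs : ∀ x, |ζ x| ≤ s) (hJ : ∀ x, blk' x ≠ y' → J x = 0) :
    ∑ x, (ζ x * T J x) ^ 2 ≤ s ^ 2 * (K * K') * ∑ x, J x ^ 2 := by
  set Tk : X → X → ℝ := fun x x' => if blk x = y ∧ blk' x' = y' then T (Pi.single x' 1) x else 0 with hTk
  have hr : ∀ x, ∑ x', |Tk x x'| ≤ K := by
    intro x
    by_cases hx : blk x = y
    · calc ∑ x', |Tk x x'| = ∑ x' ∈ univ.filter (fun x' => blk' x' = y'), |T (Pi.single x' 1) x| := by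
            rw [Finset.sum_filter]
            refine Finset.sum_congr rfl fun x' _ => ?_
            by_cases hx' : blk' x' = y' <;> simp [hTk, hx, hx']
        _ ≤ K := rowSum_le_of_blockBound blk' T y' x (hrow x hx)
    · have h0 : ∑ x', |Tk x x'| = 0 := Finset.sum_eq_zero fun x' _ => by simp [hTk, hx]
      rw [h0]
      exact hK
  have hc : ∀ x', ∑ x, |Tk x x'| ≤ K' := by
    intro x'
    by_cases hx' : blk' x' = y'
    · calc ∑ x, |Tk x x'| = ∑ x ∈ univ.filter (fun x => blk x = y), |Tt (Pi.single x 1) x'| := by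
            rw [Finset.sum_filter]
            refine Finset.sum_congr rfl fun x _ => ?_
            by_cases hx : blk x = y
            · rw [if_pos hx, htr x x']
              simp [hTk, hx, hx']
            · simp [hTk, hx]
        _ ≤ K' := rowSum_le_of_blockBound blk Tt y x' (hcol x' hx')
    · have h0 : ∑ x, |Tk x x'| = 0 := Finset.sum_eq_zero fun x _ => by simp [hTk, hx']
      rw [h0]
      exact hK'
  have hTJ : ∀ x, blk x = y → T J x = ∑ x', Tk x x' * J x' := by
    intro x hx
    rw [B6RandomWalkKernel.apply_eq_sum_single]
    refine Finset.sum_congr rfl fun x' _ => ?_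
    by_cases hx' : blk' x' = y'
    · simp [hTk, hx, hx', mul_comm]
    · rw [hJ x' hx']
      simp [hTk, hx']
  have hs2 : ∀ x, ζ x ^ 2 ≤ s ^ 2 := fun x => by
    rw [← sq_abs (ζ x)]
    exact pow_le_pow_left₀ (abs_nonneg _) (hζs x) 2
  have hpt : ∀ x, (ζ x * T J x) ^ 2 ≤ s ^ 2 * (∑ x', Tk x x' * J x') ^ 2 := by
    intro x
    by_cases hx : blk x = y
    · rw [hTJ x hx, mul_pow]
      exact mul_le_mul_of_nonneg_right (hs2 x) (sq_nonneg _)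
    · rw [hζ x hx, zero_mul, zero_pow two_ne_zero]
      exact mul_nonneg (sq_nonneg _) (sq_nonneg _)
  have hS := sum_sq_le_abs Tk J hK hr hc
  calc ∑ x, (ζ x * T J x) ^ 2 ≤ ∑ x, s ^ 2 * (∑ x', Tk x x' * J x') ^ 2 := Finset.sum_le_sum fun x _ => hpt x
    _ = s ^ 2 * ∑ x, (∑ x', Tk x x' * J x') ^ 2 := by rw [Finset.mul_sum]
    _ ≤ s ^ 2 * (K * K' * ∑ x', J x' ^ 2) := mul_le_mul_of_nonneg_left hS (sq_nonneg _)
    _ = s ^ 2 * (K * K') * ∑ x, J x ^ 2 := by ring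

end Schur

/-! ## §9  THEOREM 3.14 AT `U = 1`: the `L²` members (2.140)₂ (`∇G`) and (2.140)₃ (`G∇*`) for `G = Δ_a⁻¹`, modulo the (2.136)₃ majorants -/

section Members

variable {ℓ : ℕ} {m K : ℕ} {hd : 1 ≤ d + 1} {hL : Odd (ℓ + 1) ∧ 1 < ℓ + 1}
variable {Mh k R : ℕ} {P' : Fin (d + 1) → ℕ}

/-- the linear prefactor on a top block is `L^k·|c_f|⁻¹` in both families. [cite: Balaban1984PropagatorsII, (2.136) p.247, bookkeeping] -/
theorem len_of_top (D₀ : TDomains d ℓ Mh k P' R) {y : ↥(bset D₀.toDomains)} (hy : y.1.1 = k) :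
    (geomT D₀).len y = ((ℓ : ℝ) + 1) ^ k := by
  rw [geomT_len, mul_one, hy]

/-- **THEOREM 3.14 AT `U = 1` — THE `L²` MEMBER (2.140)₂ (`∇G`) WITH THE FACTOR (3.154) FOR THE GENUINE `k`-LEVEL `G = Δ_a⁻¹`, MODULO THE ONE-FAMILY
(2.136)₃ MAJORANTS**: `Σ_x (ζ(x)(∇_ν(G[Ω] − G[Ω′])J)(x))² ≤ (C·(L^k|c_f|⁻¹)·e^{−δ·min(d(y,y′),d′(y,y′))}·e^{−δ·d(y,y′,Ω)}·s)²·Σ_x J(x)²` for `supp ζ ⊂ B(y)`,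
`|ζ| ≤ s`, `supp J ⊂ B′(y′)`, `y, y′ ∈ Ω^{(k)}` common top blocks (rows: FILE 2's `thm314_gradG_flat_V1`; columns: the transpose `(G − G′)∇*_ν` bounded by
FILE 4's member for the exchanged families).
[cite: Balaban1985BackgroundPropagators, Thm 3.14 (3.153)–(3.154) pp.426–427; Balaban1984PropagatorsII, Prop. 2.6 (2.140) p.247, (2.136) p.247] -/
theorem thm314_gradG_l2_flat_V1_of_majorants (d ℓ : ℕ) (hd : 1 ≤ d + 1) (hL : Odd (ℓ + 1) ∧ 1 < ℓ + 1) {b₀ b₁ : ℝ} (hb₀ : 0 < b₀)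
    (hb₁ : b₀ ≤ b₁) {A₃ δ₃ : ℝ} (hA₃ : 0 ≤ A₃) (hδ₃ : 0 < δ₃) :
    ∃ δ C M₀ : ℝ, ∃ N₀ : ℕ, 0 < δ ∧ 0 < C ∧ 0 < M₀ ∧ 0 < N₀ ∧
      ∀ (m K : ℕ) {Mh k R : ℕ} {P' : Fin (d + 1) → ℕ}
        (hN : ∀ μ, N0 ℓ Mh k P' μ = (PV d ℓ m K hd hL).sitesPerDir 0) (D D' : TDomains d ℓ Mh k P' R) (hk : k ≤ m + K),
        1 ≤ k → ∀ {a : ℕ}, Mh = (ℓ + 1) ^ a → 8 ≤ Mh → 2 * (ℓ + 1) ^ 2 ≤ R → (∀ μ, 5 * (ℓ + 1) ≤ P' μ) → 4 ≤ ℓ →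
        M₀ ≤ ((ℓ : ℝ) + 1) * Mh → N₀ + 1 ≤ R * ((ℓ + 1) * Mh) →
        ∀ {cf : ℝ} (hcf : cf ≠ 0) {w : BondIdx (domT hN D hk) → ℝ} (hw : ∀ i, 0 < w i)
          {w' : BondIdx (domT hN D' hk) → ℝ} (hw' : ∀ i', 0 < w' i'),
        GlobalBand b₀ b₁ cf w → GlobalBand b₀ b₁ cf w' →
        (∀ (i : BondIdx (domT hN D hk)) (i' : BondIdx (domT hN D' hk)), i.1 = i'.1 → w i = w' i') →
        ∀ (ν : Fin (d + 1)),
        HasMajorant (g := geomT D) (blkV1 hN D) (onFun (GE (domT hN D hk) hcf hw) * DVa ν cf)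
          (fun a b => A₃ * ((geomT D).len a * |cf|⁻¹) * Real.exp (-(δ₃ * (geomT D).dist a b))) →
        HasMajorant (g := geomT D') (blkV1 hN D') (onFun (GE (domT hN D' hk) hcf hw') * DVa ν cf)
          (fun a b => A₃ * ((geomT D').len a * |cf|⁻¹) * Real.exp (-(δ₃ * (geomT D').dist a b))) →
        ∀ (y : ↥(bset D.toDomains)) (hyD' : y.1 ∈ bset D'.toDomains) (y' : ↥(bset D'.toDomains)) (hy'D : y'.1 ∈ bset D.toDomains),
        y.1.1 = k → y'.1.1 = k →
        ∀ (ζ J : PBond (PV d ℓ m K hd hL) 0 → ℝ) (s : ℝ), (∀ x, blkV1 hN D x ≠ y → ζ x = 0) → (∀ x, |ζ x| ≤ s) →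
        (∀ x, blkV1 hN D' x ≠ y' → J x = 0) →
          ∑ x, (ζ x * ((DV ν cf ∘ₗ onFun (GE (domT hN D hk) hcf hw)) J x - (DV ν cf ∘ₗ onFun (GE (domT hN D' hk) hcf hw')) J x)) ^ 2
            ≤ (C * (((ℓ : ℝ) + 1) ^ k * |cf|⁻¹)
                * Real.exp (-(δ * min ((geomT D).dist y ⟨y'.1, hy'D⟩) ((geomT D').dist ⟨y.1, hyD'⟩ y')))
                * Real.exp (-(δ * dOmega D D' y.1.2 y'.1.2)) * s) ^ 2 * ∑ x, J x ^ 2 := by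
  obtain ⟨δ₂, C₂, M₂, N₂, hδ₂, hC₂, hM₂, hN₂, h2⟩ := thm314_gradG_flat_V1 d ℓ hd hL hb₀ hb₁
  obtain ⟨δ₁, C₁, M₁, N₁, hδ₁, hC₁, hM₁, hN₁, h1⟩ := thm314_Gdiv_flat_V1_of_majorants d ℓ hd hL hb₀ hb₁ hA₃ hδ₃
  refine ⟨min δ₂ δ₁, Real.sqrt (C₂ * C₁), max M₂ M₁, max N₂ N₁, lt_min hδ₂ hδ₁, Real.sqrt_pos.2 (mul_pos hC₂ hC₁),
    lt_max_of_lt_left hM₂, lt_max_of_lt_left hN₂, ?_⟩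
  intro m K Mh k R P' hN D D' hk hk1 a hMha hM8 hR2 hP5 hℓ4 hM hRN cf hcf w hw w' hw' hwb hwb' hww ν hT3 hT3' y hyD' y' hy'D hy hy' ζ J s hζ hζs hJ
  have hMh1 : 1 ≤ Mh := by omega
  have hP1 : ∀ μ, 1 ≤ P' μ := fun μ => le_trans (by omega) (hP5 μ)
  have hκ0 : 0 ≤ ((ℓ : ℝ) + 1) ^ k * |cf|⁻¹ := by positivity
  have hd0 : ∀ u t : ↥(bset D.toDomains), 0 ≤ (geomT D).dist u t := (triangle_refl_nonneg_T D hMh1 hP1).2.2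
  have hd0' : ∀ u t : ↥(bset D'.toDomains), 0 ≤ (geomT D').dist u t := (triangle_refl_nonneg_T D' hMh1 hP1).2.2
  have hM2 : M₂ ≤ ((ℓ : ℝ) + 1) * Mh := (le_max_left _ _).trans hM
  have hM1 : M₁ ≤ ((ℓ : ℝ) + 1) * Mh := (le_max_right _ _).trans hM
  have hN2 : N₂ + 1 ≤ R * ((ℓ + 1) * Mh) := le_trans (Nat.succ_le_succ (le_max_left _ _)) hRN
  have hN1 : N₁ + 1 ≤ R * ((ℓ + 1) * Mh) := le_trans (Nat.succ_le_succ (le_max_right _ _)) hRN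
  have hww' : ∀ (i' : BondIdx (domT hN D' hk)) (i : BondIdx (domT hN D hk)), i'.1 = i.1 → w' i' = w i :=
    fun i' i h => (hww i i' h.symm).symm
  -- the two decay factors and their symmetric forms
  set m₀ : ℝ := min ((geomT D).dist y ⟨y'.1, hy'D⟩) ((geomT D').dist ⟨y.1, hyD'⟩ y') with hm₀
  have hm₀0 : 0 ≤ m₀ := le_min (hd0 _ _) (hd0' _ _)
  have hmin : min ((geomT D').dist y' ⟨y.1, hyD'⟩) ((geomT D).dist ⟨y'.1, hy'D⟩ y) = m₀ := by
    rw [hm₀, symmT D' y' ⟨y.1, hyD'⟩, symmT D ⟨y'.1, hy'D⟩ y, min_comm]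
  have hΩ : dOmega D' D y'.1.2 y.1.2 = dOmega D D' y.1.2 y'.1.2 := by rw [dOmega_swap D D', dOmega_comm D D']
  have hleny : (geomT D).len y = ((ℓ : ℝ) + 1) ^ k := len_of_top D hy
  have hleny' : (geomT D').len y' = ((ℓ : ℝ) + 1) ^ k := len_of_top D' hy'
  -- weakening the two rates to `min δ₂ δ₁`
  have hE : ∀ {ρ : ℝ}, min δ₂ δ₁ ≤ ρ → ∀ {t : ℝ}, 0 ≤ t → Real.exp (-(ρ * t)) ≤ Real.exp (-(min δ₂ δ₁ * t)) :=
    fun hρ t ht => Real.exp_le_exp.2 (neg_le_neg (mul_le_mul_of_nonneg_right hρ ht))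
  set E : ℝ := Real.exp (-(min δ₂ δ₁ * m₀)) * Real.exp (-(min δ₂ δ₁ * dOmega D D' y.1.2 y'.1.2)) with hEdef
  have hE0 : 0 ≤ E := mul_nonneg (Real.exp_pos _).le (Real.exp_pos _).le
  have hE2 : Real.exp (-(δ₂ * m₀)) * Real.exp (-(δ₂ * dOmega D D' y.1.2 y'.1.2)) ≤ E :=
    mul_le_mul (hE (min_le_left _ _) hm₀0) (hE (min_le_left _ _) (B9Thm314GpFlatTorusGeometry.dOmega_nonneg D D' _ _))
      (Real.exp_pos _).le (Real.exp_pos _).le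
  have hE1 : Real.exp (-(δ₁ * m₀)) * Real.exp (-(δ₁ * dOmega D D' y.1.2 y'.1.2)) ≤ E :=
    mul_le_mul (hE (min_le_right _ _) hm₀0) (hE (min_le_right _ _) (B9Thm314GpFlatTorusGeometry.dOmega_nonneg D D' _ _))
      (Real.exp_pos _).le (Real.exp_pos _).le
  -- rows: FILE 2's (2.136)₂ member for `(Ω, Ω′)`
  set T : Module.End ℝ (PBond (PV d ℓ m K hd hL) 0 → ℝ) :=
    DV ν cf ∘ₗ onFun (GE (domT hN D hk) hcf hw) - DV ν cf ∘ₗ onFun (GE (domT hN D' hk) hcf hw') with hT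
  have hrow : ∀ x : PBond (PV d ℓ m K hd hL) 0, blkV1 hN D x = y →
      ∀ (μ : PBond (PV d ℓ m K hd hL) 0 → ℝ) (B : ℝ), 0 ≤ B → (∀ x', blkV1 hN D' x' = y' → |μ x'| ≤ B) →
        (∀ x', blkV1 hN D' x' ≠ y' → μ x' = 0) → |T μ x| ≤ (C₂ * (((ℓ : ℝ) + 1) ^ k * |cf|⁻¹) * E) * B := by
    intro x hx μ B hB hbd hoff
    have hμ : BlockSupp (g := geomT D') (blkV1 hN D') μ y' B := ⟨hB, hbd, hoff⟩
    have h := h2 m K hN D D' hk hk1 hMha hM8 hR2 hP5 hℓ4 hM2 hN2 hcf hw hw' hwb hwb' hww y hyD' y' hy'D hy hy' μ B hμ ν x hx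
    have e : T μ x = (DV ν cf ∘ₗ onFun (GE (domT hN D hk) hcf hw)) μ x - (DV ν cf ∘ₗ onFun (GE (domT hN D' hk) hcf hw')) μ x := by
      rw [hT, LinearMap.sub_apply, Pi.sub_apply]
    rw [e]
    refine h.trans ?_
    rw [hleny, ← hm₀]
    calc C₂ * (((ℓ : ℝ) + 1) ^ k * |cf|⁻¹ * B) * Real.exp (-(δ₂ * m₀)) * Real.exp (-(δ₂ * dOmega D D' y.1.2 y'.1.2))
        = C₂ * (((ℓ : ℝ) + 1) ^ k * |cf|⁻¹) * B * (Real.exp (-(δ₂ * m₀)) * Real.exp (-(δ₂ * dOmega D D' y.1.2 y'.1.2))) := by ring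
      _ ≤ C₂ * (((ℓ : ℝ) + 1) ^ k * |cf|⁻¹) * B * E := mul_le_mul_of_nonneg_left hE2 (mul_nonneg (mul_nonneg hC₂.le hκ0) hB)
      _ = _ := by ring
  -- columns: the transpose `(G − G′)∇*_ν`, FILE 4's member for `(Ω′, Ω)`
  set Tt : Module.End ℝ (PBond (PV d ℓ m K hd hL) 0 → ℝ) :=
    onFun (GE (domT hN D hk) hcf hw) * DVa ν cf - onFun (GE (domT hN D' hk) hcf hw') * DVa ν cf with hTt
  have htr : ∀ x x' : PBond (PV d ℓ m K hd hL) 0, Tt (Pi.single x 1) x' = T (Pi.single x' 1) x := by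
    intro x x'
    rw [hTt, hT, LinearMap.sub_apply, Pi.sub_apply, LinearMap.sub_apply, Pi.sub_apply, Module.End.mul_eq_comp, Module.End.mul_eq_comp,
      onFun_GE_DVa_single_transpose (domT hN D hk) hcf hw ν cf x x', onFun_GE_DVa_single_transpose (domT hN D' hk) hcf hw' ν cf x x']
  have hcol : ∀ x' : PBond (PV d ℓ m K hd hL) 0, blkV1 hN D' x' = y' →
      ∀ (μ : PBond (PV d ℓ m K hd hL) 0 → ℝ) (B : ℝ), 0 ≤ B → (∀ x, blkV1 hN D x = y → |μ x| ≤ B) →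
        (∀ x, blkV1 hN D x ≠ y → μ x = 0) → |Tt μ x'| ≤ (C₁ * (((ℓ : ℝ) + 1) ^ k * |cf|⁻¹) * E) * B := by
    intro x' hx' μ B hB hbd hoff
    have hμ : BlockSupp (g := geomT D) (blkV1 hN D) μ y B := ⟨hB, hbd, hoff⟩
    have h := h1 m K hN D' D hk hk1 hMha hM8 hR2 hP5 hℓ4 hM1 hN1 hcf hw' hw hwb' hwb hww' ν hT3' hT3 y' hy'D y hyD' hy' hy μ B hμ x' hx'
    have e : Tt μ x' = (onFun (GE (domT hN D hk) hcf hw) * DVa ν cf : Module.End ℝ (PBond (PV d ℓ m K hd hL) 0 → ℝ)) μ x'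
        - (onFun (GE (domT hN D' hk) hcf hw') * DVa ν cf : Module.End ℝ (PBond (PV d ℓ m K hd hL) 0 → ℝ)) μ x' := by
      rw [hTt, LinearMap.sub_apply, Pi.sub_apply]
    rw [e, abs_sub_comm]
    refine h.trans ?_
    rw [hleny', hmin, hΩ]
    calc C₁ * (((ℓ : ℝ) + 1) ^ k * |cf|⁻¹ * B) * Real.exp (-(δ₁ * m₀)) * Real.exp (-(δ₁ * dOmega D D' y.1.2 y'.1.2))
        = C₁ * (((ℓ : ℝ) + 1) ^ k * |cf|⁻¹) * B * (Real.exp (-(δ₁ * m₀)) * Real.exp (-(δ₁ * dOmega D D' y.1.2 y'.1.2))) := by ring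
      _ ≤ C₁ * (((ℓ : ℝ) + 1) ^ k * |cf|⁻¹) * B * E := mul_le_mul_of_nonneg_left hE1 (mul_nonneg (mul_nonneg hC₁.le hκ0) hB)
      _ = _ := by ring
  have hK : 0 ≤ C₂ * (((ℓ : ℝ) + 1) ^ k * |cf|⁻¹) * E := mul_nonneg (mul_nonneg hC₂.le hκ0) hE0
  have hK' : 0 ≤ C₁ * (((ℓ : ℝ) + 1) ^ k * |cf|⁻¹) * E := mul_nonneg (mul_nonneg hC₁.le hκ0) hE0
  have hS := sum_sq_le_of_blockBounds (blkV1 hN D) (blkV1 hN D') T Tt y y' hK hK' htr hrow hcol ζ J hζ hζs hJ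
  have e : ∀ x, ζ x * ((DV ν cf ∘ₗ onFun (GE (domT hN D hk) hcf hw)) J x - (DV ν cf ∘ₗ onFun (GE (domT hN D' hk) hcf hw')) J x)
      = ζ x * T J x := by
    intro x
    rw [hT, LinearMap.sub_apply, Pi.sub_apply]
  have hCC : C₂ * (((ℓ : ℝ) + 1) ^ k * |cf|⁻¹) * E * (C₁ * (((ℓ : ℝ) + 1) ^ k * |cf|⁻¹) * E)
      = (Real.sqrt (C₂ * C₁) * (((ℓ : ℝ) + 1) ^ k * |cf|⁻¹) * E) ^ 2 := by
    rw [mul_pow, mul_pow, Real.sq_sqrt (mul_pos hC₂ hC₁).le]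
    ring
  calc ∑ x, (ζ x * ((DV ν cf ∘ₗ onFun (GE (domT hN D hk) hcf hw)) J x - (DV ν cf ∘ₗ onFun (GE (domT hN D' hk) hcf hw')) J x)) ^ 2
      = ∑ x, (ζ x * T J x) ^ 2 := Finset.sum_congr rfl fun x _ => by rw [e x]
    _ ≤ s ^ 2 * (C₂ * (((ℓ : ℝ) + 1) ^ k * |cf|⁻¹) * E * (C₁ * (((ℓ : ℝ) + 1) ^ k * |cf|⁻¹) * E)) * ∑ x, J x ^ 2 := hS
    _ = (Real.sqrt (C₂ * C₁) * (((ℓ : ℝ) + 1) ^ k * |cf|⁻¹) * E * s) ^ 2 * ∑ x, J x ^ 2 := by rw [hCC]; ring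
    _ = _ := by rw [hEdef, hm₀]; ring

/-- **THEOREM 3.14 AT `U = 1` — THE `L²` MEMBER (2.140)₃ (`G∇*`) WITH THE FACTOR (3.154) FOR THE GENUINE `k`-LEVEL `G = Δ_a⁻¹`, MODULO THE ONE-FAMILY
(2.136)₃ MAJORANTS**: `Σ_x (ζ(x)((G[Ω] − G[Ω′])∇*_νJ)(x))² ≤ (C·(L^k|c_f|⁻¹)·e^{−δ·min(d(y,y′),d′(y,y′))}·e^{−δ·d(y,y′,Ω)}·s)²·Σ_x J(x)²` (rows: FILE 4's
member; columns: the transpose `∇_ν(G − G′)` bounded by FILE 2's (2.136)₂ member for the exchanged families).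
[cite: Balaban1985BackgroundPropagators, Thm 3.14 (3.153)–(3.154) pp.426–427; Balaban1984PropagatorsII, Prop. 2.6 (2.140) p.247, (2.136) p.247] -/
theorem thm314_Gdiv_l2_flat_V1_of_majorants (d ℓ : ℕ) (hd : 1 ≤ d + 1) (hL : Odd (ℓ + 1) ∧ 1 < ℓ + 1) {b₀ b₁ : ℝ} (hb₀ : 0 < b₀)
    (hb₁ : b₀ ≤ b₁) {A₃ δ₃ : ℝ} (hA₃ : 0 ≤ A₃) (hδ₃ : 0 < δ₃) :
    ∃ δ C M₀ : ℝ, ∃ N₀ : ℕ, 0 < δ ∧ 0 < C ∧ 0 < M₀ ∧ 0 < N₀ ∧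
      ∀ (m K : ℕ) {Mh k R : ℕ} {P' : Fin (d + 1) → ℕ}
        (hN : ∀ μ, N0 ℓ Mh k P' μ = (PV d ℓ m K hd hL).sitesPerDir 0) (D D' : TDomains d ℓ Mh k P' R) (hk : k ≤ m + K),
        1 ≤ k → ∀ {a : ℕ}, Mh = (ℓ + 1) ^ a → 8 ≤ Mh → 2 * (ℓ + 1) ^ 2 ≤ R → (∀ μ, 5 * (ℓ + 1) ≤ P' μ) → 4 ≤ ℓ →
        M₀ ≤ ((ℓ : ℝ) + 1) * Mh → N₀ + 1 ≤ R * ((ℓ + 1) * Mh) →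
        ∀ {cf : ℝ} (hcf : cf ≠ 0) {w : BondIdx (domT hN D hk) → ℝ} (hw : ∀ i, 0 < w i)
          {w' : BondIdx (domT hN D' hk) → ℝ} (hw' : ∀ i', 0 < w' i'),
        GlobalBand b₀ b₁ cf w → GlobalBand b₀ b₁ cf w' →
        (∀ (i : BondIdx (domT hN D hk)) (i' : BondIdx (domT hN D' hk)), i.1 = i'.1 → w i = w' i') →
        ∀ (ν : Fin (d + 1)),
        HasMajorant (g := geomT D) (blkV1 hN D) (onFun (GE (domT hN D hk) hcf hw) * DVa ν cf)
          (fun a b => A₃ * ((geomT D).len a * |cf|⁻¹) * Real.exp (-(δ₃ * (geomT D).dist a b))) →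
        HasMajorant (g := geomT D') (blkV1 hN D') (onFun (GE (domT hN D' hk) hcf hw') * DVa ν cf)
          (fun a b => A₃ * ((geomT D').len a * |cf|⁻¹) * Real.exp (-(δ₃ * (geomT D').dist a b))) →
        ∀ (y : ↥(bset D.toDomains)) (hyD' : y.1 ∈ bset D'.toDomains) (y' : ↥(bset D'.toDomains)) (hy'D : y'.1 ∈ bset D.toDomains),
        y.1.1 = k → y'.1.1 = k →
        ∀ (ζ J : PBond (PV d ℓ m K hd hL) 0 → ℝ) (s : ℝ), (∀ x, blkV1 hN D x ≠ y → ζ x = 0) → (∀ x, |ζ x| ≤ s) →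
        (∀ x, blkV1 hN D' x ≠ y' → J x = 0) →
          ∑ x, (ζ x * ((onFun (GE (domT hN D hk) hcf hw) * DVa ν cf : Module.End ℝ (PBond (PV d ℓ m K hd hL) 0 → ℝ)) J x
              - (onFun (GE (domT hN D' hk) hcf hw') * DVa ν cf : Module.End ℝ (PBond (PV d ℓ m K hd hL) 0 → ℝ)) J x)) ^ 2
            ≤ (C * (((ℓ : ℝ) + 1) ^ k * |cf|⁻¹)
                * Real.exp (-(δ * min ((geomT D).dist y ⟨y'.1, hy'D⟩) ((geomT D').dist ⟨y.1, hyD'⟩ y')))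
                * Real.exp (-(δ * dOmega D D' y.1.2 y'.1.2)) * s) ^ 2 * ∑ x, J x ^ 2 := by
  obtain ⟨δ₂, C₂, M₂, N₂, hδ₂, hC₂, hM₂, hN₂, h2⟩ := thm314_gradG_flat_V1 d ℓ hd hL hb₀ hb₁
  obtain ⟨δ₁, C₁, M₁, N₁, hδ₁, hC₁, hM₁, hN₁, h1⟩ := thm314_Gdiv_flat_V1_of_majorants d ℓ hd hL hb₀ hb₁ hA₃ hδ₃
  refine ⟨min δ₂ δ₁, Real.sqrt (C₁ * C₂), max M₂ M₁, max N₂ N₁, lt_min hδ₂ hδ₁, Real.sqrt_pos.2 (mul_pos hC₁ hC₂),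
    lt_max_of_lt_left hM₂, lt_max_of_lt_left hN₂, ?_⟩
  intro m K Mh k R P' hN D D' hk hk1 a hMha hM8 hR2 hP5 hℓ4 hM hRN cf hcf w hw w' hw' hwb hwb' hww ν hT3 hT3' y hyD' y' hy'D hy hy' ζ J s hζ hζs hJ
  have hMh1 : 1 ≤ Mh := by omega
  have hP1 : ∀ μ, 1 ≤ P' μ := fun μ => le_trans (by omega) (hP5 μ)
  have hκ0 : 0 ≤ ((ℓ : ℝ) + 1) ^ k * |cf|⁻¹ := by positivity
  have hd0 : ∀ u t : ↥(bset D.toDomains), 0 ≤ (geomT D).dist u t := (triangle_refl_nonneg_T D hMh1 hP1).2.2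
  have hd0' : ∀ u t : ↥(bset D'.toDomains), 0 ≤ (geomT D').dist u t := (triangle_refl_nonneg_T D' hMh1 hP1).2.2
  have hM2 : M₂ ≤ ((ℓ : ℝ) + 1) * Mh := (le_max_left _ _).trans hM
  have hM1 : M₁ ≤ ((ℓ : ℝ) + 1) * Mh := (le_max_right _ _).trans hM
  have hN2 : N₂ + 1 ≤ R * ((ℓ + 1) * Mh) := le_trans (Nat.succ_le_succ (le_max_left _ _)) hRN
  have hN1 : N₁ + 1 ≤ R * ((ℓ + 1) * Mh) := le_trans (Nat.succ_le_succ (le_max_right _ _)) hRN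
  have hww' : ∀ (i' : BondIdx (domT hN D' hk)) (i : BondIdx (domT hN D hk)), i'.1 = i.1 → w' i' = w i :=
    fun i' i h => (hww i i' h.symm).symm
  set m₀ : ℝ := min ((geomT D).dist y ⟨y'.1, hy'D⟩) ((geomT D').dist ⟨y.1, hyD'⟩ y') with hm₀
  have hm₀0 : 0 ≤ m₀ := le_min (hd0 _ _) (hd0' _ _)
  have hmin : min ((geomT D').dist y' ⟨y.1, hyD'⟩) ((geomT D).dist ⟨y'.1, hy'D⟩ y) = m₀ := by
    rw [hm₀, symmT D' y' ⟨y.1, hyD'⟩, symmT D ⟨y'.1, hy'D⟩ y, min_comm]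
  have hΩ : dOmega D' D y'.1.2 y.1.2 = dOmega D D' y.1.2 y'.1.2 := by rw [dOmega_swap D D', dOmega_comm D D']
  have hleny : (geomT D).len y = ((ℓ : ℝ) + 1) ^ k := len_of_top D hy
  have hleny' : (geomT D').len y' = ((ℓ : ℝ) + 1) ^ k := len_of_top D' hy'
  have hE : ∀ {ρ : ℝ}, min δ₂ δ₁ ≤ ρ → ∀ {t : ℝ}, 0 ≤ t → Real.exp (-(ρ * t)) ≤ Real.exp (-(min δ₂ δ₁ * t)) :=
    fun hρ t ht => Real.exp_le_exp.2 (neg_le_neg (mul_le_mul_of_nonneg_right hρ ht))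
  set E : ℝ := Real.exp (-(min δ₂ δ₁ * m₀)) * Real.exp (-(min δ₂ δ₁ * dOmega D D' y.1.2 y'.1.2)) with hEdef
  have hE0 : 0 ≤ E := mul_nonneg (Real.exp_pos _).le (Real.exp_pos _).le
  have hE2 : Real.exp (-(δ₂ * m₀)) * Real.exp (-(δ₂ * dOmega D D' y.1.2 y'.1.2)) ≤ E :=
    mul_le_mul (hE (min_le_left _ _) hm₀0) (hE (min_le_left _ _) (B9Thm314GpFlatTorusGeometry.dOmega_nonneg D D' _ _))
      (Real.exp_pos _).le (Real.exp_pos _).le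
  have hE1 : Real.exp (-(δ₁ * m₀)) * Real.exp (-(δ₁ * dOmega D D' y.1.2 y'.1.2)) ≤ E :=
    mul_le_mul (hE (min_le_right _ _) hm₀0) (hE (min_le_right _ _) (B9Thm314GpFlatTorusGeometry.dOmega_nonneg D D' _ _))
      (Real.exp_pos _).le (Real.exp_pos _).le
  -- rows: FILE 4's (2.136)₃ member for `(Ω, Ω′)`
  set T : Module.End ℝ (PBond (PV d ℓ m K hd hL) 0 → ℝ) :=
    onFun (GE (domT hN D hk) hcf hw) * DVa ν cf - onFun (GE (domT hN D' hk) hcf hw') * DVa ν cf with hT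
  have hrow : ∀ x : PBond (PV d ℓ m K hd hL) 0, blkV1 hN D x = y →
      ∀ (μ : PBond (PV d ℓ m K hd hL) 0 → ℝ) (B : ℝ), 0 ≤ B → (∀ x', blkV1 hN D' x' = y' → |μ x'| ≤ B) →
        (∀ x', blkV1 hN D' x' ≠ y' → μ x' = 0) → |T μ x| ≤ (C₁ * (((ℓ : ℝ) + 1) ^ k * |cf|⁻¹) * E) * B := by
    intro x hx μ B hB hbd hoff
    have hμ : BlockSupp (g := geomT D') (blkV1 hN D') μ y' B := ⟨hB, hbd, hoff⟩
    have h := h1 m K hN D D' hk hk1 hMha hM8 hR2 hP5 hℓ4 hM1 hN1 hcf hw hw' hwb hwb' hww ν hT3 hT3' y hyD' y' hy'D hy hy' μ B hμ x hx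
    have e : T μ x = (onFun (GE (domT hN D hk) hcf hw) * DVa ν cf : Module.End ℝ (PBond (PV d ℓ m K hd hL) 0 → ℝ)) μ x
        - (onFun (GE (domT hN D' hk) hcf hw') * DVa ν cf : Module.End ℝ (PBond (PV d ℓ m K hd hL) 0 → ℝ)) μ x := by
      rw [hT, LinearMap.sub_apply, Pi.sub_apply]
    rw [e]
    refine h.trans ?_
    rw [hleny, ← hm₀]
    calc C₁ * (((ℓ : ℝ) + 1) ^ k * |cf|⁻¹ * B) * Real.exp (-(δ₁ * m₀)) * Real.exp (-(δ₁ * dOmega D D' y.1.2 y'.1.2))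
        = C₁ * (((ℓ : ℝ) + 1) ^ k * |cf|⁻¹) * B * (Real.exp (-(δ₁ * m₀)) * Real.exp (-(δ₁ * dOmega D D' y.1.2 y'.1.2))) := by ring
      _ ≤ C₁ * (((ℓ : ℝ) + 1) ^ k * |cf|⁻¹) * B * E := mul_le_mul_of_nonneg_left hE1 (mul_nonneg (mul_nonneg hC₁.le hκ0) hB)
      _ = _ := by ring
  -- columns: the transpose `∇_ν(G − G′)`, FILE 2's member for `(Ω′, Ω)`
  set Tt : Module.End ℝ (PBond (PV d ℓ m K hd hL) 0 → ℝ) :=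
    DV ν cf ∘ₗ onFun (GE (domT hN D hk) hcf hw) - DV ν cf ∘ₗ onFun (GE (domT hN D' hk) hcf hw') with hTt
  have htr : ∀ x x' : PBond (PV d ℓ m K hd hL) 0, Tt (Pi.single x 1) x' = T (Pi.single x' 1) x := by
    intro x x'
    rw [hTt, hT, LinearMap.sub_apply, Pi.sub_apply, LinearMap.sub_apply, Pi.sub_apply, Module.End.mul_eq_comp, Module.End.mul_eq_comp,
      onFun_DV_GE_single_transpose (domT hN D hk) hcf hw ν cf x x', onFun_DV_GE_single_transpose (domT hN D' hk) hcf hw' ν cf x x']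
  have hcol : ∀ x' : PBond (PV d ℓ m K hd hL) 0, blkV1 hN D' x' = y' →
      ∀ (μ : PBond (PV d ℓ m K hd hL) 0 → ℝ) (B : ℝ), 0 ≤ B → (∀ x, blkV1 hN D x = y → |μ x| ≤ B) →
        (∀ x, blkV1 hN D x ≠ y → μ x = 0) → |Tt μ x'| ≤ (C₂ * (((ℓ : ℝ) + 1) ^ k * |cf|⁻¹) * E) * B := by
    intro x' hx' μ B hB hbd hoff
    have hμ : BlockSupp (g := geomT D) (blkV1 hN D) μ y B := ⟨hB, hbd, hoff⟩
    have h := h2 m K hN D' D hk hk1 hMha hM8 hR2 hP5 hℓ4 hM2 hN2 hcf hw' hw hwb' hwb hww' y' hy'D y hyD' hy' hy μ B hμ ν x' hx'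
    have e : Tt μ x' = (DV ν cf ∘ₗ onFun (GE (domT hN D hk) hcf hw)) μ x' - (DV ν cf ∘ₗ onFun (GE (domT hN D' hk) hcf hw')) μ x' := by
      rw [hTt, LinearMap.sub_apply, Pi.sub_apply]
    rw [e, abs_sub_comm]
    refine h.trans ?_
    rw [hleny', hmin, hΩ]
    calc C₂ * (((ℓ : ℝ) + 1) ^ k * |cf|⁻¹ * B) * Real.exp (-(δ₂ * m₀)) * Real.exp (-(δ₂ * dOmega D D' y.1.2 y'.1.2))
        = C₂ * (((ℓ : ℝ) + 1) ^ k * |cf|⁻¹) * B * (Real.exp (-(δ₂ * m₀)) * Real.exp (-(δ₂ * dOmega D D' y.1.2 y'.1.2))) := by ring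
      _ ≤ C₂ * (((ℓ : ℝ) + 1) ^ k * |cf|⁻¹) * B * E := mul_le_mul_of_nonneg_left hE2 (mul_nonneg (mul_nonneg hC₂.le hκ0) hB)
      _ = _ := by ring
  have hK : 0 ≤ C₁ * (((ℓ : ℝ) + 1) ^ k * |cf|⁻¹) * E := mul_nonneg (mul_nonneg hC₁.le hκ0) hE0
  have hK' : 0 ≤ C₂ * (((ℓ : ℝ) + 1) ^ k * |cf|⁻¹) * E := mul_nonneg (mul_nonneg hC₂.le hκ0) hE0
  have hS := sum_sq_le_of_blockBounds (blkV1 hN D) (blkV1 hN D') T Tt y y' hK hK' htr hrow hcol ζ J hζ hζs hJ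
  have e : ∀ x, ζ x * ((onFun (GE (domT hN D hk) hcf hw) * DVa ν cf : Module.End ℝ (PBond (PV d ℓ m K hd hL) 0 → ℝ)) J x
      - (onFun (GE (domT hN D' hk) hcf hw') * DVa ν cf : Module.End ℝ (PBond (PV d ℓ m K hd hL) 0 → ℝ)) J x) = ζ x * T J x := by
    intro x
    rw [hT, LinearMap.sub_apply, Pi.sub_apply]
  have hCC : C₁ * (((ℓ : ℝ) + 1) ^ k * |cf|⁻¹) * E * (C₂ * (((ℓ : ℝ) + 1) ^ k * |cf|⁻¹) * E)
      = (Real.sqrt (C₁ * C₂) * (((ℓ : ℝ) + 1) ^ k * |cf|⁻¹) * E) ^ 2 := by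
    rw [mul_pow, mul_pow, Real.sq_sqrt (mul_pos hC₁ hC₂).le]
    ring
  calc ∑ x, (ζ x * ((onFun (GE (domT hN D hk) hcf hw) * DVa ν cf : Module.End ℝ (PBond (PV d ℓ m K hd hL) 0 → ℝ)) J x
          - (onFun (GE (domT hN D' hk) hcf hw') * DVa ν cf : Module.End ℝ (PBond (PV d ℓ m K hd hL) 0 → ℝ)) J x)) ^ 2
      = ∑ x, (ζ x * T J x) ^ 2 := Finset.sum_congr rfl fun x _ => by rw [e x]
    _ ≤ s ^ 2 * (C₁ * (((ℓ : ℝ) + 1) ^ k * |cf|⁻¹) * E * (C₂ * (((ℓ : ℝ) + 1) ^ k * |cf|⁻¹) * E)) * ∑ x, J x ^ 2 := hS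
    _ = (Real.sqrt (C₁ * C₂) * (((ℓ : ℝ) + 1) ^ k * |cf|⁻¹) * E * s) ^ 2 * ∑ x, J x ^ 2 := by rw [hCC]; ring
    _ = _ := by rw [hEdef, hm₀]; ring

end Members

end Literature.MathematicalPhysics.QuantumFieldTheory.Balaban1983to89.B9Thm314GFlatV1DivTransfer

end
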